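import Mathlib
import Literature.Probability.RandomMatrix.TwoQubitSeparabilityVolumes
import HarnessLib

/-!
# Proof of the two-qubit fibre separability probability `8/33`
# (discharge of `ZhangJiangXie2025_qubit_fibre_separability_probability`)

We prove, sorry-free, the named fact of
`Literature/Probability/RandomMatrix/TwoQubitSeparabilityVolumes.lean`:

  `33 * volume {x : Fin 12 → ℝ | ρ(x) ≥ 0 ∧ ½·1 − ρ(x) ≥ 0} = 8 * volume {x | ρ(x) ≥ 0}`,

`ρ(x) = qubitFibreMatrix x` the two-qubit states with maximally mixed marginal in the entry
chart (Zhang–Jiang–Xie 2025, Thm. 6.12 with Props. 6.7, 6.9, 6.10; Huong–Khoi 2024; the fibre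
version of Milz–Strunz / Lovas–Andai). In fact we compute both volumes:
`vol K = π⁵/1238630400`, `vol K' = π⁵/5109350400` (`volume_Kset_value`, `volume_K'set_value`).

## The proof formalized here (elementary; NOT the Duistermaat–Heckman route of the source)

Write `ρ = [[P, Z], [Zᴴ, Q]]` with `Q = ½ − P` (`2 × 2` blocks) and `ρ' := ½ − ρ = [[Q, −Z], [−Zᴴ, P]]`.
1. (Schur) For `P, Q > 0`: `ρ ≥ 0 ⟺ Q − Zᴴ P⁻¹ Z ≥ 0`, `ρ' ≥ 0 ⟺ P − Zᴴ Q⁻¹ Z ≥ 0`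
   (`Matrix.PosDef.fromBlocks₁₁`).
2. (Diagonal frame) `P = U Λ U*` (spectral theorem); conjugating the block matrix by `diag(U, U)`
   and substituting `Z' = U* Z U` (an isometry of `ℂ^{2×2} ≅ ℝ⁸`, hence measure preserving:
   `measurePreserving_TU`), then scaling `w_ij = z'_ij / √(λ_i (½ − λ_j))`, the `Z`-section of
   `K` becomes the operator-norm unit ball `B = {W : 1 − WᴴW ≥ 0}` and that of `K'` becomes
   `B ∩ B_μ`, `B_μ = {W : 1 − (DWD⁻¹)ᴴ(DWD⁻¹) ≥ 0}`, `D = diag(μ)`, `μ_i² = λ_i/(½ − λ_i)`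
   (`volume_fibre_one`, `volume_fibre_two`; the Jacobian is `(det P det Q)²`).
3. (**Key Lemma**, `volume_Ebody_eq`) `vol₈(B ∩ B_μ) = (π⁴/36) ε² (4 − ε²)`, `ε² = min(q², q⁻²)`,
   `q = μ₀/μ₁`; in particular `vol₈(B) = π⁴/12`. Proof: for `W = [[a, b], [c, d]]` and fixed
   `(b, c, d)`, `|d| < 1`, the set of admissible `a` is a closed DISC with centre `−d̄bc/(1−|d|²)`
   for `B` and for `B_μ` alike (the two discs are concentric since `bc` is invariant under
   `(b, c) ↦ (qb, c/q)`); its squared radius is `(u−|b|²)(u−|c|²)/u²`, `u = 1 − |d|²`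
   (`volume_section`, using the `2 × 2` criterion `posSemidef_fin_two_iff` and a Cauchy–Schwarz
   step). Three radial integrations (`lintegral_comp_normSq`) and a rescaling leave the double
   integral `J(q) = ∫∫ min((1−σ)(1−τ), (1−q²σ)(1−τ/q²))` which is `ε²(4−ε²)/12` (`Jint_eq`).
   This is Lovas–Andai's function `χ̃₂` (J. Phys. A 50 (2017) 295303, Def. 1), whose closed form
   `χ̃₂(ε) = ε²(4 − ε²)/3` they left open.
4. (Outer integral) In the coordinates `t = (x₀+x₁)/2`, `r = √(((x₀−x₁)/2)² + x₂² + x₃²)`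
   (eigenvalues `t ± r` of `P`) Lebesgue measure on `ℝ⁴` pushes to `8π r² dt dr`
   (`lintegral_tr`: a linear change of variables, polar coordinates in `ℂ`, two 1-D
   substitutions, Tonelli). The densities are polynomials on `{r < t, t + r < ½}`:
   `(π⁴/12)((t²−r²)((½−t)²−r²))²` resp. `(π⁴/36)(4(t−r)³(t+r)(½−t+r)(½−t−r)³ − (t−r)⁴(½−t−r)⁴)`,
   and the two polynomial double integrals are `1/825753600` and `1/1135411200`
   (`lintegral_K1`, `lintegral_K2`, by termwise integration of monomial sums).
5. `33 · π⁵/5109350400 = 8 · π⁵/1238630400` (`main_identity`).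
Null sets (`det P = 0`, `det Q = 0`, `|d| = 1`) are handled explicitly (`volume_graph_eq_zero`,
`Measure.addHaar_sphere`); all integrals are `lintegral`s of nonnegative functions (Tonelli only).

## References

* [ZhangJiangXie2025] L. Zhang, X. Jiang, B. Xie, *One application of Duistermaat–Heckman measure
  in quantum information theory*, Quantum Inf. Comput. 25 (2025) 598–632, §6: Props. 6.7, 6.9,
  6.10, Thm. 6.12 (the statement discharged here). arXiv:2507.02369.
* [HuongKhoi2024] H. T. Huong, V. T. Khoi, J. Phys. A 57 (2024) 445304 (the value `8/33`).
* [LovasAndai2017] A. Lovas, A. Andai, J. Phys. A 50 (2017) 295303, §2 (Lemma 1: Schur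
  complement; Def. 1: the function `χ_d`; the structure of the argument in step 2–3).
-/

noncomputable section

open _root_.MeasureTheory Set Real
open scoped ENNReal ComplexConjugate ComplexOrder Matrix
open Complex Matrix

namespace Literature.Probability.RandomMatrix

namespace ZhangJiangXie2025

/-! ## F1. The 2×2 PSD criterion -/

/-- The quadratic form of the Hermitian `2 × 2` matrix `!![a, m; conj m, e]` (`a e : ℝ`). [folklore] -/
theorem quadForm_fin_two (a e : ℝ) (m : ℂ) (x : Fin 2 → ℂ) :
    star x ⬝ᵥ (!![(a : ℂ), m; conj m, (e : ℂ)] *ᵥ x) =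
      ((a * normSq (x 0) + e * normSq (x 1) + 2 * (m * conj (x 0) * x 1).re : ℝ) : ℂ) := by
  simp only [dotProduct, mulVec, Fin.sum_univ_two, Pi.star_apply, Matrix.cons_val',
    Matrix.cons_val_zero, Matrix.cons_val_one, Matrix.empty_val', Matrix.cons_val_fin_one,
    Matrix.of_apply]
  apply Complex.ext <;> simp [Complex.normSq_apply] <;> ring

/-- `!![a, m; conj m, e]` (`a e : ℝ`) is Hermitian. [folklore] -/
theorem isHermitian_fin_two (a e : ℝ) (m : ℂ) :
    (!![(a : ℂ), m; conj m, (e : ℂ)]).IsHermitian := by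
  refine Matrix.IsHermitian.ext fun i j => ?_
  fin_cases i <;> fin_cases j <;> simp

/-- A Hermitian `2 × 2` complex matrix is `!![a, m; conj m, e]` with `a e` real. [folklore] -/
theorem eq_of_isHermitian_fin_two {M : Matrix (Fin 2) (Fin 2) ℂ} (hM : M.IsHermitian) :
    M = !![((M 0 0).re : ℂ), M 0 1; conj (M 0 1), ((M 1 1).re : ℂ)] := by
  have h00 : conj (M 0 0) = M 0 0 := by simpa using congrFun (congrFun hM 0) 0
  have h11 : conj (M 1 1) = M 1 1 := by simpa using congrFun (congrFun hM 1) 1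
  have h10 : conj (M 0 1) = M 1 0 := by simpa using congrFun (congrFun hM 1) 0
  ext i j
  fin_cases i <;> fin_cases j
  · exact (Complex.conj_eq_iff_re.mp h00).symm
  · rfl
  · exact h10.symm
  · exact (Complex.conj_eq_iff_re.mp h11).symm

/-- The real quadratic form `a|x₀|² + e|x₁|² + 2 Re(m x̄₀ x₁)` is nonnegative when `a, e ≥ 0` and
`|m|² ≤ a e`. [folklore] -/
theorem quadForm_nonneg {a e : ℝ} {m : ℂ} (h0 : 0 ≤ a) (h1 : 0 ≤ e) (h2 : normSq m ≤ a * e)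
    (x0 x1 : ℂ) : 0 ≤ a * normSq x0 + e * normSq x1 + 2 * (m * conj x0 * x1).re := by
  set w := m * conj x0 * x1 with hw
  have hA : 0 ≤ a * normSq x0 := mul_nonneg h0 (normSq_nonneg _)
  have hE : 0 ≤ e * normSq x1 := mul_nonneg h1 (normSq_nonneg _)
  have hwre : w.re ^ 2 ≤ normSq w := by
    rw [Complex.normSq_apply]; nlinarith [sq_nonneg w.im]
  have hwn : normSq w = normSq m * normSq x0 * normSq x1 := by
    rw [hw, normSq_mul, normSq_mul, normSq_conj]
  have hkey : (2 * w.re) ^ 2 ≤ (a * normSq x0 + e * normSq x1) ^ 2 := by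
    have h3 : normSq m * (normSq x0 * normSq x1) ≤ a * e * (normSq x0 * normSq x1) :=
      mul_le_mul_of_nonneg_right h2 (mul_nonneg (normSq_nonneg _) (normSq_nonneg _))
    nlinarith [sq_nonneg (a * normSq x0 - e * normSq x1)]
  nlinarith [hkey, hA, hE]

/-- **PSD criterion for `!![a, m; conj m, e]`** (`a e : ℝ`): `0 ≤ a`, `0 ≤ e`, `|m|² ≤ a e`. [folklore] -/
theorem posSemidef_fin_two_iff' (a e : ℝ) (m : ℂ) :
    (!![(a : ℂ), m; conj m, (e : ℂ)]).PosSemidef ↔ 0 ≤ a ∧ 0 ≤ e ∧ normSq m ≤ a * e := by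
  rw [posSemidef_iff_dotProduct_mulVec]
  simp only [quadForm_fin_two, Complex.zero_le_real]
  constructor
  · rintro ⟨-, h⟩
    have h0 := h ![1, 0]
    have h1 := h ![0, 1]
    simp at h0 h1
    refine ⟨h0, h1, ?_⟩
    rcases h0.lt_or_eq with ha0 | ha0
    · have h2 := h ![-m, (a : ℂ)]
      simp [Complex.normSq_apply] at h2
      have h3 : 0 ≤ a * (a * e - normSq m) := by
        rw [Complex.normSq_apply]; nlinarith [h2]
      have h4 := (mul_nonneg_iff_of_pos_left ha0).mp h3
      linarith
    · rw [← ha0, zero_mul]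
      by_contra hne
      have hpos : 0 < normSq m := lt_of_not_ge hne
      set s : ℝ := (e + 1) / (2 * normSq m) with hs
      have h2 := h ![-((s : ℂ) * m), 1]
      simp at h2
      have hre : m.im * (s * m.im) + m.re * (s * m.re) = s * normSq m := by
        rw [Complex.normSq_apply]; ring
      have hval : s * normSq m = (e + 1) / 2 := by
        rw [hs]; field_simp
      rw [← ha0] at h2
      nlinarith [h2, hre, hval, normSq_nonneg ((s : ℂ) * m)]
  · rintro ⟨h0, h1, h2⟩
    exact ⟨isHermitian_fin_two a e m, fun x => quadForm_nonneg h0 h1 h2 (x 0) (x 1)⟩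

/-- **PSD criterion for `2 × 2` Hermitian complex matrices**: nonnegative diagonal and
nonnegative determinant `M₀₀ M₁₁ - |M₀₁|²`. [folklore] -/
theorem posSemidef_fin_two_iff {M : Matrix (Fin 2) (Fin 2) ℂ} (hM : M.IsHermitian) :
    M.PosSemidef ↔
      0 ≤ (M 0 0).re ∧ 0 ≤ (M 1 1).re ∧ normSq (M 0 1) ≤ (M 0 0).re * (M 1 1).re := by
  conv_lhs => rw [eq_of_isHermitian_fin_two hM]
  exact posSemidef_fin_two_iff' _ _ _


/-! ## F2–F3. Key Lemma -/

/-- `det (I - WᴴW)` for `W = [[a, b], [c, d]]`. [folklore] -/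
def detN (a b c d : ℂ) : ℝ :=
  1 - (normSq a + normSq b + normSq c + normSq d) + normSq (a * d - b * c)

/-- Membership of `W = [[a, b], [c, d]]` in the operator-norm unit ball, spelled through the
`2 × 2` PSD criterion for `I - WᴴW` (diagonal entries and determinant nonnegative). [folklore] -/
def InB (a b c d : ℂ) : Prop :=
  normSq a + normSq c ≤ 1 ∧ normSq b + normSq d ≤ 1 ∧ 0 ≤ detN a b c d

/-- The polynomial identity behind the disc description of the `a`-sections of the ball:
`u · det + |u a + d̄ b c|² = (u - |b|²)(u - |c|²)`, `u = 1 - |d|²`. [folklore] -/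
theorem detN_identity (a b c d : ℂ) :
    (1 - normSq d) * detN a b c d + normSq ((1 - normSq d : ℝ) * a + conj d * b * c) =
      ((1 - normSq d) - normSq b) * ((1 - normSq d) - normSq c) := by
  simp only [detN, Complex.normSq_apply, Complex.mul_re, Complex.mul_im, Complex.sub_re,
    Complex.sub_im, Complex.add_re, Complex.add_im, Complex.conj_re, Complex.conj_im,
    Complex.ofReal_re, Complex.ofReal_im]
  ring

/-- The common centre `-d̄bc/u` of the `a`-section discs. [folklore] -/
def ctr (b c d : ℂ) : ℂ := -(conj d * b * c) / ((1 - normSq d : ℝ) : ℂ)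

/-- The squared radius `(u-β)(u-γ)/u²` (`u = 1 - δ`) of the `a`-section disc. [folklore] -/
def tRad (β γ δ : ℝ) : ℝ := ((1 - δ) - β) * ((1 - δ) - γ) / (1 - δ) ^ 2

/-- `u² |a - c₀|² = |u a + d̄ b c|²` for the disc centre `c₀ = -d̄bc/u`. [folklore] -/
theorem normSq_sub_ctr (a b c d : ℂ) (hu : 1 - normSq d ≠ 0) :
    (1 - normSq d) ^ 2 * normSq (a - ctr b c d) =
      normSq ((1 - normSq d : ℝ) * a + conj d * b * c) := by
  have hu' : ((1 - normSq d : ℝ) : ℂ) ≠ 0 := by exact_mod_cast hu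
  have : a - ctr b c d = ((1 - normSq d : ℝ) * a + conj d * b * c) / ((1 - normSq d : ℝ) : ℂ) := by
    rw [ctr]; field_simp; ring
  rw [this, normSq_div, Complex.normSq_ofReal]
  field_simp

/-- `u² |c₀|² = |d|² |b|² |c|²` for the disc centre. [folklore] -/
theorem normSq_ctr (b c d : ℂ) (hu : 1 - normSq d ≠ 0) :
    (1 - normSq d) ^ 2 * normSq (ctr b c d) = normSq d * normSq b * normSq c := by
  rw [ctr, normSq_div, normSq_neg, normSq_mul, normSq_mul, normSq_conj, Complex.normSq_ofReal]
  field_simp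

/-- For `u = 1 - |d|² > 0`: `det (I - WᴴW) ≥ 0` iff `a` lies in the closed disc of squared radius
`tRad` about `ctr`. [folklore] -/
theorem detN_nonneg_iff {a b c d : ℂ} (hu : 0 < 1 - normSq d) :
    0 ≤ detN a b c d ↔ normSq (a - ctr b c d) ≤ tRad (normSq b) (normSq c) (normSq d) := by
  have hid := detN_identity a b c d
  rw [← normSq_sub_ctr a b c d hu.ne'] at hid
  rw [tRad, le_div_iff₀ (by positivity)]
  constructor
  · intro h; nlinarith
  · intro h; nlinarith

/-- Upper inclusion: a point of the ball lies in the section disc. [folklore] -/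
theorem normSq_sub_ctr_le_of_inB {a b c d : ℂ} (hu : 0 < 1 - normSq d) (h : InB a b c d) :
    normSq (a - ctr b c d) ≤ tRad (normSq b) (normSq c) (normSq d) :=
  (detN_nonneg_iff hu).mp h.2.2

/-- Lower inclusion (Cauchy–Schwarz step): under the thresholds `β, γ ≤ u`, the whole section
disc lies in the ball. [folklore] -/
theorem inB_of_normSq_sub_ctr_le {a b c d : ℂ} (hu : 0 < 1 - normSq d)
    (hβ : normSq b ≤ 1 - normSq d) (hγ : normSq c ≤ 1 - normSq d)
    (ha : normSq (a - ctr b c d) ≤ tRad (normSq b) (normSq c) (normSq d)) : InB a b c d := by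
  refine ⟨?_, by linarith, (detN_nonneg_iff hu).mpr ha⟩
  -- notation
  set u := 1 - normSq d with hu_def
  set β := normSq b
  set γ := normSq c
  set δ := normSq d
  have hδ : δ = 1 - u := by rw [hu_def]; ring
  have hδ0 : 0 ≤ δ := normSq_nonneg d
  have hβ0 : 0 ≤ β := normSq_nonneg b
  have hγ0 : 0 ≤ γ := normSq_nonneg c
  set v := a - ctr b c d with hv
  set p := ‖ctr b c d‖ with hp
  set s := ‖v‖ with hs
  have hp0 : 0 ≤ p := norm_nonneg _
  have hs0 : 0 ≤ s := norm_nonneg _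
  -- P = p², T ≥ s²
  have hP : u ^ 2 * p ^ 2 = δ * β * γ := by
    rw [hp, ← Complex.normSq_eq_norm_sq]; exact normSq_ctr b c d hu.ne'
  have hT : u ^ 2 * s ^ 2 ≤ (u - β) * (u - γ) := by
    rw [hs, ← Complex.normSq_eq_norm_sq]
    have := ha; rw [tRad, le_div_iff₀ (by positivity)] at this; linarith
  -- M
  set M := (δ * γ * (u - β) + (u - γ) * β) / u ^ 2 with hM
  have hM0 : 0 ≤ M := by
    rw [hM]; apply div_nonneg _ (by positivity)
    have : 0 ≤ u - β := by linarith
    have : 0 ≤ u - γ := by linarith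
    positivity
  have h2ps : 2 * p * s ≤ M := by
    have h4 : (2 * p * s) ^ 2 ≤ M ^ 2 := by
      have hu2 : 0 < u ^ 2 := by positivity
      -- multiply through by u⁴
      have key : u ^ 4 * (2 * p * s) ^ 2 ≤ u ^ 4 * M ^ 2 := by
        have e1 : u ^ 4 * (2 * p * s) ^ 2 = 4 * (u ^ 2 * p ^ 2) * (u ^ 2 * s ^ 2) := by ring
        have e2 : u ^ 4 * M ^ 2 = (δ * γ * (u - β) + (u - γ) * β) ^ 2 := by
          rw [hM]; field_simp
        rw [e1, e2, hP]
        have hX : 0 ≤ δ * β * γ := by positivity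
        calc 4 * (δ * β * γ) * (u ^ 2 * s ^ 2) ≤ 4 * (δ * β * γ) * ((u - β) * (u - γ)) :=
              mul_le_mul_of_nonneg_left hT (by positivity)
          _ ≤ (δ * γ * (u - β) + (u - γ) * β) ^ 2 := by
              nlinarith [sq_nonneg (δ * γ * (u - β) - (u - γ) * β)]
      exact le_of_mul_le_mul_left key (by positivity)
    exact (sq_le_sq₀ (by positivity) hM0).mp h4
  have hsum : p ^ 2 + s ^ 2 + M ≤ 1 - γ := by
    have hT' : s ^ 2 ≤ (u - β) * (u - γ) / u ^ 2 := by
      rw [le_div_iff₀ (by positivity)]; linarith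
    have hP' : p ^ 2 = δ * β * γ / u ^ 2 := by
      rw [eq_div_iff (by positivity)]; linarith
    have hid : δ * β * γ / u ^ 2 + (u - β) * (u - γ) / u ^ 2 + M = 1 - γ := by
      rw [hM, hδ]; field_simp; ring
    linarith
  -- conclude
  have hnorm : ‖a‖ ≤ p + s := by
    have : a = ctr b c d + v := by rw [hv]; ring
    rw [this]; exact norm_add_le _ _
  have : normSq a ≤ (p + s) ^ 2 := by
    rw [Complex.normSq_eq_norm_sq]
    exact pow_le_pow_left₀ (norm_nonneg _) hnorm 2
  nlinarith


/-! ### Volume of the `a`-sections of `B ∩ B_μ` -/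

/-- `|q b|² = q² |b|²` for real `q`. [folklore] -/
theorem normSq_real_mul (q : ℝ) (b : ℂ) : normSq ((q : ℂ) * b) = q ^ 2 * normSq b := by
  rw [normSq_mul, Complex.normSq_ofReal]; ring

/-- `|c / q|² = |c|² / q²` for real `q`. [folklore] -/
theorem normSq_div_real (q : ℝ) (c : ℂ) : normSq (c / (q : ℂ)) = normSq c / q ^ 2 := by
  rw [normSq_div, Complex.normSq_ofReal]; ring

/-- The disc centre is invariant under `(b, c) ↦ (q b, c / q)`. [folklore] -/
theorem ctr_scaled {q : ℝ} (hq : q ≠ 0) (b c d : ℂ) :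
    ctr ((q : ℂ) * b) (c / (q : ℂ)) d = ctr b c d := by
  have hq' : (q : ℂ) ≠ 0 := by exact_mod_cast hq
  unfold ctr
  rw [show conj d * ((q : ℂ) * b) * (c / (q : ℂ)) = conj d * b * c by field_simp]

/-- The thresholds under which the `a`-section of `B ∩ B_μ` over `(b, c, d)` is a non-degenerate
disc (`β = |b|²`, `γ = |c|²`, `δ = |d|²`, `u = 1 - δ`). [folklore] -/
def Thr (q β γ δ : ℝ) : Prop :=
  0 < 1 - δ ∧ β ≤ 1 - δ ∧ γ ≤ 1 - δ ∧ q ^ 2 * β ≤ 1 - δ ∧ γ / q ^ 2 ≤ 1 - δ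

open Classical in
/-- The area (divided by `π`) of the `a`-section of `B ∩ B_μ` over `(b, c, d)`. [folklore] -/
def secArea (q β γ δ : ℝ) : ℝ :=
  if Thr q β γ δ then min (tRad β γ δ) (tRad (q ^ 2 * β) (γ / q ^ 2) δ) else 0

/-- The squared radius `tRad` is nonnegative under the thresholds `β, γ ≤ 1 - δ`. [folklore] -/
theorem tRad_nonneg {β γ δ : ℝ} (hβ : β ≤ 1 - δ) (hγ : γ ≤ 1 - δ) : 0 ≤ tRad β γ δ := by
  unfold tRad
  apply div_nonneg _ (sq_nonneg _)
  have h1 : 0 ≤ 1 - δ - β := by linarith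
  have h2 : 0 ≤ 1 - δ - γ := by linarith
  positivity

/-- The squared radius `tRad` is nonpositive when `β ≤ 1 - δ < γ`. [folklore] -/
theorem tRad_nonpos {β γ δ : ℝ} (hβ : β ≤ 1 - δ) (hγ : 1 - δ < γ) : tRad β γ δ ≤ 0 := by
  unfold tRad
  apply div_nonpos_of_nonpos_of_nonneg _ (sq_nonneg _)
  have h1 : 0 ≤ 1 - δ - β := by linarith
  have h2 : 1 - δ - γ ≤ 0 := by linarith
  exact mul_nonpos_of_nonneg_of_nonpos h1 h2

/-- The section area is nonnegative. [folklore] -/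
theorem secArea_nonneg (q β γ δ : ℝ) : 0 ≤ secArea q β γ δ := by
  unfold secArea
  split_ifs with h
  · exact le_min (tRad_nonneg h.2.1 h.2.2.1) (tRad_nonneg h.2.2.2.1 h.2.2.2.2)
  · exact le_rfl

/-- `ENNReal.ofReal π = NNReal.pi`. [folklore] -/
theorem ofReal_pi_eq : ENNReal.ofReal π = (NNReal.pi : ℝ≥0∞) := by
  rw [← NNReal.coe_real_pi, ENNReal.ofReal_coe_nnreal]

/-- **The `a`-sections of `B ∩ B_μ` are concentric discs**: their area is `π · secArea`. [folklore] -/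
theorem volume_section {q : ℝ} (hq : 0 < q) (b c d : ℂ) (hd : normSq d ≠ 1) :
    volume {a : ℂ | InB a b c d ∧ InB a ((q : ℂ) * b) (c / (q : ℂ)) d} =
      ENNReal.ofReal (π * secArea q (normSq b) (normSq c) (normSq d)) := by
  have hq0 : q ≠ 0 := hq.ne'
  have hsb : normSq ((q : ℂ) * b) = q ^ 2 * normSq b := normSq_real_mul q b
  have hsc : normSq (c / (q : ℂ)) = normSq c / q ^ 2 := normSq_div_real q c
  have hctr : ctr ((q : ℂ) * b) (c / (q : ℂ)) d = ctr b c d := ctr_scaled hq0 b c d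
  set β := normSq b with hβ_def
  set γ := normSq c with hγ_def
  set δ := normSq d with hδ_def
  by_cases hu : 0 < 1 - δ
  · by_cases hth : β ≤ 1 - δ ∧ γ ≤ 1 - δ ∧ q ^ 2 * β ≤ 1 - δ ∧ γ / q ^ 2 ≤ 1 - δ
    · -- non-degenerate disc
      obtain ⟨h1, h2, h3, h4⟩ := hth
      set m := min (tRad β γ δ) (tRad (q ^ 2 * β) (γ / q ^ 2) δ) with hm_def
      have hm0 : 0 ≤ m := le_min (tRad_nonneg h1 h2) (tRad_nonneg h3 h4)
      have hset : {a : ℂ | InB a b c d ∧ InB a ((q : ℂ) * b) (c / (q : ℂ)) d} =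
          Metric.closedBall (ctr b c d) (Real.sqrt m) := by
        ext a
        simp only [mem_setOf_eq, Metric.mem_closedBall, dist_eq_norm]
        rw [Real.le_sqrt (norm_nonneg _) hm0, ← Complex.normSq_eq_norm_sq, le_min_iff]
        constructor
        · rintro ⟨hB, hBq⟩
          refine ⟨normSq_sub_ctr_le_of_inB hu hB, ?_⟩
          have := normSq_sub_ctr_le_of_inB hu hBq
          rwa [hctr, hsb, hsc] at this
        · rintro ⟨ha1, ha2⟩
          refine ⟨inB_of_normSq_sub_ctr_le hu h1 h2 ha1, ?_⟩
          refine inB_of_normSq_sub_ctr_le hu (by rwa [hsb]) (by rwa [hsc]) ?_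
          rwa [hctr, hsb, hsc]
      rw [hset, Complex.volume_closedBall, secArea, if_pos ⟨hu, h1, h2, h3, h4⟩, ← hm_def,
        ← ENNReal.ofReal_pow (Real.sqrt_nonneg _), Real.sq_sqrt hm0,
        ENNReal.ofReal_mul pi_pos.le, ofReal_pi_eq, mul_comm]
    · -- degenerate: volume zero
      rw [secArea, if_neg (fun h => hth h.2), mul_zero, ENNReal.ofReal_zero]
      by_cases hb : β ≤ 1 - δ
      · by_cases hqb : q ^ 2 * β ≤ 1 - δ
        · -- then one of the γ-thresholds fails: the section is contained in {ctr}
          apply measure_mono_null (t := {ctr b c d}) _ (measure_singleton _)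
          intro a ha
          obtain ⟨hB, hBq⟩ := ha
          simp only [mem_singleton_iff]
          by_cases hg : γ ≤ 1 - δ
          · have hg' : 1 - δ < γ / q ^ 2 := by
              by_contra hcon; exact hth ⟨hb, hg, hqb, not_lt.mp hcon⟩
            have := normSq_sub_ctr_le_of_inB hu hBq
            rw [hctr, hsb, hsc] at this
            have hle := this.trans (tRad_nonpos hqb hg')
            have h0 : normSq (a - ctr b c d) = 0 := le_antisymm hle (normSq_nonneg _)
            exact sub_eq_zero.mp (normSq_eq_zero.mp h0)
          · have := (normSq_sub_ctr_le_of_inB hu hB).trans (tRad_nonpos hb (not_le.mp hg))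
            have h0 : normSq (a - ctr b c d) = 0 := le_antisymm this (normSq_nonneg _)
            exact sub_eq_zero.mp (normSq_eq_zero.mp h0)
        · -- second ball condition fails: empty
          convert measure_empty (μ := (volume : Measure ℂ))
          ext a
          simp only [mem_setOf_eq, mem_empty_iff_false, iff_false, not_and]
          intro _ hBq
          have := hBq.2.1
          rw [hsb] at this
          exact hqb (by linarith)
      · convert measure_empty (μ := (volume : Measure ℂ))
        ext a
        simp only [mem_setOf_eq, mem_empty_iff_false, iff_false, not_and]
        intro hB _
        have := hB.2.1
        exact hb (by linarith)
  · -- u ≤ 0, in fact u < 0: empty section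
    have hu' : 1 - δ < 0 := by
      rcases (not_lt.mp hu).lt_or_eq with h | h
      · exact h
      · exact absurd (by linarith : δ = 1) hd
    rw [secArea, if_neg (fun h => hu h.1), mul_zero, ENNReal.ofReal_zero]
    convert measure_empty (μ := (volume : Measure ℂ))
    ext a
    simp only [mem_setOf_eq, mem_empty_iff_false, iff_false, not_and]
    intro hB _
    have := hB.2.1
    have : 0 ≤ β := normSq_nonneg b
    linarith


/-! ### Radial lemmas (from Radial.lean) -/


/-- Substitution `s = r²` on `(0, ∞)`: `∫₀^∞ g(s) ds = ∫₀^∞ 2r g(r²) dr`. [folklore] -/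
theorem lintegral_Ioi_eq_lintegral_sq (g : ℝ → ℝ≥0∞) :
    ∫⁻ s in Ioi (0:ℝ), g s = ∫⁻ r in Ioi (0:ℝ), ENNReal.ofReal (2 * r) * g (r ^ 2) := by
  have himg : (fun r : ℝ => r ^ 2) '' Ioi 0 = Ioi 0 := by
    ext s
    constructor
    · rintro ⟨r, hr, rfl⟩
      exact pow_pos (show (0:ℝ) < r from hr) 2
    · intro hs
      exact ⟨Real.sqrt s, Real.sqrt_pos.mpr hs, Real.sq_sqrt (le_of_lt (show (0:ℝ) < s from hs))⟩
  have hinj : InjOn (fun r : ℝ => r ^ 2) (Ioi 0) := by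
    intro a ha b hb hab
    have := congrArg Real.sqrt hab
    simpa [Real.sqrt_sq (le_of_lt (show (0:ℝ) < a from ha)),
      Real.sqrt_sq (le_of_lt (show (0:ℝ) < b from hb))] using this
  calc ∫⁻ s in Ioi (0:ℝ), g s = ∫⁻ s in (fun r : ℝ => r ^ 2) '' Ioi 0, g s := by rw [himg]
    _ = ∫⁻ r in Ioi (0:ℝ), ENNReal.ofReal |(2 : ℕ) * r ^ (2 - 1)| * g (r ^ 2) :=
        lintegral_image_eq_lintegral_abs_deriv_mul measurableSet_Ioi
          (fun r _ => (hasDerivAt_pow 2 r).hasDerivWithinAt) hinj g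
    _ = ∫⁻ r in Ioi (0:ℝ), ENNReal.ofReal (2 * r) * g (r ^ 2) := by
        refine setLIntegral_congr_fun measurableSet_Ioi (fun r hr => ?_)
        have hr' : (0:ℝ) < r := hr
        congr 2
        simp [abs_of_pos hr']

/-- **Radial integration on `ℂ`**: `∫_ℂ g(|z|²) dz = π ∫₀^∞ g(s) ds`. [folklore] -/
theorem lintegral_comp_normSq (g : ℝ → ℝ≥0∞) (hg : Measurable g) :
    ∫⁻ z : ℂ, g (Complex.normSq z) = ENNReal.ofReal π * ∫⁻ s in Ioi (0:ℝ), g s := by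
  rw [← Complex.lintegral_comp_polarCoord_symm,
    show polarCoord.target = Ioi (0 : ℝ) ×ˢ Ioo (-π) π from rfl]
  have h1 : ∀ p : ℝ × ℝ, Complex.normSq (Complex.polarCoord.symm p) = p.1 ^ 2 := by
    intro p
    rw [Complex.normSq_eq_norm_sq, Complex.norm_polarCoord_symm, sq_abs]
  simp_rw [h1]
  rw [Measure.volume_eq_prod, ← Measure.prod_restrict, lintegral_prod]
  swap
  · exact ((measurable_fst.ennreal_ofReal).smul (hg.comp (measurable_fst.pow_const 2))).aemeasurable
  have h2 : ∀ r : ℝ, ∫⁻ _θ in Ioo (-π) π, ENNReal.ofReal r • g (r ^ 2) ∂volume =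
      ENNReal.ofReal (2 * π) * (ENNReal.ofReal r * g (r ^ 2)) := by
    intro r
    rw [setLIntegral_const, Real.volume_Ioo, smul_eq_mul, mul_comm]
    congr 2
    ring
  simp_rw [h2]
  rw [lintegral_const_mul' _ _ ENNReal.ofReal_ne_top, lintegral_Ioi_eq_lintegral_sq g]
  have h3 : ∀ r : ℝ, r ∈ Ioi (0:ℝ) →
      ENNReal.ofReal (2 * r) * g (r ^ 2) = 2 * (ENNReal.ofReal r * g (r ^ 2)) := by
    intro r _
    rw [ENNReal.ofReal_mul (by norm_num : (0:ℝ) ≤ 2), ENNReal.ofReal_ofNat, mul_assoc]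
  rw [setLIntegral_congr_fun measurableSet_Ioi h3,
    lintegral_const_mul' _ _ (by norm_num : (2:ℝ≥0∞) ≠ ⊤), ← mul_assoc]
  congr 1
  rw [ENNReal.ofReal_mul (by norm_num : (0:ℝ) ≤ 2), ENNReal.ofReal_ofNat, mul_comm]



/-! ### The body `E_q = B ∩ B_μ` as a subset of `ℂ × ℂ × ℂ × ℂ` and its volume as a triple integral -/

/-- `B ∩ B_μ` in the coordinates `(a, (b, (c, d)))`, `q = μ₁/μ₂`. [folklore] -/
def Ebody (q : ℝ) : Set (ℂ × ℂ × ℂ × ℂ) :=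
  {w | InB w.1 w.2.1 w.2.2.1 w.2.2.2 ∧ InB w.1 ((q : ℂ) * w.2.1) (w.2.2.1 / (q : ℂ)) w.2.2.2}

/-- `detN` is continuous in the four entries. [folklore] -/
theorem continuous_detN : Continuous (fun w : ℂ × ℂ × ℂ × ℂ => detN w.1 w.2.1 w.2.2.1 w.2.2.2) := by
  unfold detN
  fun_prop

/-- The operator-norm ball condition `InB` is closed along continuous entry maps. [folklore] -/
theorem isClosed_setOf_inB {f₁ f₂ f₃ f₄ : ℂ × ℂ × ℂ × ℂ → ℂ} (h₁ : Continuous f₁) (h₂ : Continuous f₂)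
    (h₃ : Continuous f₃) (h₄ : Continuous f₄) :
    IsClosed {w : ℂ × ℂ × ℂ × ℂ | InB (f₁ w) (f₂ w) (f₃ w) (f₄ w)} := by
  have hF : Continuous fun w : ℂ × ℂ × ℂ × ℂ => (f₁ w, f₂ w, f₃ w, f₄ w) := by fun_prop
  have c1 : IsClosed {w : ℂ × ℂ × ℂ × ℂ | normSq (f₁ w) + normSq (f₃ w) ≤ 1} := by
    apply isClosed_le _ continuous_const
    exact (Complex.continuous_normSq.comp h₁).add (Complex.continuous_normSq.comp h₃)
  have c2 : IsClosed {w : ℂ × ℂ × ℂ × ℂ | normSq (f₂ w) + normSq (f₄ w) ≤ 1} := by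
    apply isClosed_le _ continuous_const
    exact (Complex.continuous_normSq.comp h₂).add (Complex.continuous_normSq.comp h₄)
  have c3 : IsClosed {w : ℂ × ℂ × ℂ × ℂ | 0 ≤ detN (f₁ w) (f₂ w) (f₃ w) (f₄ w)} := by
    apply isClosed_le continuous_const
    exact continuous_detN.comp hF
  convert (c1.inter c2).inter c3 using 1
  ext w
  simp only [InB, mem_setOf_eq, mem_inter_iff, and_assoc]

/-- `Ebody q` is measurable (closed). [folklore] -/
theorem measurableSet_Ebody (q : ℝ) : MeasurableSet (Ebody q) := by
  refine (IsClosed.inter ?_ ?_).measurableSet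
  · exact isClosed_setOf_inB continuous_fst (by fun_prop) (by fun_prop) (by fun_prop)
  · exact isClosed_setOf_inB continuous_fst (by fun_prop) (by fun_prop) (by fun_prop)

/-- `tRad` is measurable. [folklore] -/
theorem measurable_tRad : Measurable (fun p : ℝ × ℝ × ℝ => tRad p.1 p.2.1 p.2.2) := by
  unfold tRad
  fun_prop

/-- The threshold set `Thr` is measurable. [folklore] -/
theorem measurableSet_Thr (q : ℝ) : MeasurableSet {p : ℝ × ℝ × ℝ | Thr q p.1 p.2.1 p.2.2} := by
  have m1 : MeasurableSet {p : ℝ × ℝ × ℝ | 0 < 1 - p.2.2} := by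
    apply measurableSet_lt <;> fun_prop
  have m2 : MeasurableSet {p : ℝ × ℝ × ℝ | p.1 ≤ 1 - p.2.2} := by
    apply measurableSet_le <;> fun_prop
  have m3 : MeasurableSet {p : ℝ × ℝ × ℝ | p.2.1 ≤ 1 - p.2.2} := by
    apply measurableSet_le <;> fun_prop
  have m4 : MeasurableSet {p : ℝ × ℝ × ℝ | q ^ 2 * p.1 ≤ 1 - p.2.2} := by
    apply measurableSet_le <;> fun_prop
  have m5 : MeasurableSet {p : ℝ × ℝ × ℝ | p.2.1 / q ^ 2 ≤ 1 - p.2.2} := by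
    apply measurableSet_le <;> fun_prop
  convert m1.inter (m2.inter (m3.inter (m4.inter m5))) using 1
  ext p
  simp only [Thr, mem_setOf_eq, mem_inter_iff]

/-- `secArea` is measurable. [folklore] -/
theorem measurable_secArea (q : ℝ) : Measurable (fun p : ℝ × ℝ × ℝ => secArea q p.1 p.2.1 p.2.2) := by
  classical
  unfold secArea
  refine Measurable.ite (measurableSet_Thr q) ?_ measurable_const
  refine Measurable.min measurable_tRad ?_
  exact measurable_tRad.comp (f := fun p : ℝ × ℝ × ℝ => (q ^ 2 * p.1, p.2.1 / q ^ 2, p.2.2))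
    (by fun_prop)

/-- `ofReal ∘ secArea` as a function of `(β, γ, δ)` is measurable. [folklore] -/
theorem measurable_ofReal_secArea (q : ℝ) :
    Measurable (fun p : ℝ × ℝ × ℝ => ENNReal.ofReal (secArea q p.1 p.2.1 p.2.2)) :=
  ENNReal.measurable_ofReal.comp (measurable_secArea q)

/-- The integrand `secArea(q, |b|², |c|², |d|²)` as a function of `(b, c, d)`. [folklore] -/
def secFun (q : ℝ) (y : ℂ × ℂ × ℂ) : ℝ≥0∞ :=
  ENNReal.ofReal (secArea q (normSq y.1) (normSq y.2.1) (normSq y.2.2))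

/-- `secFun` is measurable. [folklore] -/
theorem measurable_secFun (q : ℝ) : Measurable (secFun q) := by
  unfold secFun
  exact (measurable_ofReal_secArea q).comp
    (f := fun y : ℂ × ℂ × ℂ => (normSq y.1, normSq y.2.1, normSq y.2.2)) (by fun_prop)

/-- The set of `(b, c, d)` with `|d| = 1` is null. [folklore] -/
theorem volume_normSq_eq_one : volume {y : ℂ × ℂ × ℂ | normSq y.2.2 = 1} = 0 := by
  have hset : {y : ℂ × ℂ × ℂ | normSq y.2.2 = 1} =
      (univ : Set ℂ) ×ˢ ((univ : Set ℂ) ×ˢ Metric.sphere (0 : ℂ) 1) := by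
    ext y
    simp only [mem_setOf_eq, mem_prod, mem_univ, true_and, Metric.mem_sphere, dist_zero_right,
      Complex.normSq_eq_norm_sq]
    exact pow_eq_one_iff_of_nonneg (norm_nonneg _) two_ne_zero
  rw [hset, Measure.volume_eq_prod, Measure.prod_prod, Measure.volume_eq_prod, Measure.prod_prod,
    Measure.addHaar_sphere, mul_zero, mul_zero]

/-- The innermost radial step. [folklore] -/
theorem step_d (q β γ : ℝ) :
    ∫⁻ d : ℂ, ENNReal.ofReal (secArea q β γ (normSq d)) =
      ENNReal.ofReal π * ∫⁻ δ in Ioi (0:ℝ), ENNReal.ofReal (secArea q β γ δ) :=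
  lintegral_comp_normSq (fun δ => ENNReal.ofReal (secArea q β γ δ))
    ((measurable_ofReal_secArea q).comp (f := fun δ : ℝ => (β, γ, δ)) (by fun_prop))

/-- Measurability of the innermost parametric integral. [folklore] -/
theorem measurable_Id (q β : ℝ) :
    Measurable fun γ : ℝ => ∫⁻ δ in Ioi (0:ℝ), ENNReal.ofReal (secArea q β γ δ) := by
  refine Measurable.lintegral_prod_right (f := fun γ δ => ENNReal.ofReal (secArea q β γ δ)) ?_
  exact (measurable_ofReal_secArea q).comp (f := fun p : ℝ × ℝ => (β, p.1, p.2)) (by fun_prop)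

/-- The second radial step (integrating out `c`). [folklore] -/
theorem step_c (q β : ℝ) :
    ∫⁻ c : ℂ, ∫⁻ d : ℂ, ENNReal.ofReal (secArea q β (normSq c) (normSq d)) =
      ENNReal.ofReal π ^ 2 *
        ∫⁻ γ in Ioi (0:ℝ), ∫⁻ δ in Ioi (0:ℝ), ENNReal.ofReal (secArea q β γ δ) := by
  simp_rw [step_d]
  rw [lintegral_const_mul' _ _ ENNReal.ofReal_ne_top,
    lintegral_comp_normSq _ (measurable_Id q β)]
  ring

/-- Measurability of the double parametric integral. [folklore] -/
theorem measurable_Icd (q : ℝ) :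
    Measurable fun β : ℝ => ∫⁻ γ in Ioi (0:ℝ), ∫⁻ δ in Ioi (0:ℝ), ENNReal.ofReal (secArea q β γ δ) := by
  refine Measurable.lintegral_prod_right
    (f := fun β γ => ∫⁻ δ in Ioi (0:ℝ), ENNReal.ofReal (secArea q β γ δ)) ?_
  refine Measurable.lintegral_prod_right
    (f := fun (p : ℝ × ℝ) δ => ENNReal.ofReal (secArea q p.1 p.2 δ)) ?_
  exact (measurable_ofReal_secArea q).comp
    (f := fun r : (ℝ × ℝ) × ℝ => (r.1.1, r.1.2, r.2)) (by fun_prop)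

/-- The third radial step (integrating out `b`). [folklore] -/
theorem step_b (q : ℝ) :
    ∫⁻ b : ℂ, ∫⁻ c : ℂ, ∫⁻ d : ℂ, ENNReal.ofReal (secArea q (normSq b) (normSq c) (normSq d)) =
      ENNReal.ofReal π ^ 3 * ∫⁻ β in Ioi (0:ℝ), ∫⁻ γ in Ioi (0:ℝ), ∫⁻ δ in Ioi (0:ℝ),
        ENNReal.ofReal (secArea q β γ δ) := by
  simp_rw [step_c]
  rw [lintegral_const_mul' _ _ (by simp), lintegral_comp_normSq _ (measurable_Icd q)]
  ring

/-- **`vol(B ∩ B_μ)` as a triple integral of the section areas.** [folklore] -/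
theorem volume_Ebody {q : ℝ} (hq : 0 < q) :
    volume (Ebody q) = ENNReal.ofReal π ^ 4 *
      ∫⁻ β in Ioi (0:ℝ), ∫⁻ γ in Ioi (0:ℝ), ∫⁻ δ in Ioi (0:ℝ), ENNReal.ofReal (secArea q β γ δ) := by
  rw [Measure.volume_eq_prod, Measure.prod_apply_symm (measurableSet_Ebody q)]
  have hsec : ∀ y : ℂ × ℂ × ℂ, (fun a : ℂ => (a, y)) ⁻¹' Ebody q =
      {a : ℂ | InB a y.1 y.2.1 y.2.2 ∧ InB a ((q : ℂ) * y.1) (y.2.1 / (q : ℂ)) y.2.2} := fun y => rfl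
  simp_rw [hsec]
  have hae : (fun y : ℂ × ℂ × ℂ => volume {a : ℂ | InB a y.1 y.2.1 y.2.2 ∧
      InB a ((q : ℂ) * y.1) (y.2.1 / (q : ℂ)) y.2.2}) =ᵐ[volume]
        fun y => ENNReal.ofReal π * secFun q y := by
    have h0 := volume_normSq_eq_one
    rw [← compl_mem_ae_iff] at h0
    filter_upwards [h0] with y hy
    rw [volume_section hq y.1 y.2.1 y.2.2 hy, secFun, ENNReal.ofReal_mul pi_pos.le]
  rw [lintegral_congr_ae hae, lintegral_const_mul' _ _ ENNReal.ofReal_ne_top]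
  -- iterate (Tonelli twice)
  rw [Measure.volume_eq_prod, lintegral_prod _ (measurable_secFun q).aemeasurable]
  have h2 : ∀ b : ℂ, ∫⁻ z : ℂ × ℂ, secFun q (b, z) ∂volume =
      ∫⁻ c : ℂ, ∫⁻ d : ℂ, ENNReal.ofReal (secArea q (normSq b) (normSq c) (normSq d)) := by
    intro b
    rw [Measure.volume_eq_prod,
      lintegral_prod (fun z : ℂ × ℂ => secFun q (b, z))
        ((measurable_secFun q).comp measurable_prodMk_left).aemeasurable]
    rfl
  simp_rw [h2]
  rw [step_b, ← mul_assoc, ← pow_succ']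


/-! ### Evaluation of the triple integral -/

/-- Linear substitution `β = uσ` on `(0, ∞)`. [folklore] -/
theorem lintegral_Ioi_comp_mul {u : ℝ} (hu : 0 < u) (F : ℝ → ℝ≥0∞) :
    ∫⁻ β in Ioi (0:ℝ), F β = ENNReal.ofReal u * ∫⁻ σ in Ioi (0:ℝ), F (u * σ) := by
  have himg : (fun σ : ℝ => u * σ) '' Ioi 0 = Ioi 0 := by
    ext s
    constructor
    · rintro ⟨r, hr, rfl⟩
      exact mul_pos hu hr
    · intro hs
      exact ⟨s / u, div_pos hs hu, by field_simp⟩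
  have hinj : InjOn (fun σ : ℝ => u * σ) (Ioi 0) := by
    intro a _ b _ hab
    exact mul_left_cancel₀ hu.ne' hab
  calc ∫⁻ β in Ioi (0:ℝ), F β = ∫⁻ β in (fun σ : ℝ => u * σ) '' Ioi 0, F β := by rw [himg]
    _ = ∫⁻ σ in Ioi (0:ℝ), ENNReal.ofReal |u| * F (u * σ) :=
        lintegral_image_eq_lintegral_abs_deriv_mul measurableSet_Ioi
          (fun σ _ => ((hasDerivAt_id σ).const_mul u |>.congr_deriv (by ring)).hasDerivWithinAt)
          hinj F
    _ = ENNReal.ofReal u * ∫⁻ σ in Ioi (0:ℝ), F (u * σ) := by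
        rw [abs_of_pos hu, lintegral_const_mul' _ _ ENNReal.ofReal_ne_top]

/-- `∫_{(a,b]} f = ofReal (∫_a^b f)` for continuous nonnegative `f`. [folklore] -/
theorem lintegral_Ioc_eq_ofReal {f : ℝ → ℝ} {a b : ℝ} (hab : a ≤ b) (hf : Continuous f)
    (hnn : ∀ x ∈ Icc a b, 0 ≤ f x) :
    ∫⁻ x in Ioc a b, ENNReal.ofReal (f x) = ENNReal.ofReal (∫ x in a..b, f x) := by
  rw [intervalIntegral.integral_of_le hab, ofReal_integral_eq_lintegral_ofReal]
  · exact (hf.integrableOn_Icc (a := a) (b := b)).mono_set Ioc_subset_Icc_self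
  · exact ae_restrict_of_forall_mem measurableSet_Ioc fun x hx => hnn x (Ioc_subset_Icc_self hx)

/-- FTC for the explicit polynomial integrals below. [folklore] -/
theorem integral_eq_of_hasDerivAt {F f : ℝ → ℝ} (hF : ∀ x, HasDerivAt F (f x) x)
    (hf : Continuous f) (a b : ℝ) : ∫ x in a..b, f x = F b - F a :=
  intervalIntegral.integral_eq_sub_of_hasDerivAt (fun x _ => hF x) (hf.intervalIntegrable _ _)

open Classical in
/-- The rescaled section area: `secArea (uσ) (uτ) δ = core σ τ` (`u = 1 - δ > 0`). [folklore] -/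
def core (q σ τ : ℝ) : ℝ :=
  if σ ≤ 1 ∧ τ ≤ 1 ∧ q ^ 2 * σ ≤ 1 ∧ τ / q ^ 2 ≤ 1
  then min ((1 - σ) * (1 - τ)) ((1 - q ^ 2 * σ) * (1 - τ / q ^ 2)) else 0

/-- `core ≥ 0`. [folklore] -/
theorem core_nonneg (q σ τ : ℝ) : 0 ≤ core q σ τ := by
  unfold core
  split_ifs with h
  · obtain ⟨h1, h2, h3, h4⟩ := h
    exact le_min (mul_nonneg (by linarith) (by linarith)) (mul_nonneg (by linarith) (by linarith))
  · exact le_rfl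

/-- Rescaling identity `secArea q (uσ) (uτ) δ = core q σ τ` for `u = 1 - δ > 0`. [folklore] -/
theorem secArea_rescale (q : ℝ) {δ : ℝ} (hu : 0 < 1 - δ) (σ τ : ℝ) :
    secArea q ((1 - δ) * σ) ((1 - δ) * τ) δ = core q σ τ := by
  have hu0 : (1 - δ) ≠ 0 := hu.ne'
  have hthr : Thr q ((1 - δ) * σ) ((1 - δ) * τ) δ ↔
      (σ ≤ 1 ∧ τ ≤ 1 ∧ q ^ 2 * σ ≤ 1 ∧ τ / q ^ 2 ≤ 1) := by
    simp only [Thr]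
    rw [mul_le_iff_le_one_right hu, mul_le_iff_le_one_right hu,
      show q ^ 2 * ((1 - δ) * σ) = (1 - δ) * (q ^ 2 * σ) by ring, mul_le_iff_le_one_right hu,
      show (1 - δ) * τ / q ^ 2 = (1 - δ) * (τ / q ^ 2) by ring, mul_le_iff_le_one_right hu]
    exact ⟨fun h => h.2, fun h => ⟨hu, h⟩⟩
  have ht1 : tRad ((1 - δ) * σ) ((1 - δ) * τ) δ = (1 - σ) * (1 - τ) := by
    unfold tRad; field_simp
  have ht2 : tRad (q ^ 2 * ((1 - δ) * σ)) ((1 - δ) * τ / q ^ 2) δ =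
      (1 - q ^ 2 * σ) * (1 - τ / q ^ 2) := by
    unfold tRad; field_simp
  classical
  unfold secArea core
  rw [ht1, ht2]
  exact if_congr hthr rfl rfl

/-- The double integral `J(q) = ∫∫ core`. [folklore] -/
def Jint (q : ℝ) : ℝ≥0∞ := ∫⁻ σ in Ioi (0:ℝ), ∫⁻ τ in Ioi (0:ℝ), ENNReal.ofReal (core q σ τ)

/-- `core` is measurable. [folklore] -/
theorem measurable_core (q : ℝ) : Measurable (fun p : ℝ × ℝ => core q p.1 p.2) := by
  classical
  unfold core
  refine Measurable.ite ?_ (by fun_prop) measurable_const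
  have m1 : MeasurableSet {p : ℝ × ℝ | p.1 ≤ 1} := by apply measurableSet_le <;> fun_prop
  have m2 : MeasurableSet {p : ℝ × ℝ | p.2 ≤ 1} := by apply measurableSet_le <;> fun_prop
  have m3 : MeasurableSet {p : ℝ × ℝ | q ^ 2 * p.1 ≤ 1} := by apply measurableSet_le <;> fun_prop
  have m4 : MeasurableSet {p : ℝ × ℝ | p.2 / q ^ 2 ≤ 1} := by apply measurableSet_le <;> fun_prop
  convert m1.inter (m2.inter (m3.inter m4)) using 1
  ext p
  simp only [mem_setOf_eq, mem_inter_iff]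

/-- The inner double integral at height `δ ∈ (0, 1)` is `(1-δ)² J(q)` (two rescalings). [folklore] -/
theorem inner_eq (q : ℝ) {δ : ℝ} (hu : 0 < 1 - δ) :
    ∫⁻ β in Ioi (0:ℝ), ∫⁻ γ in Ioi (0:ℝ), ENNReal.ofReal (secArea q β γ δ) =
      ENNReal.ofReal ((1 - δ) ^ 2) * Jint q := by
  rw [lintegral_Ioi_comp_mul hu]
  have h1 : ∀ σ : ℝ, ∫⁻ γ in Ioi (0:ℝ), ENNReal.ofReal (secArea q ((1 - δ) * σ) γ δ) =
      ENNReal.ofReal (1 - δ) * ∫⁻ τ in Ioi (0:ℝ), ENNReal.ofReal (core q σ τ) := by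
    intro σ
    rw [lintegral_Ioi_comp_mul hu]
    simp_rw [secArea_rescale q hu]
  simp_rw [h1]
  rw [lintegral_const_mul' _ _ ENNReal.ofReal_ne_top, ← mul_assoc, ← ENNReal.ofReal_mul hu.le,
    ← pow_two]
  rfl

/-- For `δ ≥ 1` the section areas vanish. [folklore] -/
theorem secArea_eq_zero_of_le (q : ℝ) {δ : ℝ} (hδ : 1 ≤ δ) (β γ : ℝ) : secArea q β γ δ = 0 := by
  unfold secArea
  rw [if_neg]
  intro h
  exact absurd h.1 (by linarith)

/-- Measurability of the `γ`-integral as a function of `(β, δ)`. [folklore] -/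
theorem measurable_T2 (q : ℝ) :
    Measurable fun p : ℝ × ℝ => ∫⁻ γ in Ioi (0:ℝ), ENNReal.ofReal (secArea q p.1 γ p.2) := by
  refine Measurable.lintegral_prod_right
    (f := fun (p : ℝ × ℝ) γ => ENNReal.ofReal (secArea q p.1 γ p.2)) ?_
  exact (measurable_ofReal_secArea q).comp
    (f := fun r : (ℝ × ℝ) × ℝ => (r.1.1, r.2, r.1.2)) (by fun_prop)

/-- `∫₀¹ (1-δ)² dδ = 1/3`. [folklore] -/
theorem lintegral_one_sub_sq :
    ∫⁻ δ in Ioo (0:ℝ) 1, ENNReal.ofReal ((1 - δ) ^ 2) = ENNReal.ofReal (1 / 3) := by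
  rw [restrict_Ioo_eq_restrict_Ioc,
    lintegral_Ioc_eq_ofReal zero_le_one (by fun_prop) (fun x _ => sq_nonneg _)]
  congr 1
  rw [integral_eq_of_hasDerivAt (F := fun x => x - x ^ 2 + x ^ 3 / 3) (f := fun x => (1 - x) ^ 2)
    ?_ (by fun_prop)]
  · norm_num
  · intro x
    have h := ((hasDerivAt_id x).sub (hasDerivAt_pow 2 x)).add ((hasDerivAt_pow 3 x).div_const 3)
    exact h.congr_deriv (by norm_num; ring)

/-- **Reduction of the triple integral to `J(q)/3`.** [folklore] -/
theorem triple_eq (q : ℝ) :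
    ∫⁻ β in Ioi (0:ℝ), ∫⁻ γ in Ioi (0:ℝ), ∫⁻ δ in Ioi (0:ℝ), ENNReal.ofReal (secArea q β γ δ) =
      ENNReal.ofReal (1 / 3) * Jint q := by
  -- reorder: δ outermost
  have hsw1 : ∀ β : ℝ, ∫⁻ γ in Ioi (0:ℝ), ∫⁻ δ in Ioi (0:ℝ), ENNReal.ofReal (secArea q β γ δ) =
      ∫⁻ δ in Ioi (0:ℝ), ∫⁻ γ in Ioi (0:ℝ), ENNReal.ofReal (secArea q β γ δ) := by
    intro β
    refine lintegral_lintegral_swap ?_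
    exact ((measurable_ofReal_secArea q).comp (f := fun p : ℝ × ℝ => (β, p.1, p.2))
      (by fun_prop)).aemeasurable
  simp_rw [hsw1]
  rw [lintegral_lintegral_swap ((measurable_T2 q).aemeasurable)]
  -- now ∫⁻ δ, ∫⁻ β, ∫⁻ γ
  have hI : ∀ δ : ℝ, δ ∈ Ioi (0:ℝ) →
      ∫⁻ β in Ioi (0:ℝ), ∫⁻ γ in Ioi (0:ℝ), ENNReal.ofReal (secArea q β γ δ) =
        (Ioo (0:ℝ) 1).indicator (fun δ => ENNReal.ofReal ((1 - δ) ^ 2) * Jint q) δ := by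
    intro δ hδ
    by_cases h1 : δ < 1
    · rw [indicator_of_mem (show δ ∈ Ioo (0:ℝ) 1 from ⟨hδ, h1⟩), inner_eq q (by linarith)]
    · rw [indicator_of_notMem (fun h => h1 h.2)]
      simp_rw [secArea_eq_zero_of_le q (not_lt.mp h1), ENNReal.ofReal_zero, lintegral_zero]
  rw [setLIntegral_congr_fun measurableSet_Ioi hI, lintegral_indicator measurableSet_Ioo,
    Measure.restrict_restrict measurableSet_Ioo,
    show Ioo (0:ℝ) 1 ∩ Ioi 0 = Ioo 0 1 from inter_eq_left.mpr Ioo_subset_Ioi_self,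
    lintegral_mul_const _ (by fun_prop), lintegral_one_sub_sq, mul_comm]

/-! ### Evaluation of `J(q)` -/

/-- `innerJ q σ = ∫₀¹ min(...) dτ` for `0 < σ ≤ 1/q²`, `q ≥ 1`. [folklore] -/
def innerJ (q σ : ℝ) : ℝ := (1 - σ - q ^ 2 * (q ^ 2 - 1) * σ ^ 2) / 2

/-- The difference of the two products in `core`: `(1-σ)(1-τ) - (1-q²σ)(1-τ/q²) = (q²-1)(σ - τ/q²)`. [folklore] -/
theorem pB_sub_pA {q : ℝ} (hq : q ≠ 0) (σ τ : ℝ) :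
    (1 - σ) * (1 - τ) - (1 - q ^ 2 * σ) * (1 - τ / q ^ 2) = (q ^ 2 - 1) * (σ - τ / q ^ 2) := by
  field_simp
  ring

/-- Explicit value of `core` inside the thresholds (`q ≥ 1`, `q²σ ≤ 1`, `0 < τ ≤ 1`). [folklore] -/
theorem core_eq_of_le {q σ τ : ℝ} (hq : 1 ≤ q) (hσ : q ^ 2 * σ ≤ 1) (_hτ0 : 0 < τ) (hτ : τ ≤ 1) :
    core q σ τ = min ((1 - σ) * (1 - τ)) ((1 - q ^ 2 * σ) * (1 - τ / q ^ 2)) := by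
  have hq2 : 1 ≤ q ^ 2 := by nlinarith
  have hσ1 : σ ≤ 1 := by nlinarith
  have hτq : τ / q ^ 2 ≤ 1 := by
    rw [div_le_one (by positivity)]; linarith
  unfold core
  rw [if_pos ⟨hσ1, hτ, hσ, hτq⟩]

/-- `core = 0` for `τ > 1`. [folklore] -/
theorem core_eq_zero_of_one_lt_tau {q σ τ : ℝ} (hτ : 1 < τ) : core q σ τ = 0 := by
  unfold core
  rw [if_neg]
  intro h
  linarith [h.2.1]

/-- `core = 0` for `q² σ > 1`. [folklore] -/
theorem core_eq_zero_of_lt_sigma {q σ τ : ℝ} (hσ : 1 < q ^ 2 * σ) : core q σ τ = 0 := by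
  unfold core
  rw [if_neg]
  intro h
  linarith [h.2.2.1]

/-- The `τ`-integral for `0 < σ ≤ 1/q²` (`q ≥ 1`). [folklore] -/
theorem lintegral_core_tau {q σ : ℝ} (hq : 1 ≤ q) (hσ0 : 0 < σ) (hσ : q ^ 2 * σ ≤ 1) :
    ∫⁻ τ in Ioi (0:ℝ), ENNReal.ofReal (core q σ τ) = ENNReal.ofReal (innerJ q σ) := by
  have hq0 : q ≠ 0 := by positivity
  have hq2 : 1 ≤ q ^ 2 := by nlinarith
  have hσ1 : σ ≤ 1 := by nlinarith
  set τ₀ := q ^ 2 * σ with hτ₀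
  have hτ₀0 : 0 < τ₀ := by positivity
  -- restrict to (0,1]
  rw [← Ioc_union_Ioi_eq_Ioi zero_le_one, lintegral_union measurableSet_Ioi (Ioc_disjoint_Ioi le_rfl)]
  have hzero : ∫⁻ τ in Ioi (1:ℝ), ENNReal.ofReal (core q σ τ) = 0 := by
    rw [setLIntegral_congr_fun measurableSet_Ioi
      (fun τ hτ => by rw [core_eq_zero_of_one_lt_tau (q := q) (σ := σ) hτ, ENNReal.ofReal_zero])]
    exact lintegral_zero
  rw [hzero, add_zero]
  -- split at τ₀
  rw [← Ioc_union_Ioc_eq_Ioc hτ₀0.le hσ,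
    lintegral_union measurableSet_Ioc (Ioc_disjoint_Ioc_of_le le_rfl)]
  have hA : ∫⁻ τ in Ioc (0:ℝ) τ₀, ENNReal.ofReal (core q σ τ) =
      ENNReal.ofReal ((1 - q ^ 2 * σ) * (τ₀ - τ₀ ^ 2 / (2 * q ^ 2))) := by
    rw [setLIntegral_congr_fun measurableSet_Ioc (g := fun τ =>
        ENNReal.ofReal ((1 - q ^ 2 * σ) * (1 - τ / q ^ 2))) (fun τ hτ => by
          rw [core_eq_of_le hq hσ hτ.1 (hτ.2.trans hσ), min_eq_right]
          have := pB_sub_pA hq0 σ τ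
          have h1 : 0 ≤ σ - τ / q ^ 2 := by
            rw [sub_nonneg, div_le_iff₀ (by positivity)]; linarith [hτ.2]
          nlinarith)]
    rw [lintegral_Ioc_eq_ofReal hτ₀0.le (by fun_prop)]
    · congr 1
      rw [integral_eq_of_hasDerivAt (F := fun τ => (1 - q ^ 2 * σ) * (τ - τ ^ 2 / (2 * q ^ 2)))
        (f := fun τ => (1 - q ^ 2 * σ) * (1 - τ / q ^ 2)) ?_ (by fun_prop)]
      · ring
      · intro x
        have h := ((hasDerivAt_id x).sub ((hasDerivAt_pow 2 x).div_const (2 * q ^ 2))).const_mul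
          (1 - q ^ 2 * σ)
        exact h.congr_deriv (by field_simp; ring)
    · intro τ hτ
      apply mul_nonneg (by linarith)
      rw [sub_nonneg, div_le_one (by positivity)]
      linarith [hτ.2]
  have hB : ∫⁻ τ in Ioc τ₀ 1, ENNReal.ofReal (core q σ τ) =
      ENNReal.ofReal ((1 - σ) * ((1 - 1 / 2) - (τ₀ - τ₀ ^ 2 / 2))) := by
    rw [setLIntegral_congr_fun measurableSet_Ioc (g := fun τ =>
        ENNReal.ofReal ((1 - σ) * (1 - τ))) (fun τ hτ => by
          rw [core_eq_of_le hq hσ (hτ₀0.trans hτ.1) hτ.2, min_eq_left]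
          have := pB_sub_pA hq0 σ τ
          have h1 : σ - τ / q ^ 2 ≤ 0 := by
            rw [sub_nonpos, le_div_iff₀ (by positivity)]; nlinarith [hτ.1]
          nlinarith)]
    rw [lintegral_Ioc_eq_ofReal hσ (by fun_prop)]
    · congr 1
      rw [integral_eq_of_hasDerivAt (F := fun τ => (1 - σ) * (τ - τ ^ 2 / 2))
        (f := fun τ => (1 - σ) * (1 - τ)) ?_ (by fun_prop)]
      · ring
      · intro x
        have h := ((hasDerivAt_id x).sub ((hasDerivAt_pow 2 x).div_const 2)).const_mul (1 - σ)
        exact h.congr_deriv (by ring)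
    · intro τ hτ
      exact mul_nonneg (by linarith) (by linarith [hτ.2])
  rw [hA, hB, ← ENNReal.ofReal_add]
  · congr 1
    rw [innerJ, hτ₀]
    field_simp
    ring
  · apply mul_nonneg (by linarith)
    have : τ₀ ^ 2 / (2 * q ^ 2) ≤ τ₀ := by
      rw [div_le_iff₀ (by positivity)]; nlinarith
    linarith
  · apply mul_nonneg (by linarith)
    nlinarith

/-- `innerJ ≥ 0` on `0 ≤ σ ≤ 1/q²`. [folklore] -/
theorem innerJ_nonneg {q σ : ℝ} (hq : 1 ≤ q) (hσ0 : 0 ≤ σ) (hσ : q ^ 2 * σ ≤ 1) :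
    0 ≤ innerJ q σ := by
  unfold innerJ
  have hq2 : 1 ≤ q ^ 2 := by nlinarith
  have h1 : q ^ 2 * (q ^ 2 - 1) * σ ^ 2 ≤ (q ^ 2 - 1) * σ := by
    have : q ^ 2 * (q ^ 2 - 1) * σ ^ 2 = ((q ^ 2 - 1) * σ) * (q ^ 2 * σ) := by ring
    rw [this]
    exact mul_le_of_le_one_right (mul_nonneg (by linarith) hσ0) hσ
  nlinarith

/-- **`J(q) = (4q² - 1)/(12 q⁴)` for `q ≥ 1`.** [folklore] -/
theorem Jint_eq_of_one_le {q : ℝ} (hq : 1 ≤ q) :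
    Jint q = ENNReal.ofReal ((4 * q ^ 2 - 1) / (12 * q ^ 4)) := by
  have hq0 : 0 < q := by linarith
  have hs0 : 0 < 1 / q ^ 2 := by positivity
  unfold Jint
  set F : ℝ → ℝ≥0∞ := fun σ => ∫⁻ τ in Ioi (0:ℝ), ENNReal.ofReal (core q σ τ) with hF
  rw [← Ioc_union_Ioi_eq_Ioi hs0.le, lintegral_union measurableSet_Ioi (Ioc_disjoint_Ioi le_rfl)]
  have hzero : ∫⁻ σ in Ioi (1 / q ^ 2), F σ = 0 := by
    rw [setLIntegral_congr_fun measurableSet_Ioi (g := fun _ => 0) (fun σ hσ => by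
      simp only [hF]
      have hσ' : 1 < q ^ 2 * σ := by
        have := (div_lt_iff₀ (by positivity : (0:ℝ) < q ^ 2)).mp (show 1 / q ^ 2 < σ from hσ)
        linarith
      simp_rw [core_eq_zero_of_lt_sigma (τ := _) hσ', ENNReal.ofReal_zero, lintegral_zero])]
    exact lintegral_zero
  rw [hzero, add_zero]
  rw [setLIntegral_congr_fun measurableSet_Ioc (g := fun σ => ENNReal.ofReal (innerJ q σ))
    (fun σ hσ => lintegral_core_tau hq hσ.1 (by
      have := (le_div_iff₀ (by positivity : (0:ℝ) < q ^ 2)).mp hσ.2; linarith))]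
  rw [lintegral_Ioc_eq_ofReal hs0.le (by unfold innerJ; fun_prop)]
  · congr 1
    rw [integral_eq_of_hasDerivAt
      (F := fun σ => (σ - σ ^ 2 / 2 - q ^ 2 * (q ^ 2 - 1) * σ ^ 3 / 3) / 2)
      (f := fun σ => innerJ q σ) ?_ (by unfold innerJ; fun_prop)]
    · field_simp
      ring
    · intro x
      have h := (((hasDerivAt_id x).sub ((hasDerivAt_pow 2 x).div_const 2)).sub
        (((hasDerivAt_pow 3 x).const_mul (q ^ 2 * (q ^ 2 - 1))).div_const 3)).div_const 2
      refine h.congr_deriv ?_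
      unfold innerJ
      ring
  · intro σ hσ
    exact innerJ_nonneg hq hσ.1 (by
      have := (le_div_iff₀ (by positivity : (0:ℝ) < q ^ 2)).mp hσ.2; linarith)

/-- Symmetry of `core` under `(σ, τ, q) ↦ (τ, σ, 1/q)`. [folklore] -/
theorem core_symm (q σ τ : ℝ) : core q σ τ = core q⁻¹ τ σ := by
  have h1 : q⁻¹ ^ 2 * τ = τ / q ^ 2 := by rw [inv_pow, div_eq_mul_inv, mul_comm]
  have h2 : σ / q⁻¹ ^ 2 = q ^ 2 * σ := by rw [inv_pow, div_inv_eq_mul, mul_comm]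
  classical
  unfold core
  rw [h1, h2]
  refine if_congr ?_ ?_ rfl
  · tauto
  · congr 1 <;> ring

/-- `J(q) = J(1/q)` (swap `σ ↔ τ`). [folklore] -/
theorem Jint_symm (q : ℝ) : Jint q = Jint q⁻¹ := by
  unfold Jint
  simp_rw [core_symm q]
  rw [lintegral_lintegral_swap]
  exact ((ENNReal.measurable_ofReal.comp (measurable_core q⁻¹)).comp
    (f := fun p : ℝ × ℝ => (p.2, p.1)) (by fun_prop)).aemeasurable

/-- `ε² = min(q², q⁻²)`. [folklore] -/
def epsSq (q : ℝ) : ℝ := min (q ^ 2) (q ^ 2)⁻¹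

/-- **`J(q) = ε²(4 - ε²)/12`.** [folklore] -/
theorem Jint_eq {q : ℝ} (hq : 0 < q) : Jint q = ENNReal.ofReal (epsSq q * (4 - epsSq q) / 12) := by
  rcases le_or_gt 1 q with h | h
  · have hq2 : 1 ≤ q ^ 2 := by nlinarith
    have he : epsSq q = (q ^ 2)⁻¹ := by
      unfold epsSq
      exact min_eq_right ((inv_le_one_of_one_le₀ hq2).trans hq2)
    rw [Jint_eq_of_one_le h, he]
    congr 1
    field_simp
  · have hq' : 1 ≤ q⁻¹ := (one_le_inv₀ hq).mpr h.le
    have hq2 : q ^ 2 ≤ 1 := by nlinarith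
    have he : epsSq q = q ^ 2 := by
      unfold epsSq
      exact min_eq_left (hq2.trans ((one_le_inv₀ (by positivity)).mpr hq2))
    rw [Jint_symm q, Jint_eq_of_one_le hq', he]
    congr 1
    field_simp

/-- **Key Lemma**: `vol(B ∩ B_μ) = (π⁴/36) ε² (4 - ε²)`. [folklore] -/
theorem volume_Ebody_eq {q : ℝ} (hq : 0 < q) :
    volume (Ebody q) = ENNReal.ofReal (π ^ 4 / 36 * (epsSq q * (4 - epsSq q))) := by
  rw [volume_Ebody hq, triple_eq, Jint_eq hq, ← ENNReal.ofReal_pow pi_pos.le,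
    ← ENNReal.ofReal_mul (by norm_num), ← ENNReal.ofReal_mul (by positivity)]
  congr 1
  ring


/-! ## F4a. Fibre algebra -/

/-! ### Block conjugation by a unitary -/

/-- Conjugating a block matrix by `diag(U, U)`. [folklore] -/
theorem fromBlocks_unitary_conj (U A B C D : Matrix (Fin 2) (Fin 2) ℂ) :
    fromBlocks U 0 0 U * fromBlocks A B C D * fromBlocks (star U) 0 0 (star U) =
      fromBlocks (U * A * star U) (U * B * star U) (U * C * star U) (U * D * star U) := by
  simp [fromBlocks_multiply]

/-- `star (diag(U, U)) = diag(U*, U*)` as block matrices. [folklore] -/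
theorem star_fromBlocks_diag (U : Matrix (Fin 2) (Fin 2) ℂ) :
    star (fromBlocks U 0 0 U) = fromBlocks (star U) (0 : Matrix (Fin 2) (Fin 2) ℂ) 0 (star U) := by
  rw [star_eq_conjTranspose, fromBlocks_conjTranspose]
  simp [star_eq_conjTranspose]

/-- `diag(U, U)` is invertible when `U U* = 1`. [folklore] -/
theorem isUnit_fromBlocks_diag {U : Matrix (Fin 2) (Fin 2) ℂ} (hU : U * star U = 1) :
    IsUnit (fromBlocks U 0 0 U : Matrix (Fin 2 ⊕ Fin 2) (Fin 2 ⊕ Fin 2) ℂ) := by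
  have h : fromBlocks U 0 0 U * fromBlocks (star U) 0 0 (star U) =
      (1 : Matrix (Fin 2 ⊕ Fin 2) (Fin 2 ⊕ Fin 2) ℂ) := by
    simp [fromBlocks_multiply, hU, fromBlocks_one]
  letI := invertibleOfRightInverse _ _ h
  exact isUnit_of_invertible _

/-- PSD is invariant under the block-diagonal unitary conjugation. [folklore] -/
theorem posSemidef_fromBlocks_conj_iff {U : Matrix (Fin 2) (Fin 2) ℂ} (hU : U * star U = 1)
    (A B C D : Matrix (Fin 2) (Fin 2) ℂ) :
    (fromBlocks (U * A * star U) (U * B * star U) (U * C * star U) (U * D * star U)).PosSemidef ↔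
      (fromBlocks A B C D).PosSemidef := by
  rw [← fromBlocks_unitary_conj, ← star_fromBlocks_diag]
  exact (isUnit_fromBlocks_diag hU).posSemidef_star_right_conjugate_iff

/-! ### Schur complements for the two bodies -/

/-- `ρ ≥ 0 ⟺ Q - Zᴴ P⁻¹ Z ≥ 0` for `P` positive definite. [folklore] -/
theorem posSemidef_rho_iff {P Q Z : Matrix (Fin 2) (Fin 2) ℂ} (hP : P.PosDef) :
    (fromBlocks P Z Zᴴ Q).PosSemidef ↔ (Q - Zᴴ * P⁻¹ * Z).PosSemidef := by
  letI : Invertible P := hP.isUnit.invertible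
  exact Matrix.PosDef.fromBlocks₁₁ Z Q hP

/-- `ρ' = fromBlocks Q (-Z) (-Z)ᴴ P ≥ 0 ⟺ P - Zᴴ Q⁻¹ Z ≥ 0` for `Q` positive definite. [folklore] -/
theorem posSemidef_rho'_iff {P Q Z : Matrix (Fin 2) (Fin 2) ℂ} (hQ : Q.PosDef) :
    (fromBlocks Q (-Z) (-Z)ᴴ P).PosSemidef ↔ (P - Zᴴ * Q⁻¹ * Z).PosSemidef := by
  letI : Invertible Q := hQ.isUnit.invertible
  have := Matrix.PosDef.fromBlocks₁₁ (-Z) P hQ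
  rw [this]
  simp [conjTranspose_neg]

/-! ### The normalized Schur complement in the diagonal frame -/

/-- Entries of `diag(q) - Yᴴ diag(p)⁻¹ Y`. [folklore] -/
theorem schur_diag_entries (p0 p1 q0 q1 : ℝ) (hp0 : p0 ≠ 0) (hp1 : p1 ≠ 0)
    (Y : Matrix (Fin 2) (Fin 2) ℂ) :
    diagonal ![(q0 : ℂ), q1] - Yᴴ * (diagonal ![(p0 : ℂ), p1])⁻¹ * Y =
      !![((q0 : ℂ) - (conj (Y 0 0) * Y 0 0 / p0 + conj (Y 1 0) * Y 1 0 / p1)),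
          -(conj (Y 0 0) * Y 0 1 / p0 + conj (Y 1 0) * Y 1 1 / p1);
         -(conj (Y 0 1) * Y 0 0 / p0 + conj (Y 1 1) * Y 1 0 / p1),
          ((q1 : ℂ) - (conj (Y 0 1) * Y 0 1 / p0 + conj (Y 1 1) * Y 1 1 / p1))] := by
  have hinv : (diagonal ![(p0 : ℂ), p1])⁻¹ = diagonal ![(p0 : ℂ)⁻¹, (p1 : ℂ)⁻¹] := by
    apply inv_eq_right_inv
    rw [diagonal_mul_diagonal]
    ext i j
    fin_cases i <;> fin_cases j <;> simp [hp0, hp1]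
  rw [hinv]
  ext i j
  fin_cases i <;> fin_cases j <;>
    simp [Matrix.mul_apply, Fin.sum_univ_two, Matrix.diagonal, conjTranspose_apply, div_eq_mul_inv] <;> ring


/-- `√x · √y = √(xy)` in `ℂ` (for `x ≥ 0`). [folklore] -/
theorem ofReal_sqrt_mul_sqrt {x y : ℝ} (hx : 0 ≤ x) :
    ((Real.sqrt x : ℝ) : ℂ) * ((Real.sqrt y : ℝ) : ℂ) = ((Real.sqrt (x * y) : ℝ) : ℂ) := by
  rw [← ofReal_mul, ← Real.sqrt_mul hx]

/-- `|z / √x|² = |z|² / x` for `x ≥ 0`. [folklore] -/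
theorem normSq_div_sqrt (z : ℂ) {x : ℝ} (hx : 0 ≤ x) :
    normSq (z / ((Real.sqrt x : ℝ) : ℂ)) = normSq z / x := by
  rw [normSq_div, normSq_ofReal, Real.mul_self_sqrt hx]

/-- PSD of the diagonal-frame Schur complement `diag(q) - Yᴴ diag(p)⁻¹ Y` in terms of the three
real inequalities of the `2 × 2` criterion. [folklore] -/
theorem posSemidef_schur_diag_iff {p0 p1 q0 q1 : ℝ} (hp0 : 0 < p0) (hp1 : 0 < p1)
    (Y : Matrix (Fin 2) (Fin 2) ℂ) :
    (diagonal ![(q0 : ℂ), q1] - Yᴴ * (diagonal ![(p0 : ℂ), p1])⁻¹ * Y).PosSemidef ↔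
      0 ≤ q0 - (normSq (Y 0 0) / p0 + normSq (Y 1 0) / p1) ∧
      0 ≤ q1 - (normSq (Y 0 1) / p0 + normSq (Y 1 1) / p1) ∧
      normSq (-(conj (Y 0 0) * Y 0 1 / p0 + conj (Y 1 0) * Y 1 1 / p1)) ≤
        (q0 - (normSq (Y 0 0) / p0 + normSq (Y 1 0) / p1)) *
          (q1 - (normSq (Y 0 1) / p0 + normSq (Y 1 1) / p1)) := by
  rw [schur_diag_entries p0 p1 q0 q1 hp0.ne' hp1.ne' Y]
  have h00 : ((q0 : ℂ) - (conj (Y 0 0) * Y 0 0 / p0 + conj (Y 1 0) * Y 1 0 / p1)) =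
      ((q0 - (normSq (Y 0 0) / p0 + normSq (Y 1 0) / p1) : ℝ) : ℂ) := by
    rw [← normSq_eq_conj_mul_self, ← normSq_eq_conj_mul_self]; push_cast; ring
  have h11 : ((q1 : ℂ) - (conj (Y 0 1) * Y 0 1 / p0 + conj (Y 1 1) * Y 1 1 / p1)) =
      ((q1 - (normSq (Y 0 1) / p0 + normSq (Y 1 1) / p1) : ℝ) : ℂ) := by
    rw [← normSq_eq_conj_mul_self, ← normSq_eq_conj_mul_self]; push_cast; ring
  have h10 : -(conj (Y 0 1) * Y 0 0 / (p0 : ℂ) + conj (Y 1 1) * Y 1 0 / p1) =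
      conj (-(conj (Y 0 0) * Y 0 1 / p0 + conj (Y 1 0) * Y 1 1 / p1)) := by
    simp only [map_neg, map_add, map_div₀, map_mul, Complex.conj_conj, Complex.conj_ofReal]
    ring
  rw [h00, h11, h10]
  exact posSemidef_fin_two_iff' _ _ _

/-- The scaled entries `w_ij = y_ij / √(p_i q_j)`. [folklore] -/
def wsc (p0 p1 q0 q1 : ℝ) (Y : Matrix (Fin 2) (Fin 2) ℂ) : ℂ × ℂ × ℂ × ℂ :=
  (Y 0 0 / ((Real.sqrt (p0 * q0) : ℝ) : ℂ), Y 0 1 / ((Real.sqrt (p0 * q1) : ℝ) : ℂ),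
   Y 1 0 / ((Real.sqrt (p1 * q0) : ℝ) : ℂ), Y 1 1 / ((Real.sqrt (p1 * q1) : ℝ) : ℂ))

/-- **Normalization**: `diag(q) - Yᴴ diag(p)⁻¹ Y ≥ 0 ⟺ W ∈ B`, `w_ij = y_ij/√(p_i q_j)`. [folklore] -/
theorem posSemidef_schur_diag_iff_inB {p0 p1 q0 q1 : ℝ} (hp0 : 0 < p0) (hp1 : 0 < p1)
    (hq0 : 0 < q0) (hq1 : 0 < q1) (Y : Matrix (Fin 2) (Fin 2) ℂ) :
    (diagonal ![(q0 : ℂ), q1] - Yᴴ * (diagonal ![(p0 : ℂ), p1])⁻¹ * Y).PosSemidef ↔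
      InB (wsc p0 p1 q0 q1 Y).1 (wsc p0 p1 q0 q1 Y).2.1 (wsc p0 p1 q0 q1 Y).2.2.1
        (wsc p0 p1 q0 q1 Y).2.2.2 := by
  rw [posSemidef_schur_diag_iff hp0 hp1]
  simp only [InB, wsc, detN]
  rw [normSq_div_sqrt _ (by positivity), normSq_div_sqrt _ (by positivity),
    normSq_div_sqrt _ (by positivity), normSq_div_sqrt _ (by positivity)]
  have hdet : Y 0 0 / ((Real.sqrt (p0 * q0) : ℝ) : ℂ) * (Y 1 1 / ((Real.sqrt (p1 * q1) : ℝ) : ℂ)) -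
      Y 0 1 / ((Real.sqrt (p0 * q1) : ℝ) : ℂ) * (Y 1 0 / ((Real.sqrt (p1 * q0) : ℝ) : ℂ)) =
      (Y 0 0 * Y 1 1 - Y 0 1 * Y 1 0) / ((Real.sqrt (p0 * q0 * (p1 * q1)) : ℝ) : ℂ) := by
    have h1 : ((Real.sqrt (p0 * q1) : ℝ) : ℂ) * ((Real.sqrt (p1 * q0) : ℝ) : ℂ) =
        ((Real.sqrt (p0 * q0 * (p1 * q1)) : ℝ) : ℂ) := by
      rw [ofReal_sqrt_mul_sqrt (by positivity)]; congr 2; ring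
    have h2 : ((Real.sqrt (p0 * q0) : ℝ) : ℂ) * ((Real.sqrt (p1 * q1) : ℝ) : ℂ) =
        ((Real.sqrt (p0 * q0 * (p1 * q1)) : ℝ) : ℂ) := ofReal_sqrt_mul_sqrt (by positivity)
    have hne : ((Real.sqrt (p0 * q0 * (p1 * q1)) : ℝ) : ℂ) ≠ 0 := by
      exact_mod_cast (Real.sqrt_pos.mpr (by positivity)).ne'
    have hne1 : ((Real.sqrt (p0 * q0) : ℝ) : ℂ) ≠ 0 := by
      exact_mod_cast (Real.sqrt_pos.mpr (by positivity)).ne'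
    have hne2 : ((Real.sqrt (p1 * q1) : ℝ) : ℂ) ≠ 0 := by
      exact_mod_cast (Real.sqrt_pos.mpr (by positivity)).ne'
    have hne3 : ((Real.sqrt (p0 * q1) : ℝ) : ℂ) ≠ 0 := by
      exact_mod_cast (Real.sqrt_pos.mpr (by positivity)).ne'
    have hne4 : ((Real.sqrt (p1 * q0) : ℝ) : ℂ) ≠ 0 := by
      exact_mod_cast (Real.sqrt_pos.mpr (by positivity)).ne'
    rw [div_mul_div_comm, div_mul_div_comm, h1, h2, ← sub_div]
  rw [hdet, normSq_div_sqrt _ (by positivity)]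
  -- now a real (in)equality bookkeeping: the three conditions match after clearing denominators
  have e1 : 0 ≤ q0 - (normSq (Y 0 0) / p0 + normSq (Y 1 0) / p1) ↔
      normSq (Y 0 0) / (p0 * q0) + normSq (Y 1 0) / (p1 * q0) ≤ 1 := by
    rw [show normSq (Y 0 0) / (p0 * q0) + normSq (Y 1 0) / (p1 * q0) =
      (normSq (Y 0 0) / p0 + normSq (Y 1 0) / p1) / q0 by field_simp]
    rw [div_le_one hq0]; constructor <;> intro h <;> linarith
  have e2 : 0 ≤ q1 - (normSq (Y 0 1) / p0 + normSq (Y 1 1) / p1) ↔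
      normSq (Y 0 1) / (p0 * q1) + normSq (Y 1 1) / (p1 * q1) ≤ 1 := by
    rw [show normSq (Y 0 1) / (p0 * q1) + normSq (Y 1 1) / (p1 * q1) =
      (normSq (Y 0 1) / p0 + normSq (Y 1 1) / p1) / q1 by field_simp]
    rw [div_le_one hq1]; constructor <;> intro h <;> linarith
  have e3 : (q0 - (normSq (Y 0 0) / p0 + normSq (Y 1 0) / p1)) *
        (q1 - (normSq (Y 0 1) / p0 + normSq (Y 1 1) / p1)) -
      normSq (-(conj (Y 0 0) * Y 0 1 / p0 + conj (Y 1 0) * Y 1 1 / p1)) =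
      q0 * q1 * (1 - (normSq (Y 0 0) / (p0 * q0) + normSq (Y 0 1) / (p0 * q1) +
        normSq (Y 1 0) / (p1 * q0) + normSq (Y 1 1) / (p1 * q1)) +
        normSq (Y 0 0 * Y 1 1 - Y 0 1 * Y 1 0) / (p0 * q0 * (p1 * q1))) := by
    have hp0' : (p0 : ℂ) ≠ 0 := by exact_mod_cast hp0.ne'
    have hp1' : (p1 : ℂ) ≠ 0 := by exact_mod_cast hp1.ne'
    simp only [Complex.normSq_apply, Complex.neg_re, Complex.neg_im, Complex.add_re,
      Complex.add_im, Complex.div_ofReal_re, Complex.div_ofReal_im, Complex.mul_re,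
      Complex.mul_im, Complex.conj_re, Complex.conj_im, Complex.sub_re, Complex.sub_im]
    field_simp
    ring
  rw [e1, e2]
  constructor
  · rintro ⟨h1, h2, h3⟩
    refine ⟨h1, h2, ?_⟩
    have : 0 ≤ q0 * q1 * _ := e3 ▸ sub_nonneg.mpr h3
    exact (mul_nonneg_iff_of_pos_left (mul_pos hq0 hq1)).mp this
  · rintro ⟨h1, h2, h3⟩
    refine ⟨h1, h2, ?_⟩
    have : 0 ≤ q0 * q1 * _ := mul_nonneg (mul_pos hq0 hq1).le h3
    rw [← e3] at this
    exact sub_nonneg.mp this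


/-! ### From the blocks `P, Q = ½ - P` to the normalized body -/

/-- `½·1 − diag(l₀, l₁) = diag(½ − l₀, ½ − l₁)`. [folklore] -/
theorem half_sub_diagonal (l0 l1 : ℝ) :
    (2 : ℂ)⁻¹ • (1 : Matrix (Fin 2) (Fin 2) ℂ) - diagonal ![(l0 : ℂ), l1] =
      diagonal ![((1 / 2 - l0 : ℝ) : ℂ), ((1 / 2 - l1 : ℝ) : ℂ)] := by
  ext i j
  fin_cases i <;> fin_cases j <;> simp [Matrix.diagonal, one_apply]

/-- **Diagonal-frame reduction for `ρ`**: with `P = U Λ U*`, `Q = ½ - P`,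
`ρ = fromBlocks P Z Zᴴ Q ≥ 0 ⟺ W ∈ B` where `W` are the scaled entries of `U* Z U`. [folklore] -/
theorem posSemidef_rho_iff_inB {U P Q Z : Matrix (Fin 2) (Fin 2) ℂ} {l0 l1 : ℝ}
    (hU : U * star U = 1)
    (hP : P = U * diagonal ![(l0 : ℂ), l1] * star U) (hQ : Q = (2 : ℂ)⁻¹ • 1 - P)
    (hl0 : 0 < l0) (hl1 : 0 < l1) (hm0 : 0 < 1 / 2 - l0) (hm1 : 0 < 1 / 2 - l1) :
    (fromBlocks P Z Zᴴ Q).PosSemidef ↔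
      InB (wsc l0 l1 (1 / 2 - l0) (1 / 2 - l1) (star U * Z * U)).1
        (wsc l0 l1 (1 / 2 - l0) (1 / 2 - l1) (star U * Z * U)).2.1
        (wsc l0 l1 (1 / 2 - l0) (1 / 2 - l1) (star U * Z * U)).2.2.1
        (wsc l0 l1 (1 / 2 - l0) (1 / 2 - l1) (star U * Z * U)).2.2.2 := by
  set Λ : Matrix (Fin 2) (Fin 2) ℂ := diagonal ![(l0 : ℂ), l1] with hΛ
  set Z' := star U * Z * U with hZ'
  have hZ : Z = U * Z' * star U := by
    rw [hZ', ← Matrix.mul_assoc, ← Matrix.mul_assoc, hU, Matrix.one_mul, Matrix.mul_assoc, hU,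
      Matrix.mul_one]
  have hZH : (U * Z' * star U)ᴴ = U * Z'ᴴ * star U := by
    simp only [conjTranspose_mul, star_eq_conjTranspose, conjTranspose_conjTranspose, Matrix.mul_assoc]
  have hQ' : Q = U * ((2 : ℂ)⁻¹ • 1 - Λ) * star U := by
    rw [hQ, hP, Matrix.mul_sub, Matrix.sub_mul, Matrix.mul_smul, Matrix.smul_mul, Matrix.mul_one, hU]
  have hΛpd : Λ.PosDef := by
    rw [hΛ, posDef_diagonal_iff]
    intro i; fin_cases i
    · simpa using hl0
    · simpa using hl1
  rw [hP, hZ, hZH, hQ', posSemidef_fromBlocks_conj_iff hU, posSemidef_rho_iff hΛpd, hΛ,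
    half_sub_diagonal, posSemidef_schur_diag_iff_inB hl0 hl1 hm0 hm1]

/-- **Diagonal-frame reduction for `ρ' = ½ - ρ`**: `fromBlocks Q (-Z) (-Z)ᴴ P ≥ 0 ⟺ W^μ ∈ B`,
spelled with `p ↔ q` swapped in the scaling. [folklore] -/
theorem posSemidef_rho'_iff_inB {U P Q Z : Matrix (Fin 2) (Fin 2) ℂ} {l0 l1 : ℝ}
    (hU : U * star U = 1)
    (hP : P = U * diagonal ![(l0 : ℂ), l1] * star U) (hQ : Q = (2 : ℂ)⁻¹ • 1 - P)
    (hl0 : 0 < l0) (hl1 : 0 < l1) (hm0 : 0 < 1 / 2 - l0) (hm1 : 0 < 1 / 2 - l1) :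
    (fromBlocks Q (-Z) (-Z)ᴴ P).PosSemidef ↔
      InB (wsc (1 / 2 - l0) (1 / 2 - l1) l0 l1 (star U * Z * U)).1
        (wsc (1 / 2 - l0) (1 / 2 - l1) l0 l1 (star U * Z * U)).2.1
        (wsc (1 / 2 - l0) (1 / 2 - l1) l0 l1 (star U * Z * U)).2.2.1
        (wsc (1 / 2 - l0) (1 / 2 - l1) l0 l1 (star U * Z * U)).2.2.2 := by
  set Λ : Matrix (Fin 2) (Fin 2) ℂ := diagonal ![(l0 : ℂ), l1] with hΛ
  set Z' := star U * Z * U with hZ'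
  have hZ : Z = U * Z' * star U := by
    rw [hZ', ← Matrix.mul_assoc, ← Matrix.mul_assoc, hU, Matrix.one_mul, Matrix.mul_assoc, hU,
      Matrix.mul_one]
  have hnZ : -Z = U * (-Z') * star U := by
    rw [hZ]; simp
  have hnZH : (U * (-Z') * star U)ᴴ = U * (-Z')ᴴ * star U := by
    simp only [conjTranspose_neg, conjTranspose_mul, star_eq_conjTranspose,
      conjTranspose_conjTranspose, Matrix.mul_assoc, Matrix.mul_neg, Matrix.neg_mul]
  have hQ' : Q = U * ((2 : ℂ)⁻¹ • 1 - Λ) * star U := by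
    rw [hQ, hP, Matrix.mul_sub, Matrix.sub_mul, Matrix.mul_smul, Matrix.smul_mul, Matrix.mul_one, hU]
  have hMpd : ((2 : ℂ)⁻¹ • (1 : Matrix (Fin 2) (Fin 2) ℂ) - Λ).PosDef := by
    rw [hΛ, half_sub_diagonal, posDef_diagonal_iff]
    intro i; fin_cases i
    · exact Complex.zero_lt_real.mpr hm0
    · exact Complex.zero_lt_real.mpr hm1
  have hΛ' : Λ = diagonal ![((l0 : ℝ) : ℂ), ((l1 : ℝ) : ℂ)] := hΛ
  rw [hP, hnZ, hnZH, hQ', posSemidef_fromBlocks_conj_iff hU, posSemidef_rho'_iff hMpd,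
    half_sub_diagonal, hΛ', posSemidef_schur_diag_iff_inB hm0 hm1 hl0 hl1]


/-! ## F4b. Fibre measure theory -/

/-! ### The off-diagonal block as a function of 8 real coordinates -/

/-- `Z = [[w0 + i w1, w2 + i w3], [w4 + i w5, w6 + i w7]]`. [folklore] -/
def Zmat (w : Fin 8 → ℝ) : Matrix (Fin 2) (Fin 2) ℂ :=
  !![⟨w 0, w 1⟩, ⟨w 2, w 3⟩; ⟨w 4, w 5⟩, ⟨w 6, w 7⟩]

/-- The inverse coordinate map. [folklore] -/
def vecZ (M : Matrix (Fin 2) (Fin 2) ℂ) : Fin 8 → ℝ :=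
  ![(M 0 0).re, (M 0 0).im, (M 0 1).re, (M 0 1).im, (M 1 0).re, (M 1 0).im, (M 1 1).re, (M 1 1).im]

/-- `Zmat ∘ vecZ = id`. [folklore] -/
@[simp] theorem Zmat_vecZ (M : Matrix (Fin 2) (Fin 2) ℂ) : Zmat (vecZ M) = M := by
  ext i j
  fin_cases i <;> fin_cases j <;> simp [Zmat, vecZ]

/-- `vecZ ∘ Zmat = id`. [folklore] -/
@[simp] theorem vecZ_Zmat (w : Fin 8 → ℝ) : vecZ (Zmat w) = w := by
  funext k
  fin_cases k <;> simp [Zmat, vecZ]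

/-- `Zmat` is additive. [folklore] -/
theorem Zmat_add (v w : Fin 8 → ℝ) : Zmat (v + w) = Zmat v + Zmat w := by
  ext i j
  fin_cases i <;> fin_cases j <;> simp [Zmat] <;> rfl

/-- `Zmat` is `ℝ`-homogeneous. [folklore] -/
theorem Zmat_smul (c : ℝ) (w : Fin 8 → ℝ) : Zmat (c • w) = (c : ℂ) • Zmat w := by
  ext i j
  fin_cases i <;> fin_cases j <;> apply Complex.ext <;> simp [Zmat]

/-- `vecZ` is additive. [folklore] -/
theorem vecZ_add (M N : Matrix (Fin 2) (Fin 2) ℂ) : vecZ (M + N) = vecZ M + vecZ N := by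
  funext k
  fin_cases k <;> simp [vecZ]

/-- `vecZ` is `ℝ`-homogeneous. [folklore] -/
theorem vecZ_smul (c : ℝ) (M : Matrix (Fin 2) (Fin 2) ℂ) : vecZ ((c : ℂ) • M) = c • vecZ M := by
  funext k
  fin_cases k <;> simp [vecZ]

/-- The Euclidean inner product of coordinate vectors is the real Frobenius inner product. [folklore] -/
theorem vecZ_dotProduct (M N : Matrix (Fin 2) (Fin 2) ℂ) :
    vecZ M ⬝ᵥ vecZ N = ((Mᴴ * N).trace).re := by
  simp [vecZ, dotProduct, Fin.sum_univ_succ, Matrix.trace, Matrix.mul_apply, conjTranspose_apply]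
  ring

/-- Conjugation `Z ↦ U* Z U` in the 8 real coordinates, as a linear map. [folklore] -/
def TU (U : Matrix (Fin 2) (Fin 2) ℂ) : (Fin 8 → ℝ) →ₗ[ℝ] (Fin 8 → ℝ) where
  toFun w := vecZ (star U * Zmat w * U)
  map_add' v w := by
    rw [Zmat_add, Matrix.mul_add, Matrix.add_mul, vecZ_add]
  map_smul' c w := by
    rw [Zmat_smul, Matrix.mul_smul, Matrix.smul_mul, vecZ_smul]
    rfl

/-- Unfolding lemma for `TU`. [folklore] -/
theorem TU_apply (U : Matrix (Fin 2) (Fin 2) ℂ) (w : Fin 8 → ℝ) :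
    TU U w = vecZ (star U * Zmat w * U) := rfl

/-- `Zmat (TU U w) = U* (Zmat w) U`. [folklore] -/
theorem Zmat_TU (U : Matrix (Fin 2) (Fin 2) ℂ) (w : Fin 8 → ℝ) :
    Zmat (TU U w) = star U * Zmat w * U := by
  rw [TU_apply, Zmat_vecZ]

/-- `Z ↦ U* Z U` preserves the real Frobenius inner product when `U U* = 1`. [folklore] -/
theorem TU_dotProduct {U : Matrix (Fin 2) (Fin 2) ℂ} (hU : U * star U = 1) (v w : Fin 8 → ℝ) :
    TU U v ⬝ᵥ TU U w = v ⬝ᵥ w := by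
  rw [TU_apply, TU_apply, vecZ_dotProduct]
  conv_rhs => rw [← vecZ_Zmat v, ← vecZ_Zmat w, vecZ_dotProduct]
  have hU' : U * Uᴴ = 1 := by simpa [star_eq_conjTranspose] using hU
  have h1 : (star U * Zmat v * U)ᴴ * (star U * Zmat w * U) = star U * ((Zmat v)ᴴ * Zmat w) * U := by
    simp only [conjTranspose_mul, star_eq_conjTranspose, conjTranspose_conjTranspose,
      Matrix.mul_assoc]
    rw [← Matrix.mul_assoc U Uᴴ, hU', Matrix.one_mul]
  rw [h1, Matrix.trace_mul_cycle, hU, Matrix.one_mul]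

/-- Hence it is an orthogonal transformation: `Aᵀ A = 1` for its matrix `A`. [folklore] -/
theorem TU_toMatrix_orthogonal {U : Matrix (Fin 2) (Fin 2) ℂ} (hU : U * star U = 1) :
    (LinearMap.toMatrix' (TU U))ᵀ * LinearMap.toMatrix' (TU U) = 1 := by
  ext i j
  rw [Matrix.mul_apply]
  simp only [transpose_apply, LinearMap.toMatrix'_apply]
  have := TU_dotProduct hU (Pi.single i 1) (Pi.single j 1)
  rw [dotProduct] at this
  rw [this, single_dotProduct, one_mul, Pi.single_apply, one_apply]

/-- `|det TU| = 1` (orthogonality). [folklore] -/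
theorem abs_det_TU {U : Matrix (Fin 2) (Fin 2) ℂ} (hU : U * star U = 1) :
    |LinearMap.det (TU U)| = 1 := by
  have h := congrArg Matrix.det (TU_toMatrix_orthogonal hU)
  rw [det_mul, det_transpose, det_one, LinearMap.det_toMatrix'] at h
  have h2 : |LinearMap.det (TU U)| ^ 2 = 1 := by rw [sq_abs, sq]; exact h
  nlinarith [abs_nonneg (LinearMap.det (TU U))]

/-- **`Z ↦ U* Z U` preserves Lebesgue measure on `ℝ⁸`.** [folklore] -/
theorem measurePreserving_TU {U : Matrix (Fin 2) (Fin 2) ℂ} (hU : U * star U = 1) :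
    MeasurePreserving (TU U) (volume : Measure (Fin 8 → ℝ)) volume := by
  refine ⟨(TU U).continuous_of_finiteDimensional.measurable, ?_⟩
  have hdet : LinearMap.det (TU U) ≠ 0 := by
    intro h; have := abs_det_TU hU; rw [h, abs_zero] at this; exact zero_ne_one this
  rw [Measure.map_linearMap_addHaar_eq_smul_addHaar _ hdet, abs_inv, abs_det_TU hU, inv_one,
    ENNReal.ofReal_one, one_smul]


/-! ### `ℝ⁸ ≃ ℂ⁴` -/

/-- The coordinates-to-entries map `ℝ⁸ → ℂ × ℂ × ℂ × ℂ`, `w ↦ (z₁₁, z₁₂, z₂₁, z₂₂)`. [folklore] -/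
def e8fun (w : Fin 8 → ℝ) : ℂ × ℂ × ℂ × ℂ :=
  ((w 0 : ℂ) + (w 1 : ℂ) * I, (w 2 : ℂ) + (w 3 : ℂ) * I, (w 4 : ℂ) + (w 5 : ℂ) * I,
    (w 6 : ℂ) + (w 7 : ℂ) * I)

/-- `e8fun w` lists the entries of `Zmat w`. [folklore] -/
theorem e8fun_eq_Zmat (w : Fin 8 → ℝ) :
    e8fun w = (Zmat w 0 0, Zmat w 0 1, Zmat w 1 0, Zmat w 1 1) := by
  simp only [e8fun, Zmat, ← Complex.mk_eq_add_mul_I]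
  rfl

/-- `e8fun` is measurable. [folklore] -/
theorem measurable_e8fun : Measurable e8fun := by
  unfold e8fun
  fun_prop

/-- Uncurrying preserves Lebesgue measure. [folklore] -/
theorem volume_preserving_curry_symm (Λ κ : Type*) [Fintype Λ] [Fintype κ] :
    MeasurePreserving (MeasurableEquiv.curry Λ κ ℝ).symm
      (volume : Measure (Λ → κ → ℝ)) (volume : Measure (Λ × κ → ℝ)) where
  measurable := (MeasurableEquiv.curry Λ κ ℝ).symm.measurable
  map_eq := by
    rw [volume_pi]
    refine (Measure.pi_eq fun s hs => ?_).symm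
    rw [MeasurableEquiv.map_apply, MeasurableEquiv.coe_curry_symm]
    have hpre : Function.uncurry ⁻¹' Set.univ.pi s =
        Set.univ.pi fun x : Λ => Set.univ.pi fun i : κ => s (x, i) := by
      ext f
      simp only [Set.mem_preimage, Set.mem_univ_pi, Function.uncurry_apply_pair, Prod.forall]
    rw [hpre, Measure.pi_pi]
    simp_rw [volume_pi_pi]
    rw [← Finset.univ_product_univ, Finset.prod_product]

/-- The library chain of measure-preserving equivalences realizing `e8fun`. [folklore] -/
def e8chain (w : Fin 8 → ℝ) : ℂ × ℂ × ℂ × ℂ :=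
  (Prod.map id (Prod.map id MeasurableEquiv.finTwoArrow) <|
    Prod.map id (MeasurableEquiv.piFinSuccAbove (fun _ => ℂ) 0) <|
      MeasurableEquiv.piFinSuccAbove (fun _ => ℂ) 0 <|
        fun i : Fin 4 => Complex.measurableEquivPi.symm
          ((MeasurableEquiv.curry (Fin 4) (Fin 2) ℝ)
            ((MeasurableEquiv.piCongrLeft (fun _ => ℝ) finProdFinEquiv).symm w) i))

/-- The library chain realizing `e8fun` is measure preserving. [folklore] -/
theorem measurePreserving_e8chain : MeasurePreserving e8chain volume volume := by
  have s1 : MeasurePreserving (MeasurableEquiv.piCongrLeft (fun _ => ℝ) finProdFinEquiv).symm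
      (volume : Measure (Fin 8 → ℝ)) (volume : Measure (Fin 4 × Fin 2 → ℝ)) :=
    (volume_measurePreserving_piCongrLeft (fun _ => ℝ) finProdFinEquiv).symm _
  have s2 : MeasurePreserving (MeasurableEquiv.curry (Fin 4) (Fin 2) ℝ)
      (volume : Measure (Fin 4 × Fin 2 → ℝ)) (volume : Measure (Fin 4 → Fin 2 → ℝ)) :=
    (volume_preserving_curry_symm (Fin 4) (Fin 2)).symm _
  have s3 : MeasurePreserving (fun (f : Fin 4 → Fin 2 → ℝ) (i : Fin 4) =>
      Complex.measurableEquivPi.symm (f i)) volume volume :=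
    volume_preserving_pi (fun _ => Complex.volume_preserving_equiv_pi.symm _)
  have s4 : MeasurePreserving (MeasurableEquiv.piFinSuccAbove (fun _ => ℂ) 0)
      (volume : Measure (Fin 4 → ℂ)) volume :=
    volume_preserving_piFinSuccAbove _ 0
  have s5 : MeasurePreserving (Prod.map id (MeasurableEquiv.piFinSuccAbove (fun _ => ℂ) 0))
      (volume : Measure (ℂ × (Fin 3 → ℂ))) volume :=
    (MeasurePreserving.id volume).prod (volume_preserving_piFinSuccAbove _ 0)
  have s6 : MeasurePreserving (Prod.map id (Prod.map id MeasurableEquiv.finTwoArrow))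
      (volume : Measure (ℂ × ℂ × (Fin 2 → ℂ))) (volume : Measure (ℂ × ℂ × ℂ × ℂ)) :=
    (MeasurePreserving.id volume).prod ((MeasurePreserving.id volume).prod
      (volume_preserving_finTwoArrow ℂ))
  exact s6.comp (s5.comp (s4.comp (s3.comp (s2.comp s1))))

/-- The library chain equals `e8fun` (definitionally). [folklore] -/
theorem e8chain_eq : e8chain = e8fun := by
  funext w
  rfl

/-- **`ℝ⁸ → ℂ⁴` (entries of `Z`) preserves Lebesgue measure.** [folklore] -/
theorem measurePreserving_e8fun : MeasurePreserving e8fun volume volume :=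
  e8chain_eq ▸ measurePreserving_e8chain



/-! ## F4c. Scaling and the fibre volumes -/

/-- Coordinate scaling `w ↦ (w_k / s_k)_k`. [folklore] -/
def scl (s : Fin 8 → ℝ) : (Fin 8 → ℝ) →ₗ[ℝ] (Fin 8 → ℝ) :=
  Matrix.toLin' (Matrix.diagonal fun k => (s k)⁻¹)

/-- Unfolding lemma for the scaling map `scl`. [folklore] -/
theorem scl_apply (s w : Fin 8 → ℝ) (k : Fin 8) : scl s w k = (s k)⁻¹ * w k := by
  simp [scl, Matrix.toLin'_apply, mulVec_diagonal]

/-- `det (scl s) = ∏ (s k)⁻¹`. [folklore] -/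
theorem det_scl (s : Fin 8 → ℝ) : LinearMap.det (scl s) = ∏ k, (s k)⁻¹ := by
  rw [scl, LinearMap.det_toLin', det_diagonal]

/-- Volume of a preimage under the coordinate scaling: factor `∏ s k`. [folklore] -/
theorem volume_preimage_scl {s : Fin 8 → ℝ} (hs : ∀ k, 0 < s k) (E : Set (Fin 8 → ℝ)) :
    volume (scl s ⁻¹' E) = ENNReal.ofReal (∏ k, s k) * volume E := by
  have hdet : LinearMap.det (scl s) ≠ 0 := by
    rw [det_scl]
    exact Finset.prod_ne_zero_iff.mpr fun k _ => inv_ne_zero (hs k).ne'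
  rw [Measure.addHaar_preimage_linearMap _ hdet E, det_scl, ← Finset.prod_inv_distrib]
  congr 2
  simp only [inv_inv]
  exact abs_of_pos (Finset.prod_pos fun k _ => hs k)

/-- The scale vector `(√(p_i q_j))` attached to the four entries (each twice: re and im). [folklore] -/
def sv (p0 p1 q0 q1 : ℝ) : Fin 8 → ℝ :=
  ![Real.sqrt (p0 * q0), Real.sqrt (p0 * q0), Real.sqrt (p0 * q1), Real.sqrt (p0 * q1),
    Real.sqrt (p1 * q0), Real.sqrt (p1 * q0), Real.sqrt (p1 * q1), Real.sqrt (p1 * q1)]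

/-- The scale vector is positive. [folklore] -/
theorem sv_pos {p0 p1 q0 q1 : ℝ} (hp0 : 0 < p0) (hp1 : 0 < p1) (hq0 : 0 < q0) (hq1 : 0 < q1)
    (k : Fin 8) : 0 < sv p0 p1 q0 q1 k := by
  fin_cases k <;> simp [sv] <;> positivity

/-- `∏ sv = (p₀p₁)² (q₀q₁)²`. [folklore] -/
theorem prod_sv {p0 p1 q0 q1 : ℝ} (hp0 : 0 < p0) (hp1 : 0 < p1) (hq0 : 0 < q0) (hq1 : 0 < q1) :
    ∏ k, sv p0 p1 q0 q1 k = (p0 * p1) ^ 2 * (q0 * q1) ^ 2 := by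
  have h : ∀ x : ℝ, 0 ≤ x → Real.sqrt x * Real.sqrt x = x := fun x hx => Real.mul_self_sqrt hx
  simp only [Fin.prod_univ_succ, Fin.prod_univ_zero, sv, Matrix.cons_val_zero, Matrix.cons_val_succ,
    mul_one]
  have e1 := h (p0 * q0) (by positivity)
  have e2 := h (p0 * q1) (by positivity)
  have e3 := h (p1 * q0) (by positivity)
  have e4 := h (p1 * q1) (by positivity)
  calc Real.sqrt (p0 * q0) * (Real.sqrt (p0 * q0) * (Real.sqrt (p0 * q1) * (Real.sqrt (p0 * q1) *
      (Real.sqrt (p1 * q0) * (Real.sqrt (p1 * q0) * (Real.sqrt (p1 * q1) * Real.sqrt (p1 * q1)))))))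
      = (Real.sqrt (p0 * q0) * Real.sqrt (p0 * q0)) * (Real.sqrt (p0 * q1) * Real.sqrt (p0 * q1)) *
        (Real.sqrt (p1 * q0) * Real.sqrt (p1 * q0)) * (Real.sqrt (p1 * q1) * Real.sqrt (p1 * q1)) := by
        ring
    _ = (p0 * p1) ^ 2 * (q0 * q1) ^ 2 := by rw [e1, e2, e3, e4]; ring

/-- Division of `x + iy` by a real number, componentwise. [folklore] -/
theorem div_ofReal_eq (x y r : ℝ) :
    ((x : ℂ) + (y : ℂ) * I) / (r : ℂ) = ((r⁻¹ * x : ℝ) : ℂ) + ((r⁻¹ * y : ℝ) : ℂ) * I := by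
  apply Complex.ext <;> simp [div_ofReal_re, div_ofReal_im] <;> ring

/-- The scaled entries of `Zmat w'` are `e8fun (scl sv w')`. [folklore] -/
theorem wsc_Zmat (p0 p1 q0 q1 : ℝ) (w : Fin 8 → ℝ) :
    wsc p0 p1 q0 q1 (Zmat w) = e8fun (scl (sv p0 p1 q0 q1) w) := by
  simp only [wsc, e8fun, scl_apply, Zmat, sv]
  simp only [Matrix.of_apply, Matrix.cons_val', Matrix.cons_val_zero, Matrix.cons_val_one,
    Matrix.empty_val', Matrix.cons_val_fin_one, Complex.mk_eq_add_mul_I, div_ofReal_eq]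
  rfl

/-- The ratio `r = μ₀/μ₁ = √(p₀ q₁) / √(q₀ p₁)`. [folklore] -/
def rat (p0 p1 q0 q1 : ℝ) : ℝ := Real.sqrt (p0 * q1) / Real.sqrt (q0 * p1)

/-- The ratio `rat` is positive. [folklore] -/
theorem rat_pos {p0 p1 q0 q1 : ℝ} (hp0 : 0 < p0) (hp1 : 0 < p1) (hq0 : 0 < q0) (hq1 : 0 < q1) :
    0 < rat p0 p1 q0 q1 := by
  unfold rat; positivity

/-- The swapped scaling expressed through the unswapped one: `W^μ = (a, r b, c / r, d)`. [folklore] -/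
theorem wsc_swap (p0 p1 q0 q1 : ℝ) (hp0 : 0 < p0) (hp1 : 0 < p1) (hq0 : 0 < q0) (hq1 : 0 < q1)
    (Y : Matrix (Fin 2) (Fin 2) ℂ) :
    wsc q0 q1 p0 p1 Y =
      ((wsc p0 p1 q0 q1 Y).1, (rat p0 p1 q0 q1 : ℂ) * (wsc p0 p1 q0 q1 Y).2.1,
        (wsc p0 p1 q0 q1 Y).2.2.1 / (rat p0 p1 q0 q1 : ℂ), (wsc p0 p1 q0 q1 Y).2.2.2) := by
  have h1 : ((Real.sqrt (p0 * q1) : ℝ) : ℂ) ≠ 0 := by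
    exact_mod_cast (Real.sqrt_pos.mpr (by positivity)).ne'
  have h2 : ((Real.sqrt (q0 * p1) : ℝ) : ℂ) ≠ 0 := by
    exact_mod_cast (Real.sqrt_pos.mpr (by positivity)).ne'
  have h3 : ((Real.sqrt (p1 * q0) : ℝ) : ℂ) ≠ 0 := by
    exact_mod_cast (Real.sqrt_pos.mpr (by positivity)).ne'
  simp only [wsc, rat, Complex.ofReal_div]
  refine Prod.ext ?_ (Prod.ext ?_ (Prod.ext ?_ ?_))
  · simp only; rw [mul_comm q0 p0]
  · simp only; field_simp
  · simp only
    rw [mul_comm q1 p0, mul_comm q0 p1]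
    field_simp
  · simp only; rw [mul_comm q1 p1]

/-- The normalized two-body set in `ℝ⁸` is the scaled pull-back of `Ebody r`. [folklore] -/
theorem setOf_inB_inB_eq {p0 p1 q0 q1 : ℝ} (hp0 : 0 < p0) (hp1 : 0 < p1) (hq0 : 0 < q0)
    (hq1 : 0 < q1) :
    {w : Fin 8 → ℝ |
      InB (wsc p0 p1 q0 q1 (Zmat w)).1 (wsc p0 p1 q0 q1 (Zmat w)).2.1
        (wsc p0 p1 q0 q1 (Zmat w)).2.2.1 (wsc p0 p1 q0 q1 (Zmat w)).2.2.2 ∧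
      InB (wsc q0 q1 p0 p1 (Zmat w)).1 (wsc q0 q1 p0 p1 (Zmat w)).2.1
        (wsc q0 q1 p0 p1 (Zmat w)).2.2.1 (wsc q0 q1 p0 p1 (Zmat w)).2.2.2} =
      scl (sv p0 p1 q0 q1) ⁻¹' (e8fun ⁻¹' Ebody (rat p0 p1 q0 q1)) := by
  ext w
  simp only [mem_setOf_eq, mem_preimage, Ebody, wsc_swap p0 p1 q0 q1 hp0 hp1 hq0 hq1, wsc_Zmat]

/-- The normalized one-body set in `ℝ⁸` is the scaled pull-back of `Ebody 1 = B`. [folklore] -/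
theorem setOf_inB_eq (p0 p1 q0 q1 : ℝ) :
    {w : Fin 8 → ℝ |
      InB (wsc p0 p1 q0 q1 (Zmat w)).1 (wsc p0 p1 q0 q1 (Zmat w)).2.1
        (wsc p0 p1 q0 q1 (Zmat w)).2.2.1 (wsc p0 p1 q0 q1 (Zmat w)).2.2.2} =
      scl (sv p0 p1 q0 q1) ⁻¹' (e8fun ⁻¹' Ebody 1) := by
  ext w
  simp only [mem_setOf_eq, mem_preimage, Ebody, wsc_Zmat, Complex.ofReal_one, one_mul, div_one,
    and_self]

/-- **Fibre volume, two-sided body** (block form): for `P = U diag(l₀,l₁) U*`, `Q = ½ - P`,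
`vol₈ {Z : ρ ≥ 0 ∧ ρ' ≥ 0} = (l₀ l₁ (½-l₀)(½-l₁))² · vol(B ∩ B_μ)`. [folklore] -/
theorem volume_fibre_two {U P Q : Matrix (Fin 2) (Fin 2) ℂ} {l0 l1 : ℝ}
    (hU : U * star U = 1)
    (hP : P = U * Matrix.diagonal ![(l0 : ℂ), l1] * star U) (hQ : Q = (2 : ℂ)⁻¹ • 1 - P)
    (hl0 : 0 < l0) (hl1 : 0 < l1) (hm0 : 0 < 1 / 2 - l0) (hm1 : 0 < 1 / 2 - l1) :
    volume {w : Fin 8 → ℝ | (fromBlocks P (Zmat w) (Zmat w)ᴴ Q).PosSemidef ∧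
        (fromBlocks Q (-Zmat w) (-Zmat w)ᴴ P).PosSemidef} =
      ENNReal.ofReal ((l0 * l1) ^ 2 * ((1 / 2 - l0) * (1 / 2 - l1)) ^ 2) *
        volume (Ebody (rat l0 l1 (1 / 2 - l0) (1 / 2 - l1))) := by
  have hset : {w : Fin 8 → ℝ | (fromBlocks P (Zmat w) (Zmat w)ᴴ Q).PosSemidef ∧
      (fromBlocks Q (-Zmat w) (-Zmat w)ᴴ P).PosSemidef} =
      TU U ⁻¹' {w : Fin 8 → ℝ |
        InB (wsc l0 l1 (1 / 2 - l0) (1 / 2 - l1) (Zmat w)).1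
          (wsc l0 l1 (1 / 2 - l0) (1 / 2 - l1) (Zmat w)).2.1
          (wsc l0 l1 (1 / 2 - l0) (1 / 2 - l1) (Zmat w)).2.2.1
          (wsc l0 l1 (1 / 2 - l0) (1 / 2 - l1) (Zmat w)).2.2.2 ∧
        InB (wsc (1 / 2 - l0) (1 / 2 - l1) l0 l1 (Zmat w)).1
          (wsc (1 / 2 - l0) (1 / 2 - l1) l0 l1 (Zmat w)).2.1
          (wsc (1 / 2 - l0) (1 / 2 - l1) l0 l1 (Zmat w)).2.2.1
          (wsc (1 / 2 - l0) (1 / 2 - l1) l0 l1 (Zmat w)).2.2.2} := by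
    ext w
    simp only [mem_setOf_eq, mem_preimage, Zmat_TU,
      posSemidef_rho_iff_inB hU hP hQ hl0 hl1 hm0 hm1, posSemidef_rho'_iff_inB hU hP hQ hl0 hl1 hm0 hm1]
  have hmeas : MeasurableSet (scl (sv l0 l1 (1 / 2 - l0) (1 / 2 - l1)) ⁻¹'
      (e8fun ⁻¹' Ebody (rat l0 l1 (1 / 2 - l0) (1 / 2 - l1)))) :=
    ((measurableSet_Ebody _).preimage measurable_e8fun).preimage
      (scl _).continuous_of_finiteDimensional.measurable
  rw [hset, setOf_inB_inB_eq hl0 hl1 hm0 hm1, (measurePreserving_TU hU).measure_preimage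
      hmeas.nullMeasurableSet, volume_preimage_scl (sv_pos hl0 hl1 hm0 hm1),
    measurePreserving_e8fun.measure_preimage (measurableSet_Ebody _).nullMeasurableSet,
    prod_sv hl0 hl1 hm0 hm1]

/-- **Fibre volume, one-sided body** (block form):
`vol₈ {Z : ρ ≥ 0} = (l₀ l₁ (½-l₀)(½-l₁))² · vol(B)`. [folklore] -/
theorem volume_fibre_one {U P Q : Matrix (Fin 2) (Fin 2) ℂ} {l0 l1 : ℝ}
    (hU : U * star U = 1)
    (hP : P = U * Matrix.diagonal ![(l0 : ℂ), l1] * star U) (hQ : Q = (2 : ℂ)⁻¹ • 1 - P)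
    (hl0 : 0 < l0) (hl1 : 0 < l1) (hm0 : 0 < 1 / 2 - l0) (hm1 : 0 < 1 / 2 - l1) :
    volume {w : Fin 8 → ℝ | (fromBlocks P (Zmat w) (Zmat w)ᴴ Q).PosSemidef} =
      ENNReal.ofReal ((l0 * l1) ^ 2 * ((1 / 2 - l0) * (1 / 2 - l1)) ^ 2) * volume (Ebody 1) := by
  have hset : {w : Fin 8 → ℝ | (fromBlocks P (Zmat w) (Zmat w)ᴴ Q).PosSemidef} =
      TU U ⁻¹' {w : Fin 8 → ℝ |
        InB (wsc l0 l1 (1 / 2 - l0) (1 / 2 - l1) (Zmat w)).1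
          (wsc l0 l1 (1 / 2 - l0) (1 / 2 - l1) (Zmat w)).2.1
          (wsc l0 l1 (1 / 2 - l0) (1 / 2 - l1) (Zmat w)).2.2.1
          (wsc l0 l1 (1 / 2 - l0) (1 / 2 - l1) (Zmat w)).2.2.2} := by
    ext w
    simp only [mem_setOf_eq, mem_preimage, Zmat_TU, posSemidef_rho_iff_inB hU hP hQ hl0 hl1 hm0 hm1]
  have hmeas : MeasurableSet (scl (sv l0 l1 (1 / 2 - l0) (1 / 2 - l1)) ⁻¹'
      (e8fun ⁻¹' Ebody 1)) :=
    ((measurableSet_Ebody _).preimage measurable_e8fun).preimage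
      (scl _).continuous_of_finiteDimensional.measurable
  rw [hset, setOf_inB_eq, (measurePreserving_TU hU).measure_preimage hmeas.nullMeasurableSet,
    volume_preimage_scl (sv_pos hl0 hl1 hm0 hm1),
    measurePreserving_e8fun.measure_preimage (measurableSet_Ebody _).nullMeasurableSet,
    prod_sv hl0 hl1 hm0 hm1]


/-! ## F5a. The chart blocks and the section volumes in chart coordinates -/

/-- The diagonal block `P = X = [[x0, x2 + i x3], [x2 - i x3, x1]]`. [folklore] -/
def Pmat (a : Fin 4 → ℝ) : Matrix (Fin 2) (Fin 2) ℂ :=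
  !![((a 0 : ℝ) : ℂ), (⟨a 2, a 3⟩ : ℂ); (⟨a 2, -a 3⟩ : ℂ), ((a 1 : ℝ) : ℂ)]

/-- The diagonal block `Q = ½ - X`. [folklore] -/
def Qmat (a : Fin 4 → ℝ) : Matrix (Fin 2) (Fin 2) ℂ :=
  !![((1 / 2 - a 0 : ℝ) : ℂ), (⟨-a 2, -a 3⟩ : ℂ); (⟨-a 2, a 3⟩ : ℂ), ((1 / 2 - a 1 : ℝ) : ℂ)]

/-- The `4 × 4` matrix glued from the diagonal-block coordinates `a` and the off-diagonal
coordinates `w`. [folklore] -/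
def rho2 (a : Fin 4 → ℝ) (w : Fin 8 → ℝ) : Matrix (Fin 4) (Fin 4) ℂ :=
  Matrix.reindex finSumFinEquiv finSumFinEquiv (fromBlocks (Pmat a) (Zmat w) (Zmat w)ᴴ (Qmat a))

/-- `Q = ½ - P` entrywise. [folklore] -/
theorem Qmat_eq (a : Fin 4 → ℝ) : Qmat a = (2 : ℂ)⁻¹ • 1 - Pmat a := by
  ext i j
  fin_cases i <;> fin_cases j <;> apply Complex.ext <;> norm_num [Qmat, Pmat]

/-- `P` in the Hermitian normal form `!![a, m; conj m, e]`. [folklore] -/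
theorem Pmat_eq (a : Fin 4 → ℝ) :
    Pmat a = !![((a 0 : ℝ) : ℂ), (⟨a 2, a 3⟩ : ℂ); conj (⟨a 2, a 3⟩ : ℂ), ((a 1 : ℝ) : ℂ)] := by
  ext i j
  fin_cases i <;> fin_cases j <;> rfl

/-- `P` is Hermitian. [folklore] -/
theorem isHermitian_Pmat (a : Fin 4 → ℝ) : (Pmat a).IsHermitian := by
  rw [Pmat_eq]; exact isHermitian_fin_two _ _ _

/-- `det P = x₀x₁ - (x₂² + x₃²)`. [folklore] -/
theorem det_Pmat (a : Fin 4 → ℝ) : (Pmat a).det = ((a 0 * a 1 - (a 2 ^ 2 + a 3 ^ 2) : ℝ) : ℂ) := by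
  rw [Matrix.det_fin_two]
  apply Complex.ext
  · simp [Pmat, sq]
  · simp [Pmat, sq]; ring

/-- `tr P = x₀ + x₁`. [folklore] -/
theorem trace_Pmat (a : Fin 4 → ℝ) : (Pmat a).trace = ((a 0 + a 1 : ℝ) : ℂ) := by
  rw [Matrix.trace_fin_two]
  apply Complex.ext <;> simp [Pmat]

/-- `½ - ρ = reindex (fromBlocks Q (-Z) (-Z)ᴴ P)`: the second body is again a block matrix with the diagonal blocks swapped. [folklore] -/
theorem half_sub_rho2 (a : Fin 4 → ℝ) (w : Fin 8 → ℝ) :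
    (2 : ℂ)⁻¹ • (1 : Matrix (Fin 4) (Fin 4) ℂ) - rho2 a w =
      Matrix.reindex finSumFinEquiv finSumFinEquiv
        (fromBlocks (Qmat a) (-Zmat w) (-Zmat w)ᴴ (Pmat a)) := by
  have h0 : fromBlocks ((2 : ℂ)⁻¹ • (1 : Matrix (Fin 2) (Fin 2) ℂ)) 0 0 ((2 : ℂ)⁻¹ • 1) =
      (2 : ℂ)⁻¹ • (1 : Matrix (Fin 2 ⊕ Fin 2) (Fin 2 ⊕ Fin 2) ℂ) := by
    conv_rhs => rw [← fromBlocks_one, fromBlocks_smul, smul_zero]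
  have h1 : (2 : ℂ)⁻¹ • (1 : Matrix (Fin 4) (Fin 4) ℂ) =
      Matrix.reindex finSumFinEquiv finSumFinEquiv
        (fromBlocks ((2 : ℂ)⁻¹ • 1) 0 0 ((2 : ℂ)⁻¹ • 1) : Matrix (Fin 2 ⊕ Fin 2) (Fin 2 ⊕ Fin 2) ℂ) := by
    rw [h0, reindex_apply]
    ext i j
    simp [one_apply]
  have h2 : fromBlocks ((2 : ℂ)⁻¹ • (1 : Matrix (Fin 2) (Fin 2) ℂ)) 0 0 ((2 : ℂ)⁻¹ • 1) -
      fromBlocks (Pmat a) (Zmat w) (Zmat w)ᴴ (Qmat a) =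
      fromBlocks (Qmat a) (-Zmat w) (-Zmat w)ᴴ (Pmat a) := by
    rw [sub_eq_add_neg, fromBlocks_neg, fromBlocks_add]
    congr 1
    · rw [Qmat_eq, sub_eq_add_neg]
    · simp
    · simp
    · rw [Qmat_eq]; simp
  rw [h1, rho2, reindex_apply, reindex_apply, ← h2]
  rfl

/-- **2×2 positive definiteness criterion** for `!![a, m; conj m, e]`. [folklore] -/
theorem posDef_fin_two_iff' (a e : ℝ) (m : ℂ) :
    (!![(a : ℂ), m; conj m, (e : ℂ)]).PosDef ↔ 0 < a ∧ normSq m < a * e := by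
  rw [posDef_iff_dotProduct_mulVec]
  simp only [quadForm_fin_two, Complex.zero_lt_real]
  constructor
  · rintro ⟨-, h⟩
    have h0 := h (x := ![1, 0]) (by simp)
    simp at h0
    refine ⟨h0, ?_⟩
    have h2 := h (x := ![-m, (a : ℂ)]) (by simp [h0.ne'])
    simp [Complex.normSq_apply] at h2
    have h3 : 0 < a * (a * e - normSq m) := by
      rw [Complex.normSq_apply]; nlinarith [h2]
    have h4 := (mul_pos_iff_of_pos_left h0).mp h3
    linarith
  · rintro ⟨h0, h2⟩
    refine ⟨isHermitian_fin_two a e m, fun x hx => ?_⟩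
    have he : 0 < e := by
      have : 0 < a * e := lt_of_le_of_lt (normSq_nonneg m) h2
      exact (mul_pos_iff_of_pos_left h0).mp this
    -- strict version of `quadForm_nonneg`
    by_cases hx1 : x 1 = 0
    · have hx0 : x 0 ≠ 0 := by
        intro h; apply hx; funext i; fin_cases i <;> simp [h, hx1]
      simp only [hx1, mul_zero, Complex.zero_re, map_zero, add_zero]
      exact mul_pos h0 (normSq_pos.mpr hx0)
    · -- perturb: use nonneg form with slightly smaller e
      obtain ⟨e', he', h2'⟩ : ∃ e', e' < e ∧ normSq m ≤ a * e' := by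
        refine ⟨(normSq m / a + e) / 2, ?_, ?_⟩
        · have : normSq m / a < e := by rw [div_lt_iff₀ h0]; linarith
          linarith
        · rw [show a * ((normSq m / a + e) / 2) = (normSq m + a * e) / 2 by field_simp]
          linarith
      have hq := quadForm_nonneg h0.le (by
        have : normSq m / a ≤ e' := by
          rw [div_le_iff₀ h0]; linarith
        linarith [div_nonneg (normSq_nonneg m) h0.le]) h2' (x 0) (x 1)
      have : 0 < (e - e') * normSq (x 1) := mul_pos (by linarith) (normSq_pos.mpr hx1)
      nlinarith

/-- Positive definiteness of `P` in coordinates. [folklore] -/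
theorem posDef_Pmat_iff (a : Fin 4 → ℝ) :
    (Pmat a).PosDef ↔ 0 < a 0 ∧ a 2 ^ 2 + a 3 ^ 2 < a 0 * a 1 := by
  rw [Pmat_eq, posDef_fin_two_iff', Complex.normSq_apply]
  simp only [sq]

/-- `Q` in the Hermitian normal form `!![a, m; conj m, e]`. [folklore] -/
theorem Qmat_eq' (a : Fin 4 → ℝ) :
    Qmat a = !![((1 / 2 - a 0 : ℝ) : ℂ), (⟨-a 2, -a 3⟩ : ℂ); conj (⟨-a 2, -a 3⟩ : ℂ),
      ((1 / 2 - a 1 : ℝ) : ℂ)] := by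
  ext i j
  fin_cases i <;> fin_cases j <;> apply Complex.ext <;> simp [Qmat]

/-- Positive definiteness of `Q` in coordinates. [folklore] -/
theorem posDef_Qmat_iff (a : Fin 4 → ℝ) :
    (Qmat a).PosDef ↔ 0 < 1 / 2 - a 0 ∧ a 2 ^ 2 + a 3 ^ 2 < (1 / 2 - a 0) * (1 / 2 - a 1) := by
  rw [Qmat_eq', posDef_fin_two_iff', Complex.normSq_apply]
  simp only [sq, neg_mul_neg]

/-- Positive semidefiniteness of `P` in coordinates. [folklore] -/
theorem posSemidef_Pmat_iff (a : Fin 4 → ℝ) :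
    (Pmat a).PosSemidef ↔ 0 ≤ a 0 ∧ 0 ≤ a 1 ∧ a 2 ^ 2 + a 3 ^ 2 ≤ a 0 * a 1 := by
  rw [Pmat_eq, posSemidef_fin_two_iff', Complex.normSq_apply]
  simp only [sq]

/-- Positive semidefiniteness of `Q` in coordinates. [folklore] -/
theorem posSemidef_Qmat_iff (a : Fin 4 → ℝ) :
    (Qmat a).PosSemidef ↔
      0 ≤ 1 / 2 - a 0 ∧ 0 ≤ 1 / 2 - a 1 ∧ a 2 ^ 2 + a 3 ^ 2 ≤ (1 / 2 - a 0) * (1 / 2 - a 1) := by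
  rw [Qmat_eq', posSemidef_fin_two_iff', Complex.normSq_apply]
  simp only [sq, neg_mul_neg]

/-- The good region `G = {P > 0, Q > 0}` in coordinates. [folklore] -/
def Good (a : Fin 4 → ℝ) : Prop :=
  0 < a 0 ∧ a 2 ^ 2 + a 3 ^ 2 < a 0 * a 1 ∧ 0 < 1 / 2 - a 0 ∧
    a 2 ^ 2 + a 3 ^ 2 < (1 / 2 - a 0) * (1 / 2 - a 1)

/-- Spectral data of `P` on the good region. [folklore] -/
theorem spectral_Pmat (a : Fin 4 → ℝ) :
    ∃ (U : Matrix (Fin 2) (Fin 2) ℂ) (l0 l1 : ℝ), U * star U = 1 ∧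
      Pmat a = U * Matrix.diagonal ![(l0 : ℂ), l1] * star U ∧
      l0 + l1 = a 0 + a 1 ∧ l0 * l1 = a 0 * a 1 - (a 2 ^ 2 + a 3 ^ 2) := by
  classical
  have hH := isHermitian_Pmat a
  refine ⟨(hH.eigenvectorUnitary : Matrix (Fin 2) (Fin 2) ℂ), hH.eigenvalues 0, hH.eigenvalues 1,
    Matrix.mem_unitaryGroup_iff.mp (hH.eigenvectorUnitary).2, ?_, ?_, ?_⟩
  · have h := hH.spectral_theorem
    rw [Unitary.conjStarAlgAut_apply] at h
    have hd : (Matrix.diagonal (RCLike.ofReal ∘ hH.eigenvalues) : Matrix (Fin 2) (Fin 2) ℂ) =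
        Matrix.diagonal ![((hH.eigenvalues 0 : ℝ) : ℂ), ((hH.eigenvalues 1 : ℝ) : ℂ)] := by
      congr 1
      funext i
      fin_cases i <;> rfl
    rw [hd] at h
    exact h
  · have h := hH.trace_eq_sum_eigenvalues
    rw [trace_Pmat, Fin.sum_univ_two] at h
    have h2 := congrArg Complex.re h
    simpa using h2.symm
  · have h := hH.det_eq_prod_eigenvalues
    rw [det_Pmat, Fin.prod_univ_two] at h
    have h2 := congrArg Complex.re h
    simpa [sq] using h2.symm

/-- On the good region both eigenvalues of `P` and of `Q = ½ - P` are positive. [folklore] -/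
theorem eig_pos {a : Fin 4 → ℝ} (hG : Good a) {l0 l1 : ℝ} (hs : l0 + l1 = a 0 + a 1)
    (hp : l0 * l1 = a 0 * a 1 - (a 2 ^ 2 + a 3 ^ 2)) :
    0 < l0 ∧ 0 < l1 ∧ 0 < 1 / 2 - l0 ∧ 0 < 1 / 2 - l1 := by
  obtain ⟨h0, h1, h2, h3⟩ := hG
  have hm : 0 ≤ a 2 ^ 2 + a 3 ^ 2 := by positivity
  have ha1 : 0 < a 1 := by
    by_contra h; push Not at h; nlinarith
  have ha1' : 0 < 1 / 2 - a 1 := by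
    by_contra h; push Not at h; nlinarith
  have hprod : 0 < l0 * l1 := by rw [hp]; linarith
  have hsum : 0 < l0 + l1 := by rw [hs]; linarith
  have hprod' : 0 < (1 / 2 - l0) * (1 / 2 - l1) := by nlinarith
  have hsum' : 0 < (1 / 2 - l0) + (1 / 2 - l1) := by linarith
  have hl0 : 0 < l0 := by
    by_contra h; push Not at h
    have : l1 ≤ 0 ∨ 0 < l1 := le_or_gt l1 0
    rcases this with h' | h'
    · linarith
    · nlinarith
  have hl1 : 0 < l1 := by
    by_contra h; push Not at h; nlinarith
  have hm0 : 0 < 1 / 2 - l0 := by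
    by_contra h; push Not at h
    rcases le_or_gt (1 / 2 - l1) 0 with h' | h'
    · linarith
    · nlinarith
  have hm1 : 0 < 1 / 2 - l1 := by
    by_contra h; push Not at h; nlinarith
  exact ⟨hl0, hl1, hm0, hm1⟩

/-- `ε²(rat) = min ratio`, explicitly. [folklore] -/
theorem epsSq_rat {p0 p1 q0 q1 : ℝ} (hp0 : 0 < p0) (hp1 : 0 < p1) (hq0 : 0 < q0) (hq1 : 0 < q1) :
    epsSq (rat p0 p1 q0 q1) = min (p0 * q1 / (q0 * p1)) (q0 * p1 / (p0 * q1)) := by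
  unfold epsSq rat
  rw [div_pow, Real.sq_sqrt (by positivity), Real.sq_sqrt (by positivity), inv_div]

/-- The two-body density polynomial in `(t, r)`. [folklore] -/
def phi2 (t r : ℝ) : ℝ :=
  4 * (t - r) ^ 3 * (t + r) * (1 / 2 - t + r) * (1 / 2 - t - r) ^ 3 - (t - r) ^ 4 * (1 / 2 - t - r) ^ 4

/-- Half-trace and the eigenvalue half-gap of `P`. [folklore] -/
def tOf (a : Fin 4 → ℝ) : ℝ := (a 0 + a 1) / 2

/-- The half-gap `r = √(((x₀-x₁)/2)² + x₂² + x₃²)` between the eigenvalues `t ± r` of `P`. [folklore] -/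
def rOf (a : Fin 4 → ℝ) : ℝ := Real.sqrt (((a 0 - a 1) / 2) ^ 2 + a 2 ^ 2 + a 3 ^ 2)

/-- `r ≥ 0`. [folklore] -/
theorem rOf_nonneg (a : Fin 4 → ℝ) : 0 ≤ rOf a := Real.sqrt_nonneg _

/-- `r² = ((x₀-x₁)/2)² + x₂² + x₃²`. [folklore] -/
theorem rOf_sq (a : Fin 4 → ℝ) : rOf a ^ 2 = ((a 0 - a 1) / 2) ^ 2 + a 2 ^ 2 + a 3 ^ 2 :=
  Real.sq_sqrt (by positivity)

/-- The eigenvalues are `t ± r`. [folklore] -/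
theorem eig_eq {a : Fin 4 → ℝ} {l0 l1 : ℝ} (hs : l0 + l1 = a 0 + a 1)
    (hp : l0 * l1 = a 0 * a 1 - (a 2 ^ 2 + a 3 ^ 2)) :
    (l0 = tOf a + rOf a ∧ l1 = tOf a - rOf a) ∨ (l0 = tOf a - rOf a ∧ l1 = tOf a + rOf a) := by
  have hr2 := rOf_sq a
  have hd : (l0 - l1) ^ 2 = (2 * rOf a) ^ 2 := by
    have : (l0 - l1) ^ 2 = (l0 + l1) ^ 2 - 4 * (l0 * l1) := by ring
    rw [this, hs, hp, mul_pow, hr2]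
    ring
  have ht : tOf a = (l0 + l1) / 2 := by rw [tOf, hs]
  rcases eq_or_eq_neg_of_sq_eq_sq _ _ hd with h | h
  · left; constructor <;> linarith
  · right; constructor <;> linarith

/-- The two-body density identity: `(l₀l₁q₀q₁)² ε²(4-ε²) = phi2 t r`. [folklore] -/
theorem density_two_eq {a : Fin 4 → ℝ} (hG : Good a) {l0 l1 : ℝ} (hs : l0 + l1 = a 0 + a 1)
    (hp : l0 * l1 = a 0 * a 1 - (a 2 ^ 2 + a 3 ^ 2)) :
    (l0 * l1) ^ 2 * ((1 / 2 - l0) * (1 / 2 - l1)) ^ 2 *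
        (epsSq (rat l0 l1 (1 / 2 - l0) (1 / 2 - l1)) *
          (4 - epsSq (rat l0 l1 (1 / 2 - l0) (1 / 2 - l1)))) = phi2 (tOf a) (rOf a) := by
  obtain ⟨hl0, hl1, hm0, hm1⟩ := eig_pos hG hs hp
  rw [epsSq_rat hl0 hl1 hm0 hm1]
  have hr0 := rOf_nonneg a
  rcases eig_eq hs hp with ⟨e0, e1⟩ | ⟨e0, e1⟩
  · -- l0 = t + r ≥ l1 = t - r : the second ratio is the smaller one
    have h1 : (1 / 2 - l0) * l1 ≤ l0 * (1 / 2 - l1) := by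
      have : l1 ≤ l0 := by linarith
      nlinarith
    have hle : (1 / 2 - l0) * l1 / (l0 * (1 / 2 - l1)) ≤ l0 * (1 / 2 - l1) / ((1 / 2 - l0) * l1) := by
      rw [div_le_div_iff₀ (by positivity) (by positivity)]
      exact mul_self_le_mul_self (by positivity) h1
    have key : (l0 * l1) ^ 2 * ((1 / 2 - l0) * (1 / 2 - l1)) ^ 2 *
        ((1 / 2 - l0) * l1 / (l0 * (1 / 2 - l1)) * (4 - (1 / 2 - l0) * l1 / (l0 * (1 / 2 - l1)))) =
        4 * ((1 / 2 - l0) * l1) ^ 3 * (l0 * (1 / 2 - l1)) - ((1 / 2 - l0) * l1) ^ 4 := by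
      set D := l0 * (1 / 2 - l1) with hDdef
      set N := (1 / 2 - l0) * l1 with hNdef
      have hD0 : D ≠ 0 := by rw [hDdef]; positivity
      rw [show (l0 * l1) ^ 2 * ((1 / 2 - l0) * (1 / 2 - l1)) ^ 2 = N ^ 2 * D ^ 2 by
        rw [hNdef, hDdef]; ring]
      field_simp
    rw [min_eq_right hle, key, e0, e1, phi2]
    ring
  · have h1 : l0 * (1 / 2 - l1) ≤ (1 / 2 - l0) * l1 := by
      have : l0 ≤ l1 := by linarith
      nlinarith
    have hle : l0 * (1 / 2 - l1) / ((1 / 2 - l0) * l1) ≤ (1 / 2 - l0) * l1 / (l0 * (1 / 2 - l1)) := by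
      rw [div_le_div_iff₀ (by positivity) (by positivity)]
      exact mul_self_le_mul_self (by positivity) h1
    have key : (l0 * l1) ^ 2 * ((1 / 2 - l0) * (1 / 2 - l1)) ^ 2 *
        (l0 * (1 / 2 - l1) / ((1 / 2 - l0) * l1) * (4 - l0 * (1 / 2 - l1) / ((1 / 2 - l0) * l1))) =
        4 * (l0 * (1 / 2 - l1)) ^ 3 * ((1 / 2 - l0) * l1) - (l0 * (1 / 2 - l1)) ^ 4 := by
      set D := (1 / 2 - l0) * l1 with hDdef
      set N := l0 * (1 / 2 - l1) with hNdef
      have hD0 : D ≠ 0 := by rw [hDdef]; positivity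
      rw [show (l0 * l1) ^ 2 * ((1 / 2 - l0) * (1 / 2 - l1)) ^ 2 = N ^ 2 * D ^ 2 by
        rw [hNdef, hDdef]; ring]
      field_simp
    rw [min_eq_left hle, key, e0, e1, phi2]
    ring

/-- `ε²(1) = 1`. [folklore] -/
theorem epsSq_one : epsSq 1 = 1 := by simp [epsSq]

/-- **Section volume of `K` over the good region.** [folklore] -/
theorem volume_section_K {a : Fin 4 → ℝ} (hG : Good a) :
    volume {w : Fin 8 → ℝ | (rho2 a w).PosSemidef} =
      ENNReal.ofReal (π ^ 4 / 12 * ((a 0 * a 1 - (a 2 ^ 2 + a 3 ^ 2)) ^ 2 *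
        ((1 / 2 - a 0) * (1 / 2 - a 1) - (a 2 ^ 2 + a 3 ^ 2)) ^ 2)) := by
  obtain ⟨U, l0, l1, hU, hP, hs, hp⟩ := spectral_Pmat a
  obtain ⟨hl0, hl1, hm0, hm1⟩ := eig_pos hG hs hp
  have hset : {w : Fin 8 → ℝ | (rho2 a w).PosSemidef} =
      {w : Fin 8 → ℝ | (fromBlocks (Pmat a) (Zmat w) (Zmat w)ᴴ (Qmat a)).PosSemidef} := by
    ext w
    simp only [mem_setOf_eq, rho2, reindex_apply, posSemidef_submatrix_equiv]
  rw [hset, volume_fibre_one hU hP (Qmat_eq a) hl0 hl1 hm0 hm1, volume_Ebody_eq one_pos, epsSq_one,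
    ← ENNReal.ofReal_mul (by positivity)]
  congr 1
  have hq : (1 / 2 - l0) * (1 / 2 - l1) = (1 / 2 - a 0) * (1 / 2 - a 1) - (a 2 ^ 2 + a 3 ^ 2) := by
    nlinarith
  rw [hp, hq]
  ring

/-- **Section volume of `K'` over the good region.** [folklore] -/
theorem volume_section_K' {a : Fin 4 → ℝ} (hG : Good a) :
    volume {w : Fin 8 → ℝ | (rho2 a w).PosSemidef ∧
        ((2 : ℂ)⁻¹ • (1 : Matrix (Fin 4) (Fin 4) ℂ) - rho2 a w).PosSemidef} =
      ENNReal.ofReal (π ^ 4 / 36 * phi2 (tOf a) (rOf a)) := by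
  obtain ⟨U, l0, l1, hU, hP, hs, hp⟩ := spectral_Pmat a
  obtain ⟨hl0, hl1, hm0, hm1⟩ := eig_pos hG hs hp
  have hset : {w : Fin 8 → ℝ | (rho2 a w).PosSemidef ∧
      ((2 : ℂ)⁻¹ • (1 : Matrix (Fin 4) (Fin 4) ℂ) - rho2 a w).PosSemidef} =
      {w : Fin 8 → ℝ | (fromBlocks (Pmat a) (Zmat w) (Zmat w)ᴴ (Qmat a)).PosSemidef ∧
        (fromBlocks (Qmat a) (-Zmat w) (-Zmat w)ᴴ (Pmat a)).PosSemidef} := by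
    ext w
    simp only [mem_setOf_eq, half_sub_rho2]
    simp only [rho2, reindex_apply, posSemidef_submatrix_equiv]
  rw [hset, volume_fibre_two hU hP (Qmat_eq a) hl0 hl1 hm0 hm1,
    volume_Ebody_eq (rat_pos hl0 hl1 hm0 hm1), ← ENNReal.ofReal_mul (by positivity),
    ← density_two_eq hG hs hp]
  congr 1
  ring

/-- Off the closed good region the sections are empty: `ρ ≥ 0` forces `P ≥ 0` and `Q ≥ 0`. [folklore] -/
theorem posSemidef_blocks_of_rho2 {a : Fin 4 → ℝ} {w : Fin 8 → ℝ} (h : (rho2 a w).PosSemidef) :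
    (Pmat a).PosSemidef ∧ (Qmat a).PosSemidef := by
  rw [rho2, reindex_apply, posSemidef_submatrix_equiv] at h
  constructor
  · have := h.submatrix Sum.inl
    convert this using 1
    ext i j
    rfl
  · have := h.submatrix Sum.inr
    convert this using 1
    ext i j
    rfl


/-! ## F5b. Glueing the chart; measurability; null sets; a.e. densities -/

/-- Splitting the 12 coordinates into the 4 diagonal-block and 8 off-diagonal ones. [folklore] -/
def glue : (Fin 12 → ℝ) ≃ᵐ (Fin 4 → ℝ) × (Fin 8 → ℝ) :=
  (MeasurableEquiv.piCongrLeft (fun _ : Fin 12 => ℝ) finSumFinEquiv).symm.trans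
    (MeasurableEquiv.sumPiEquivProdPi (fun _ : Fin 4 ⊕ Fin 8 => ℝ))

/-- `glue` preserves Lebesgue measure. [folklore] -/
theorem measurePreserving_glue : MeasurePreserving glue volume volume := by
  have h1 := (volume_measurePreserving_piCongrLeft (fun _ : Fin 12 => ℝ)
    (finSumFinEquiv : Fin 4 ⊕ Fin 8 ≃ Fin 12)).symm _
  have h2 := measurePreserving_sumPiEquivProdPi (fun _ : Fin 4 ⊕ Fin 8 => (volume : Measure ℝ))
  exact h2.comp h1

/-- **The chart is the glued block matrix** (definitional). [folklore] -/
theorem qubitFibreMatrix_eq_rho2 (x : Fin 12 → ℝ) :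
    qubitFibreMatrix x = rho2 (glue x).1 (glue x).2 := by
  ext i j
  fin_cases i <;> fin_cases j <;> rfl

/-! ### Closedness of the PSD cone and measurability of the bodies -/

/-- `{z : ℂ | 0 ≤ z}` is closed. [folklore] -/
theorem isClosed_complex_nonneg : IsClosed {z : ℂ | 0 ≤ z} := by
  have : {z : ℂ | 0 ≤ z} = Complex.re ⁻¹' Ici 0 ∩ Complex.im ⁻¹' {0} := by
    ext z
    simp only [mem_setOf_eq, Complex.nonneg_iff, mem_inter_iff, mem_preimage, mem_Ici,
      mem_singleton_iff, eq_comm]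
  rw [this]
  exact (isClosed_Ici.preimage Complex.continuous_re).inter
    (isClosed_singleton.preimage Complex.continuous_im)

/-- The cone of positive semidefinite `4 × 4` complex matrices is closed. [folklore] -/
theorem isClosed_posSemidef : IsClosed {M : Matrix (Fin 4) (Fin 4) ℂ | M.PosSemidef} := by
  have hset : {M : Matrix (Fin 4) (Fin 4) ℂ | M.PosSemidef} =
      {M | Mᴴ = M} ∩ ⋂ v : Fin 4 → ℂ, {M | 0 ≤ star v ⬝ᵥ (M *ᵥ v)} := by
    ext M
    simp only [mem_setOf_eq, posSemidef_iff_dotProduct_mulVec, mem_inter_iff, mem_iInter,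
      Matrix.IsHermitian]
  rw [hset]
  refine (isClosed_eq continuous_id.matrix_conjTranspose continuous_id).inter ?_
  refine isClosed_iInter fun v => ?_
  exact isClosed_complex_nonneg.preimage
    (continuous_const.dotProduct (continuous_id.matrix_mulVec continuous_const))

/-- Continuity of `x ↦ ⟨f x, g x⟩ : ℂ`. [folklore] -/
theorem continuous_cmk {α : Type*} [TopologicalSpace α] {f g : α → ℝ} (hf : Continuous f)
    (hg : Continuous g) : Continuous fun x => (⟨f x, g x⟩ : ℂ) := by
  have h : (fun x => (⟨f x, g x⟩ : ℂ)) = fun x => (f x : ℂ) + (g x : ℂ) * I :=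
    funext fun x => Complex.mk_eq_add_mul_I _ _
  rw [h]
  fun_prop

/-- The chart is continuous. [folklore] -/
theorem continuous_qubitFibreMatrix : Continuous qubitFibreMatrix := by
  refine continuous_matrix fun i j => ?_
  fin_cases i <;> fin_cases j <;> simp [qubitFibreMatrix] <;> first
    | fun_prop
    | (apply continuous_cmk <;> fun_prop)

/-- The body `K = {ρ ≥ 0}` in the chart. [folklore] -/
def Kset : Set (Fin 12 → ℝ) := {x | (qubitFibreMatrix x).PosSemidef}

/-- The body `K' = {0 ≤ ρ ≤ ½}` in the chart. [folklore] -/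
def K'set : Set (Fin 12 → ℝ) :=
  {x | (qubitFibreMatrix x).PosSemidef ∧
    ((2 : ℂ)⁻¹ • (1 : Matrix (Fin 4) (Fin 4) ℂ) - qubitFibreMatrix x).PosSemidef}

/-- `K` is closed. [folklore] -/
theorem isClosed_Kset : IsClosed Kset :=
  isClosed_posSemidef.preimage continuous_qubitFibreMatrix

/-- `K'` is closed. [folklore] -/
theorem isClosed_K'set : IsClosed K'set :=
  (isClosed_posSemidef.preimage continuous_qubitFibreMatrix).inter
    (isClosed_posSemidef.preimage (continuous_const.sub continuous_qubitFibreMatrix))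

/-- The bodies in the split coordinates. [folklore] -/
def K2 : Set ((Fin 4 → ℝ) × (Fin 8 → ℝ)) := {p | (rho2 p.1 p.2).PosSemidef}

/-- The two-sided body in the split coordinates. [folklore] -/
def K2' : Set ((Fin 4 → ℝ) × (Fin 8 → ℝ)) :=
  {p | (rho2 p.1 p.2).PosSemidef ∧ ((2 : ℂ)⁻¹ • (1 : Matrix (Fin 4) (Fin 4) ℂ) - rho2 p.1 p.2).PosSemidef}

/-- `K` is the pull-back of `K2` along `glue`. [folklore] -/
theorem Kset_eq : Kset = glue ⁻¹' K2 := by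
  ext x
  simp only [Kset, K2, mem_setOf_eq, mem_preimage, qubitFibreMatrix_eq_rho2]

/-- `K'` is the pull-back of `K2'` along `glue`. [folklore] -/
theorem K'set_eq : K'set = glue ⁻¹' K2' := by
  ext x
  simp only [K'set, K2', mem_setOf_eq, mem_preimage, qubitFibreMatrix_eq_rho2]

/-- `K2` is the pull-back of `K` along `glue.symm`. [folklore] -/
theorem K2_eq : K2 = glue.symm ⁻¹' Kset := by
  rw [Kset_eq, ← Set.preimage_comp]; simp

/-- `K2'` is the pull-back of `K'` along `glue.symm`. [folklore] -/
theorem K2'_eq : K2' = glue.symm ⁻¹' K'set := by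
  rw [K'set_eq, ← Set.preimage_comp]; simp

/-- `K2` is measurable. [folklore] -/
theorem measurableSet_K2 : MeasurableSet K2 := by
  rw [K2_eq]; exact isClosed_Kset.measurableSet.preimage glue.symm.measurable

/-- `K2'` is measurable. [folklore] -/
theorem measurableSet_K2' : MeasurableSet K2' := by
  rw [K2'_eq]; exact isClosed_K'set.measurableSet.preimage glue.symm.measurable

/-- `vol₁₂(K) = ∫ vol₈(sections)`. [folklore] -/
theorem volume_Kset : volume Kset = ∫⁻ a : Fin 4 → ℝ, volume {w : Fin 8 → ℝ | (rho2 a w).PosSemidef} := by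
  rw [Kset_eq, measurePreserving_glue.measure_preimage measurableSet_K2.nullMeasurableSet,
    Measure.volume_eq_prod, Measure.prod_apply measurableSet_K2]
  rfl

/-- `vol₁₂(K') = ∫ vol₈(sections)`. [folklore] -/
theorem volume_K'set : volume K'set = ∫⁻ a : Fin 4 → ℝ, volume {w : Fin 8 → ℝ | (rho2 a w).PosSemidef ∧
    ((2 : ℂ)⁻¹ • (1 : Matrix (Fin 4) (Fin 4) ℂ) - rho2 a w).PosSemidef} := by
  rw [K'set_eq, measurePreserving_glue.measure_preimage measurableSet_K2'.nullMeasurableSet,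
    Measure.volume_eq_prod, Measure.prod_apply measurableSet_K2']
  rfl

/-! ### Null sets -/

/-- A graph-like zero set `{a | a₀ f(a₁,a₂,a₃) = g(a₁,a₂,a₃)}` is null when `{f = 0}` is null. [folklore] -/
theorem volume_graph_eq_zero {f g : (Fin 3 → ℝ) → ℝ} (hf : Measurable f) (hg : Measurable g)
    (hf0 : volume {y : Fin 3 → ℝ | f y = 0} = 0) :
    volume {a : Fin 4 → ℝ | a 0 * f (fun k => a k.succ) = g (fun k => a k.succ)} = 0 := by
  set e := MeasurableEquiv.piFinSuccAbove (fun _ : Fin 4 => ℝ) 0 with he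
  have hme : MeasurePreserving e volume volume := volume_preserving_piFinSuccAbove _ 0
  have hset : {a : Fin 4 → ℝ | a 0 * f (fun k => a k.succ) = g (fun k => a k.succ)} =
      e ⁻¹' {p : ℝ × (Fin 3 → ℝ) | p.1 * f p.2 = g p.2} := by
    ext a; rfl
  have hS : MeasurableSet {p : ℝ × (Fin 3 → ℝ) | p.1 * f p.2 = g p.2} :=
    measurableSet_eq_fun (measurable_fst.mul (hf.comp measurable_snd)) (hg.comp measurable_snd)
  rw [hset, hme.measure_preimage hS.nullMeasurableSet, Measure.volume_eq_prod,
    Measure.prod_apply_symm hS]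
  have hae : (fun y : Fin 3 → ℝ => volume ((fun x : ℝ => (x, y)) ⁻¹'
      {p : ℝ × (Fin 3 → ℝ) | p.1 * f p.2 = g p.2})) =ᵐ[volume] 0 := by
    rw [← compl_mem_ae_iff] at hf0
    filter_upwards [hf0] with y hy
    have hy' : f y ≠ 0 := hy
    have : (fun x : ℝ => (x, y)) ⁻¹' {p : ℝ × (Fin 3 → ℝ) | p.1 * f p.2 = g p.2} = {g y / f y} := by
      ext x
      simp only [mem_preimage, mem_setOf_eq, mem_singleton_iff]
      rw [eq_div_iff hy']
    rw [this]
    exact measure_singleton _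
  rw [lintegral_congr_ae hae]
  simp only [Pi.zero_apply, lintegral_zero]

/-- A coordinate hyperplane in `ℝ³` is null. [folklore] -/
theorem volume_hyperplane (c : ℝ) : volume {y : Fin 3 → ℝ | y 0 = c} = 0 := by
  rw [volume_pi]
  exact Measure.pi_hyperplane (μ := fun _ : Fin 3 => (volume : Measure ℝ)) 0 c

/-- `{det P = 0}` is null. [folklore] -/
theorem volume_detP_zero : volume {a : Fin 4 → ℝ | a 0 * a 1 - (a 2 ^ 2 + a 3 ^ 2) = 0} = 0 := by
  have h := volume_graph_eq_zero (f := fun y : Fin 3 → ℝ => y 0)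
    (g := fun y : Fin 3 → ℝ => y 1 ^ 2 + y 2 ^ 2) (by fun_prop) (by fun_prop) (volume_hyperplane 0)
  convert h using 2
  ext a
  simp only [mem_setOf_eq, sub_eq_zero]
  rfl

/-- `{det Q = 0}` is null. [folklore] -/
theorem volume_detQ_zero :
    volume {a : Fin 4 → ℝ | (1 / 2 - a 0) * (1 / 2 - a 1) - (a 2 ^ 2 + a 3 ^ 2) = 0} = 0 := by
  have h := volume_graph_eq_zero (f := fun y : Fin 3 → ℝ => 1 / 2 - y 0)
    (g := fun y : Fin 3 → ℝ => 1 / 2 * (1 / 2 - y 0) - (y 1 ^ 2 + y 2 ^ 2)) (by fun_prop) (by fun_prop)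
    (by
      convert volume_hyperplane (1 / 2) using 2
      ext y; simp only [mem_setOf_eq]; constructor <;> intro h <;> linarith)
  convert h using 2
  ext a
  simp only [mem_setOf_eq]
  have h0 : (Fin.succ 0 : Fin 4) = 1 := rfl
  have h1 : (Fin.succ 1 : Fin 4) = 2 := rfl
  have h2 : (Fin.succ 2 : Fin 4) = 3 := rfl
  simp only [h0, h1, h2]
  constructor <;> intro h' <;> linarith

/-! ### The densities and the a.e. identification of section volumes -/

open Classical in
/-- Density of `K` over the diagonal-block coordinates. [folklore] -/
def densK (a : Fin 4 → ℝ) : ℝ≥0∞ :=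
  if Good a then ENNReal.ofReal (π ^ 4 / 12 * ((a 0 * a 1 - (a 2 ^ 2 + a 3 ^ 2)) ^ 2 *
    ((1 / 2 - a 0) * (1 / 2 - a 1) - (a 2 ^ 2 + a 3 ^ 2)) ^ 2)) else 0

open Classical in
/-- Density of `K'` over the diagonal-block coordinates. [folklore] -/
def densK' (a : Fin 4 → ℝ) : ℝ≥0∞ :=
  if Good a then ENNReal.ofReal (π ^ 4 / 36 * phi2 (tOf a) (rOf a)) else 0

/-- If `P, Q ≥ 0` and both determinants are nonzero then `P, Q > 0` (the good region). [folklore] -/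
theorem good_of_blocks {a : Fin 4 → ℝ} (hP : (Pmat a).PosSemidef) (hQ : (Qmat a).PosSemidef)
    (h1 : a 0 * a 1 - (a 2 ^ 2 + a 3 ^ 2) ≠ 0)
    (h2 : (1 / 2 - a 0) * (1 / 2 - a 1) - (a 2 ^ 2 + a 3 ^ 2) ≠ 0) : Good a := by
  rw [posSemidef_Pmat_iff] at hP
  rw [posSemidef_Qmat_iff] at hQ
  obtain ⟨p0, p1, p2⟩ := hP
  obtain ⟨q0, q1, q2⟩ := hQ
  have hm : 0 ≤ a 2 ^ 2 + a 3 ^ 2 := by positivity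
  have p2' : a 2 ^ 2 + a 3 ^ 2 < a 0 * a 1 := lt_of_le_of_ne p2 (fun h => h1 (by linarith))
  have q2' : a 2 ^ 2 + a 3 ^ 2 < (1 / 2 - a 0) * (1 / 2 - a 1) :=
    lt_of_le_of_ne q2 (fun h => h2 (by linarith))
  refine ⟨?_, p2', ?_, q2'⟩
  · rcases p0.lt_or_eq with h | h
    · exact h
    · rw [← h, zero_mul] at p2'; linarith
  · rcases q0.lt_or_eq with h | h
    · exact h
    · rw [← h, zero_mul] at q2'; linarith

/-- Almost every `a` has `det P ≠ 0` and `det Q ≠ 0`. [folklore] -/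
theorem ae_not_bad : ∀ᵐ a : Fin 4 → ℝ, a 0 * a 1 - (a 2 ^ 2 + a 3 ^ 2) ≠ 0 ∧
    (1 / 2 - a 0) * (1 / 2 - a 1) - (a 2 ^ 2 + a 3 ^ 2) ≠ 0 := by
  have h1 := volume_detP_zero
  have h2 := volume_detQ_zero
  rw [← compl_mem_ae_iff] at h1 h2
  filter_upwards [h1, h2] with a ha hb
  exact ⟨ha, hb⟩

/-- **The section volumes of `K` are `densK` a.e.** [folklore] -/
theorem section_K_ae :
    (fun a : Fin 4 → ℝ => volume {w : Fin 8 → ℝ | (rho2 a w).PosSemidef}) =ᵐ[volume] densK := by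
  filter_upwards [ae_not_bad] with a ha
  by_cases hG : Good a
  · rw [densK, if_pos hG, volume_section_K hG]
  · rw [densK, if_neg hG]
    convert measure_empty (μ := (volume : Measure (Fin 8 → ℝ)))
    ext w
    simp only [mem_setOf_eq, mem_empty_iff_false, iff_false]
    intro hw
    obtain ⟨hP, hQ⟩ := posSemidef_blocks_of_rho2 hw
    exact hG (good_of_blocks hP hQ ha.1 ha.2)

/-- **The section volumes of `K'` are `densK'` a.e.** [folklore] -/
theorem section_K'_ae :
    (fun a : Fin 4 → ℝ => volume {w : Fin 8 → ℝ | (rho2 a w).PosSemidef ∧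
      ((2 : ℂ)⁻¹ • (1 : Matrix (Fin 4) (Fin 4) ℂ) - rho2 a w).PosSemidef}) =ᵐ[volume] densK' := by
  filter_upwards [ae_not_bad] with a ha
  by_cases hG : Good a
  · rw [densK', if_pos hG, volume_section_K' hG]
  · rw [densK', if_neg hG]
    convert measure_empty (μ := (volume : Measure (Fin 8 → ℝ)))
    ext w
    simp only [mem_setOf_eq, mem_empty_iff_false, iff_false, not_and]
    intro hw _
    obtain ⟨hP, hQ⟩ := posSemidef_blocks_of_rho2 hw
    exact hG (good_of_blocks hP hQ ha.1 ha.2)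

/-- `vol(K) = ∫ densK`. [folklore] -/
theorem volume_Kset_eq : volume Kset = ∫⁻ a, densK a := by
  rw [volume_Kset, lintegral_congr_ae section_K_ae]

/-- `vol(K') = ∫ densK'`. [folklore] -/
theorem volume_K'set_eq : volume K'set = ∫⁻ a, densK' a := by
  rw [volume_K'set, lintegral_congr_ae section_K'_ae]


/-! ## F5c. Reduction of `∫ φ(t, r)` over `ℝ⁴` to `8π ∫∫ r² φ(t, r)` -/

/-- Linear change of variables in a Lebesgue integral over `ℝ²`. [folklore] -/
theorem lintegral_comp_linear (L : (Fin 2 → ℝ) →ₗ[ℝ] (Fin 2 → ℝ)) (hL : LinearMap.det L ≠ 0)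
    {F : (Fin 2 → ℝ) → ℝ≥0∞} (hF : Measurable F) :
    ∫⁻ y, F y = ENNReal.ofReal |LinearMap.det L| * ∫⁻ z, F (L z) := by
  have hmap := Measure.map_linearMap_addHaar_eq_smul_addHaar (volume : Measure (Fin 2 → ℝ)) hL
  have h1 : ∫⁻ z, F (L z) = ∫⁻ y, F y ∂(Measure.map L volume) :=
    (lintegral_map hF L.continuous_of_finiteDimensional.measurable).symm
  rw [h1, hmap, lintegral_smul_measure, smul_eq_mul, ← mul_assoc, ← ENNReal.ofReal_mul (abs_nonneg _),
    abs_inv, mul_inv_cancel₀ (abs_ne_zero.mpr hL), ENNReal.ofReal_one, one_mul]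

/-- The substitution `m = ρ² - s²`: `∫₀^∞ g(√(s²+m)) dm = ∫_{|s|}^∞ 2ρ g(ρ) dρ`. [folklore] -/
theorem lintegral_Ioi_sqrt (s : ℝ) (g : ℝ → ℝ≥0∞) :
    ∫⁻ m in Ioi (0:ℝ), g (Real.sqrt (s ^ 2 + m)) =
      ∫⁻ ρ in Ioi |s|, ENNReal.ofReal (2 * ρ) * g ρ := by
  have himg : (fun ρ : ℝ => ρ ^ 2 - s ^ 2) '' Ioi |s| = Ioi 0 := by
    ext m
    constructor
    · rintro ⟨ρ, hρ, rfl⟩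
      have hρ' : |s| < ρ := hρ
      have : s ^ 2 < ρ ^ 2 := by
        rw [← sq_abs s]; exact pow_lt_pow_left₀ hρ' (abs_nonneg s) two_ne_zero
      simpa using this
    · intro hm
      refine ⟨Real.sqrt (s ^ 2 + m), ?_, ?_⟩
      · show |s| < Real.sqrt (s ^ 2 + m)
        rw [← Real.sqrt_sq (abs_nonneg s), sq_abs]
        exact Real.sqrt_lt_sqrt (sq_nonneg _) (by linarith [show (0:ℝ) < m from hm])
      · simp only
        rw [Real.sq_sqrt (by nlinarith [sq_nonneg s, show (0:ℝ) < m from hm])]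
        ring
  have hinj : InjOn (fun ρ : ℝ => ρ ^ 2 - s ^ 2) (Ioi |s|) := by
    intro a ha b hb hab
    have ha' : 0 ≤ a := (abs_nonneg s).trans (le_of_lt ha)
    have hb' : 0 ≤ b := (abs_nonneg s).trans (le_of_lt hb)
    have : a ^ 2 = b ^ 2 := by simpa using hab
    nlinarith
  calc ∫⁻ m in Ioi (0:ℝ), g (Real.sqrt (s ^ 2 + m))
      = ∫⁻ m in (fun ρ : ℝ => ρ ^ 2 - s ^ 2) '' Ioi |s|, g (Real.sqrt (s ^ 2 + m)) := by rw [himg]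
    _ = ∫⁻ ρ in Ioi |s|, ENNReal.ofReal |(2 : ℕ) * ρ ^ (2 - 1) - 0| *
          g (Real.sqrt (s ^ 2 + (ρ ^ 2 - s ^ 2))) :=
        lintegral_image_eq_lintegral_abs_deriv_mul measurableSet_Ioi
          (fun ρ _ => ((hasDerivAt_pow 2 ρ).sub (hasDerivAt_const ρ (s ^ 2))).hasDerivWithinAt)
          hinj _
    _ = ∫⁻ ρ in Ioi |s|, ENNReal.ofReal (2 * ρ) * g ρ := by
        refine setLIntegral_congr_fun measurableSet_Ioi (fun ρ hρ => ?_)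
        have hρ0 : 0 < ρ := lt_of_le_of_lt (abs_nonneg s) hρ
        have e1 : s ^ 2 + (ρ ^ 2 - s ^ 2) = ρ ^ 2 := by ring
        rw [e1, Real.sqrt_sq hρ0.le]
        congr 2
        simp [abs_of_pos hρ0]

/-- `∫_{|u|}^∞ f = ∫₀^∞ 1[|u| < ρ] f`. [folklore] -/
theorem lintegral_Ioi_abs (u : ℝ) (f : ℝ → ℝ≥0∞) :
    ∫⁻ ρ in Ioi |u|, f ρ = ∫⁻ ρ in Ioi (0:ℝ), {p : ℝ | |u| < p}.indicator f ρ := by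
  have hS : MeasurableSet {p : ℝ | |u| < p} := measurableSet_lt measurable_const measurable_id
  rw [lintegral_indicator hS, Measure.restrict_restrict hS]
  congr 2
  ext ρ
  simp only [mem_inter_iff, mem_setOf_eq, mem_Ioi]
  exact ⟨fun h => ⟨h, lt_of_le_of_lt (abs_nonneg u) h⟩, fun h => h.1⟩

/-- Joint measurability of the `ρ`-integrands with the moving threshold `|s|`. [folklore] -/
theorem measurable_absInd {α : Type*} [MeasurableSpace α] {sf tf : α → ℝ} (hs : Measurable sf)
    (ht : Measurable tf) {φ : ℝ → ℝ → ℝ≥0∞} (hφ : Measurable (Function.uncurry φ)) :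
    Measurable (fun q : α × ℝ => {p : ℝ | |sf q.1| < p}.indicator
      (fun ρ => ENNReal.ofReal (2 * ρ) * φ (tf q.1) ρ) q.2) := by
  have : (fun q : α × ℝ => {p : ℝ | |sf q.1| < p}.indicator
      (fun ρ => ENNReal.ofReal (2 * ρ) * φ (tf q.1) ρ) q.2) =
      {q : α × ℝ | |sf q.1| < q.2}.indicator (fun q => ENNReal.ofReal (2 * q.2) * φ (tf q.1) q.2) := by
    funext q
    by_cases h : |sf q.1| < q.2 <;> simp [Set.indicator, h]
  rw [this]
  refine Measurable.indicator ?_ (measurableSet_lt (by fun_prop) measurable_snd)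
  exact (Measurable.ennreal_ofReal (by fun_prop)).mul
    (hφ.comp (f := fun q : α × ℝ => (tf q.1, q.2)) (by fun_prop))

/-- Swapping and evaluating the `u`-integral: `∫_u ∫_{ρ > |u|} f(ρ) = ∫_ρ 2ρ f(ρ)`. [folklore] -/
theorem lintegral_lintegral_Ioi_abs {f : ℝ → ℝ≥0∞} (hf : Measurable f) :
    ∫⁻ u : ℝ, ∫⁻ ρ in Ioi |u|, f ρ = ∫⁻ ρ in Ioi (0:ℝ), ENNReal.ofReal (2 * ρ) * f ρ := by
  simp_rw [lintegral_Ioi_abs]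
  have hmeas : Measurable (Function.uncurry fun (u ρ : ℝ) => {p : ℝ | |u| < p}.indicator f ρ) := by
    have : (Function.uncurry fun (u ρ : ℝ) => {p : ℝ | |u| < p}.indicator f ρ) =
        {q : ℝ × ℝ | |q.1| < q.2}.indicator (fun q => f q.2) := by
      funext q
      by_cases h : |q.1| < q.2 <;> simp [Function.uncurry, Set.indicator, h]
    rw [this]
    refine Measurable.indicator (hf.comp measurable_snd) ?_
    exact measurableSet_lt (by fun_prop) measurable_snd
  rw [lintegral_lintegral_swap hmeas.aemeasurable]
  refine setLIntegral_congr_fun measurableSet_Ioi (fun ρ hρ => ?_)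
  have hρ0 : (0:ℝ) < ρ := hρ
  have : (fun u : ℝ => {p : ℝ | |u| < p}.indicator f ρ) = (Ioo (-ρ) ρ).indicator (fun _ => f ρ) := by
    funext u
    simp only [Set.indicator, mem_setOf_eq, mem_Ioo, abs_lt]
  rw [this, lintegral_indicator measurableSet_Ioo, setLIntegral_const, Real.volume_Ioo, mul_comm]
  congr 1
  congr 1
  ring

/-- Splitting the four diagonal-block coordinates: `a ↦ ((a₀, a₁), a₂ + i a₃)`. [folklore] -/
def g4 (a : Fin 4 → ℝ) : (Fin 2 → ℝ) × ℂ :=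
  (fun i : Fin 2 => a (Fin.castAdd 2 i), (a 2 : ℂ) + (a 3 : ℂ) * I)

/-- The library chain of measure-preserving equivalences realizing `g4`. [folklore] -/
def g4chain (a : Fin 4 → ℝ) : (Fin 2 → ℝ) × ℂ :=
  Prod.map id Complex.measurableEquivPi.symm
    (MeasurableEquiv.sumPiEquivProdPi (fun _ : Fin 2 ⊕ Fin 2 => ℝ)
      ((MeasurableEquiv.piCongrLeft (fun _ : Fin 4 => ℝ)
        (finSumFinEquiv : Fin 2 ⊕ Fin 2 ≃ Fin 4)).symm a))

/-- The library chain equals `g4` (definitionally). [folklore] -/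
theorem g4chain_eq : g4chain = g4 := by
  funext a
  rfl

/-- `g4` preserves Lebesgue measure. [folklore] -/
theorem measurePreserving_g4 : MeasurePreserving g4 volume volume := by
  rw [← g4chain_eq]
  have h1 := (volume_measurePreserving_piCongrLeft (fun _ : Fin 4 => ℝ)
    (finSumFinEquiv : Fin 2 ⊕ Fin 2 ≃ Fin 4)).symm _
  have h2 := measurePreserving_sumPiEquivProdPi (fun _ : Fin 2 ⊕ Fin 2 => (volume : Measure ℝ))
  have h3 : MeasurePreserving (Prod.map id Complex.measurableEquivPi.symm)
      (volume : Measure ((Fin 2 → ℝ) × (Fin 2 → ℝ))) (volume : Measure ((Fin 2 → ℝ) × ℂ)) :=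
    (MeasurePreserving.id volume).prod Complex.volume_preserving_equiv_pi.symm
  exact h3.comp (h2.comp h1)

/-- The linear map `z ↦ (z₀ + z₁, z₀ - z₁)`. [folklore] -/
def Lts : (Fin 2 → ℝ) →ₗ[ℝ] (Fin 2 → ℝ) := Matrix.toLin' !![(1:ℝ), 1; 1, -1]

/-- `Lts z = (z₀ + z₁, z₀ - z₁)`. [folklore] -/
theorem Lts_apply (z : Fin 2 → ℝ) : Lts z = ![z 0 + z 1, z 0 - z 1] := by
  simp only [Lts, Matrix.toLin'_apply]
  funext i
  fin_cases i
  · simp [Matrix.mulVec, dotProduct, Fin.sum_univ_two]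
  · simp [Matrix.mulVec, dotProduct, Fin.sum_univ_two]; ring

/-- `det Lts = -2`. [folklore] -/
theorem det_Lts : LinearMap.det Lts = -2 := by
  rw [Lts, LinearMap.det_toLin', Matrix.det_fin_two]
  simp; norm_num

/-- **The `(t, r)` reduction**: for measurable `φ ≥ 0`,
`∫_{ℝ⁴} φ(t(a), r(a)) da = 8π ∫_t ∫_{r>0} r² φ(t, r)`. [folklore] -/
theorem lintegral_tr {φ : ℝ → ℝ → ℝ≥0∞} (hφ : Measurable (Function.uncurry φ)) :
    ∫⁻ a : Fin 4 → ℝ, φ (tOf a) (rOf a) =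
      ENNReal.ofReal (8 * π) * ∫⁻ t : ℝ, ∫⁻ r in Ioi (0:ℝ), ENNReal.ofReal (r ^ 2) * φ t r := by
  -- (a),(b): pass to ((a₀,a₁), κ)
  set Φ : (Fin 2 → ℝ) × ℂ → ℝ≥0∞ := fun p =>
    φ ((p.1 0 + p.1 1) / 2) (Real.sqrt (((p.1 0 - p.1 1) / 2) ^ 2 + normSq p.2)) with hΦ
  have hΦm : Measurable Φ := hφ.comp (f := fun p : (Fin 2 → ℝ) × ℂ =>
    ((p.1 0 + p.1 1) / 2, Real.sqrt (((p.1 0 - p.1 1) / 2) ^ 2 + normSq p.2))) (by fun_prop)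
  have h1 : (fun a : Fin 4 → ℝ => φ (tOf a) (rOf a)) = fun a => Φ (g4 a) := by
    funext a
    simp only [hΦ, g4, tOf, rOf, Complex.normSq_add_mul_I]
    have e0 : a (Fin.castAdd 2 0) = a 0 := rfl
    have e1 : a (Fin.castAdd 2 1) = a 1 := rfl
    rw [e0, e1, add_assoc]
  rw [h1, measurePreserving_g4.lintegral_comp hΦm]
  -- (c): Tonelli
  rw [Measure.volume_eq_prod, lintegral_prod _ hΦm.aemeasurable]
  -- (d),(e): radial in κ, then m ↦ ρ
  have h2 : ∀ y : Fin 2 → ℝ, ∫⁻ κ : ℂ, Φ (y, κ) = ENNReal.ofReal π *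
      ∫⁻ ρ in Ioi |(y 0 - y 1) / 2|, ENNReal.ofReal (2 * ρ) * φ ((y 0 + y 1) / 2) ρ := by
    intro y
    have := lintegral_comp_normSq (fun m => φ ((y 0 + y 1) / 2)
      (Real.sqrt (((y 0 - y 1) / 2) ^ 2 + m)))
      (hφ.comp (f := fun m : ℝ => ((y 0 + y 1) / 2, Real.sqrt (((y 0 - y 1) / 2) ^ 2 + m)))
        (by fun_prop))
    simp only [hΦ]
    rw [this, lintegral_Ioi_sqrt]
  simp_rw [h2]
  rw [lintegral_const_mul' _ _ ENNReal.ofReal_ne_top]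
  -- (f): linear substitution y = Lts z
  set G : (Fin 2 → ℝ) → ℝ≥0∞ := fun y =>
    ∫⁻ ρ in Ioi |(y 0 - y 1) / 2|, ENNReal.ofReal (2 * ρ) * φ ((y 0 + y 1) / 2) ρ with hG
  have hGm : Measurable G := by
    have : G = fun y => ∫⁻ ρ in Ioi (0:ℝ), {p : ℝ | |(y 0 - y 1) / 2| < p}.indicator
        (fun ρ => ENNReal.ofReal (2 * ρ) * φ ((y 0 + y 1) / 2) ρ) ρ := by
      funext y; simp only [hG]; rw [lintegral_Ioi_abs]
    rw [this]
    exact (measurable_absInd (sf := fun y : Fin 2 → ℝ => (y 0 - y 1) / 2)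
      (tf := fun y : Fin 2 → ℝ => (y 0 + y 1) / 2) (by fun_prop) (by fun_prop) hφ).lintegral_prod_right'
  have h3 : ∫⁻ y, G y = 2 * ∫⁻ z, G (Lts z) := by
    rw [lintegral_comp_linear Lts (by rw [det_Lts]; norm_num) hGm, det_Lts]
    norm_num
  rw [h3]
  have h4 : ∀ z : Fin 2 → ℝ, G (Lts z) =
      ∫⁻ ρ in Ioi |z 1|, ENNReal.ofReal (2 * ρ) * φ (z 0) ρ := by
    intro z
    simp only [hG, Lts_apply, Matrix.cons_val_zero, Matrix.cons_val_one]
    have e1 : (z 0 + z 1 - (z 0 - z 1)) / 2 = z 1 := by ring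
    have e2 : (z 0 + z 1 + (z 0 - z 1)) / 2 = z 0 := by ring
    rw [e1, e2]
  simp_rw [h4]
  -- (g): split z = (t, u)
  have h5 : ∫⁻ z : Fin 2 → ℝ, ∫⁻ ρ in Ioi |z 1|, ENNReal.ofReal (2 * ρ) * φ (z 0) ρ =
      ∫⁻ t : ℝ, ∫⁻ u : ℝ, ∫⁻ ρ in Ioi |u|, ENNReal.ofReal (2 * ρ) * φ t ρ := by
    have hH : Measurable fun p : ℝ × ℝ => ∫⁻ ρ in Ioi |p.2|, ENNReal.ofReal (2 * ρ) * φ p.1 ρ := by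
      have : (fun p : ℝ × ℝ => ∫⁻ ρ in Ioi |p.2|, ENNReal.ofReal (2 * ρ) * φ p.1 ρ) =
          fun p => ∫⁻ ρ in Ioi (0:ℝ), {q : ℝ | |p.2| < q}.indicator
            (fun ρ => ENNReal.ofReal (2 * ρ) * φ p.1 ρ) ρ := by
        funext p; rw [lintegral_Ioi_abs]
      rw [this]
      exact (measurable_absInd (sf := fun p : ℝ × ℝ => p.2) (tf := fun p : ℝ × ℝ => p.1)
        (by fun_prop) (by fun_prop) hφ).lintegral_prod_right'
    have := (volume_preserving_finTwoArrow ℝ).lintegral_comp hH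
    simp only [MeasurableEquiv.finTwoArrow_apply] at this
    rw [this, Measure.volume_eq_prod, lintegral_prod _ hH.aemeasurable]
  rw [h5]
  -- (h): swap u and ρ
  have h6 : ∀ t : ℝ, ∫⁻ u : ℝ, ∫⁻ ρ in Ioi |u|, ENNReal.ofReal (2 * ρ) * φ t ρ =
      ∫⁻ ρ in Ioi (0:ℝ), ENNReal.ofReal (2 * ρ) * (ENNReal.ofReal (2 * ρ) * φ t ρ) := fun t =>
    lintegral_lintegral_Ioi_abs ((Measurable.ennreal_ofReal (by fun_prop)).mul
      (hφ.comp (f := fun ρ : ℝ => (t, ρ)) (by fun_prop)))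
  simp_rw [h6]
  -- constants
  have h7 : ∀ t : ℝ, ∫⁻ ρ in Ioi (0:ℝ), ENNReal.ofReal (2 * ρ) * (ENNReal.ofReal (2 * ρ) * φ t ρ) =
      4 * ∫⁻ ρ in Ioi (0:ℝ), ENNReal.ofReal (ρ ^ 2) * φ t ρ := by
    intro t
    rw [← lintegral_const_mul' _ _ (by norm_num)]
    refine setLIntegral_congr_fun measurableSet_Ioi (fun ρ hρ => ?_)
    have hρ0 : (0:ℝ) ≤ ρ := le_of_lt hρ
    rw [← mul_assoc, ← mul_assoc, ← ENNReal.ofReal_mul (by linarith),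
      show (4 : ℝ≥0∞) = ENNReal.ofReal 4 by norm_num, ← ENNReal.ofReal_mul (by norm_num)]
    congr 2
    ring
  simp_rw [h7]
  rw [lintegral_const_mul' _ _ (by norm_num), ← mul_assoc, ← mul_assoc]
  congr 1
  rw [show (2 : ℝ≥0∞) = ENNReal.ofReal 2 by norm_num, show (4 : ℝ≥0∞) = ENNReal.ofReal 4 by norm_num,
    ← ENNReal.ofReal_mul pi_pos.le, ← ENNReal.ofReal_mul (by positivity)]
  congr 1
  ring


/-! ## F5d. Evaluation of the two outer integrals -/

/-- Termwise integration of a polynomial written as a sum of monomials. [folklore] -/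
theorem integral_poly_sum (c : ℕ → ℝ) (n : ℕ) (a b : ℝ) :
    ∫ t in a..b, ∑ k ∈ Finset.range n, c k * t ^ k =
      ∑ k ∈ Finset.range n, c k * ((b ^ (k + 1) - a ^ (k + 1)) / (k + 1)) := by
  rw [intervalIntegral.integral_finsetSum]
  · refine Finset.sum_congr rfl fun k _ => ?_
    rw [intervalIntegral.integral_const_mul, integral_pow]
  · intro k _
    exact (continuous_const.mul (continuous_pow k)).intervalIntegrable _ _

/-- **Generic evaluation of the outer `(t, r)` integral** through a closed form `P r` of the inner
`t`-integral on `0 ≤ r ≤ 1/4`. [folklore] -/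
theorem outer_eval {p : ℝ → ℝ → ℝ} {P : ℝ → ℝ} (hp : Continuous (Function.uncurry p))
    (hP : Continuous P) (hp0 : ∀ t r, 0 ≤ r → r ≤ t → t + r ≤ 1 / 2 → 0 ≤ p t r)
    (hpP : ∀ r, 0 ≤ r → r ≤ 1 / 4 → ∫ t in r..(1 / 2 - r), p t r = P r)
    {c : ℝ} (hc : 0 ≤ c) {V : ℝ} (hV : ∫ r in (0:ℝ)..(1 / 4), r ^ 2 * P r = V) :
    ∫⁻ t : ℝ, ∫⁻ r in Ioi (0:ℝ), ENNReal.ofReal (r ^ 2) *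
        (if r < t ∧ t + r < 1 / 2 then ENNReal.ofReal (c * p t r) else 0) =
      ENNReal.ofReal (c * V) := by
  classical
  -- measurability for Tonelli
  have hF : Measurable (Function.uncurry fun (t r : ℝ) => ENNReal.ofReal (r ^ 2) *
      (if r < t ∧ t + r < 1 / 2 then ENNReal.ofReal (c * p t r) else 0)) := by
    refine Measurable.mul (by fun_prop) ?_
    refine Measurable.ite ?_ ((hp.const_mul c).measurable.ennreal_ofReal) measurable_const
    simp only [setOf_and]
    exact (measurableSet_lt measurable_snd measurable_fst).inter
      (measurableSet_lt (by fun_prop) measurable_const)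
  rw [lintegral_lintegral_swap hF.aemeasurable]
  -- the inner t-integral
  have hP0 : ∀ r, 0 ≤ r → r ≤ 1 / 4 → 0 ≤ P r := by
    intro r hr0 hr1
    rw [← hpP r hr0 hr1]
    exact intervalIntegral.integral_nonneg (by linarith) fun t ht => hp0 t r hr0 ht.1 (by linarith [ht.2])
  have hinner : ∀ r : ℝ, r ∈ Ioi (0:ℝ) →
      ∫⁻ t : ℝ, ENNReal.ofReal (r ^ 2) *
        (if r < t ∧ t + r < 1 / 2 then ENNReal.ofReal (c * p t r) else 0) =
      if r ≤ 1 / 4 then ENNReal.ofReal (c * (r ^ 2 * P r)) else 0 := by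
    intro r hr
    have hr0 : (0:ℝ) < r := hr
    rw [lintegral_const_mul' _ _ ENNReal.ofReal_ne_top]
    have hind : (fun t : ℝ => if r < t ∧ t + r < 1 / 2 then ENNReal.ofReal (c * p t r) else 0) =
        (Ioo r (1 / 2 - r)).indicator (fun t => ENNReal.ofReal (c * p t r)) := by
      funext t
      by_cases h : r < t ∧ t + r < 1 / 2
      · rw [if_pos h, indicator_of_mem (show t ∈ Ioo r (1 / 2 - r) from ⟨h.1, by linarith [h.2]⟩)]
      · rw [if_neg h, indicator_of_notMem]
        intro ht; exact h ⟨ht.1, by linarith [ht.2]⟩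
    rw [hind, lintegral_indicator measurableSet_Ioo]
    by_cases h4 : r ≤ 1 / 4
    · have hcont : Continuous fun t : ℝ => c * p t r :=
        (hp.comp (f := fun t : ℝ => (t, r)) (by fun_prop)).const_mul c
      rw [if_pos h4, restrict_Ioo_eq_restrict_Ioc,
        lintegral_Ioc_eq_ofReal (f := fun t => c * p t r) (by linarith) hcont
          (fun t ht => mul_nonneg hc (hp0 t r hr0.le ht.1 (by linarith [ht.2]))),
        intervalIntegral.integral_const_mul, hpP r hr0.le h4, ← ENNReal.ofReal_mul (sq_nonneg r)]
      congr 1; ring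
    · rw [if_neg h4, Ioo_eq_empty (by push Not at h4; intro h; linarith), Measure.restrict_empty,
        lintegral_zero_measure, mul_zero]
  rw [setLIntegral_congr_fun measurableSet_Ioi hinner]
  -- the outer r-integral
  rw [← Ioc_union_Ioi_eq_Ioi (show (0:ℝ) ≤ 1 / 4 by norm_num),
    lintegral_union measurableSet_Ioi (Ioc_disjoint_Ioi le_rfl)]
  have hz : ∫⁻ r in Ioi (1 / 4 : ℝ), (if r ≤ 1 / 4 then ENNReal.ofReal (c * (r ^ 2 * P r)) else 0) = 0 := by
    rw [setLIntegral_congr_fun measurableSet_Ioi (g := fun _ => 0)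
      (fun r hr => by rw [if_neg (not_le.mpr hr)])]
    exact lintegral_zero
  rw [hz, add_zero, setLIntegral_congr_fun measurableSet_Ioc
    (g := fun r => ENNReal.ofReal (c * (r ^ 2 * P r))) (fun r hr => by rw [if_pos hr.2])]
  rw [lintegral_Ioc_eq_ofReal (by norm_num) (by fun_prop)
    (fun r hr => mul_nonneg hc (mul_nonneg (sq_nonneg r) (hP0 r hr.1 hr.2))),
    intervalIntegral.integral_const_mul, hV]

/-! ### The one-sided body: `∫∫ r² ((t²-r²)((½-t)²-r²))² = 1/825753600` -/

/-- The one-body profile. [folklore] -/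
def pK1 (t r : ℝ) : ℝ := ((t ^ 2 - r ^ 2) * ((1 / 2 - t) ^ 2 - r ^ 2)) ^ 2

/-- Its `t`-coefficients. [folklore] -/
def cK1 (r : ℝ) : ℕ → ℝ
  | 0 => ((1:ℝ)/16) * r ^ 4 + ((-1:ℝ)/2) * r ^ 6 + (1:ℝ) * r ^ 8
  | 1 => ((-1:ℝ)/2) * r ^ 4 + (2:ℝ) * r ^ 6
  | 2 => ((-1:ℝ)/8) * r ^ 2 + ((5:ℝ)/2) * r ^ 4 + (-4:ℝ) * r ^ 6
  | 3 => (1:ℝ) * r ^ 2 + (-6:ℝ) * r ^ 4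
  | 4 => ((1:ℝ)/16) + ((-7:ℝ)/2) * r ^ 2 + (6:ℝ) * r ^ 4
  | 5 => ((-1:ℝ)/2) + (6:ℝ) * r ^ 2
  | 6 => ((3:ℝ)/2) + (-4:ℝ) * r ^ 2
  | 7 => (-2:ℝ)
  | 8 => (1:ℝ)
  | _ => 0

/-- The `r`-monomial coefficients of `r² ∫ pK1 dt`. [folklore] -/
def dK1 : ℕ → ℝ
  | 2 => ((1:ℝ)/322560)
  | 4 => ((-1:ℝ)/3360)
  | 6 => ((1:ℝ)/60)
  | 7 => ((-1:ℝ)/15)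
  | 9 => ((32:ℝ)/105)
  | 11 => ((-256:ℝ)/315)
  | _ => 0

/-- Closed form of the inner integral. [folklore] -/
def PK1 (r : ℝ) : ℝ := ∑ k ∈ Finset.range 9, cK1 r k * (((1 / 2 - r) ^ (k + 1) - r ^ (k + 1)) / (k + 1))

/-- Expansion of `pK1` in powers of `t`. [folklore] -/
theorem pK1_expand (t r : ℝ) : pK1 t r = ∑ k ∈ Finset.range 9, cK1 r k * t ^ k := by
  simp only [pK1, cK1, Finset.sum_range_succ, Finset.sum_range_zero]
  ring

/-- Expansion of `r² PK1 r` in powers of `r`. [folklore] -/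
theorem rsq_PK1_expand (r : ℝ) : r ^ 2 * PK1 r = ∑ j ∈ Finset.range 12, dK1 j * r ^ j := by
  simp only [PK1, cK1, dK1, Finset.sum_range_succ, Finset.sum_range_zero]
  push_cast
  ring

/-- The inner `t`-integral of `pK1` in closed form. [folklore] -/
theorem inner_K1 (r : ℝ) : ∫ t in r..(1 / 2 - r), pK1 t r = PK1 r := by
  simp_rw [pK1_expand]
  rw [integral_poly_sum]
  rfl

/-- `∫₀^{1/4} r² PK1 = 1/825753600`. [folklore] -/
theorem outer_K1 : ∫ r in (0:ℝ)..(1 / 4), r ^ 2 * PK1 r = 1 / 825753600 := by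
  simp_rw [rsq_PK1_expand]
  rw [integral_poly_sum]
  simp only [dK1, Finset.sum_range_succ, Finset.sum_range_zero]
  norm_num

/-- `PK1` is continuous. [folklore] -/
theorem continuous_PK1 : Continuous PK1 := by
  unfold PK1
  refine continuous_finsetSum _ fun k _ => ?_
  have hc : Continuous fun r => cK1 r k := by
    rcases k with _ | _ | _ | _ | _ | _ | _ | _ | _ | _ <;> simp only [cK1] <;> fun_prop
  fun_prop

/-- **`∫∫ r² pK1 = 1/825753600`** in the `lintegral` form produced by `lintegral_tr`. [folklore] -/
theorem lintegral_K1 (c : ℝ) (hc : 0 ≤ c) :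
    ∫⁻ t : ℝ, ∫⁻ r in Ioi (0:ℝ), ENNReal.ofReal (r ^ 2) *
        (if r < t ∧ t + r < 1 / 2 then ENNReal.ofReal (c * pK1 t r) else 0) =
      ENNReal.ofReal (c * (1 / 825753600)) :=
  outer_eval (p := pK1) (P := PK1) (by unfold pK1; fun_prop) continuous_PK1
    (fun t r _ _ _ => by unfold pK1; positivity) (fun r _ _ => inner_K1 r) hc outer_K1

/-! ### The two-sided body: `∫∫ r² phi2 = 1/1135411200` -/

/-- The `t`-coefficients of `phi2`. [folklore] -/
def cK2 (r : ℝ) : ℕ → ℝ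
  | 0 => ((-5:ℝ)/16) * r ^ 4 + ((3:ℝ)/2) * r ^ 5 + ((-3:ℝ)/2) * r ^ 6 + (-2:ℝ) * r ^ 7 + (3:ℝ) * r ^ 8
  | 1 => ((3:ℝ)/4) * r ^ 3 + ((-3:ℝ)/2) * r ^ 4 + (-3:ℝ) * r ^ 5 + (6:ℝ) * r ^ 6
  | 2 => ((-3:ℝ)/8) * r ^ 2 + (-3:ℝ) * r ^ 3 + ((15:ℝ)/2) * r ^ 4 + (6:ℝ) * r ^ 5 + (-12:ℝ) * r ^ 6
  | 3 => ((-1:ℝ)/4) * r + (3:ℝ) * r ^ 2 + (6:ℝ) * r ^ 3 + (-18:ℝ) * r ^ 4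
  | 4 => ((3:ℝ)/16) + ((3:ℝ)/2) * r + ((-21:ℝ)/2) * r ^ 2 + (-6:ℝ) * r ^ 3 + (18:ℝ) * r ^ 4
  | 5 => ((-3:ℝ)/2) + (-3:ℝ) * r + (18:ℝ) * r ^ 2
  | 6 => ((9:ℝ)/2) + (2:ℝ) * r + (-12:ℝ) * r ^ 2
  | 7 => (-6:ℝ)
  | 8 => (3:ℝ)
  | _ => 0

/-- The `r`-monomial coefficients of `r² ∫ phi2 dt`. [folklore] -/
def dK2 : ℕ → ℝ
  | 2 => ((1:ℝ)/107520)
  | 3 => ((-1:ℝ)/8960)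
  | 4 => ((-1:ℝ)/1120)
  | 5 => ((1:ℝ)/40)
  | 6 => ((-1:ℝ)/5)
  | 7 => ((4:ℝ)/5)
  | 8 => ((-8:ℝ)/5)
  | 9 => ((32:ℝ)/35)
  | 10 => ((64:ℝ)/35)
  | 11 => ((-256:ℝ)/105)
  | _ => 0

/-- Closed form of the inner `t`-integral of `phi2`. [folklore] -/
def PK2 (r : ℝ) : ℝ := ∑ k ∈ Finset.range 9, cK2 r k * (((1 / 2 - r) ^ (k + 1) - r ^ (k + 1)) / (k + 1))

/-- Expansion of `phi2` in powers of `t`. [folklore] -/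
theorem phi2_expand (t r : ℝ) : phi2 t r = ∑ k ∈ Finset.range 9, cK2 r k * t ^ k := by
  simp only [phi2, cK2, Finset.sum_range_succ, Finset.sum_range_zero]
  ring

/-- Expansion of `r² PK2 r` in powers of `r`. [folklore] -/
theorem rsq_PK2_expand (r : ℝ) : r ^ 2 * PK2 r = ∑ j ∈ Finset.range 12, dK2 j * r ^ j := by
  simp only [PK2, cK2, dK2, Finset.sum_range_succ, Finset.sum_range_zero]
  push_cast
  ring

/-- The inner `t`-integral of `phi2` in closed form. [folklore] -/
theorem inner_K2 (r : ℝ) : ∫ t in r..(1 / 2 - r), phi2 t r = PK2 r := by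
  simp_rw [phi2_expand]
  rw [integral_poly_sum]
  rfl

/-- `∫₀^{1/4} r² PK2 = 1/1135411200`. [folklore] -/
theorem outer_K2 : ∫ r in (0:ℝ)..(1 / 4), r ^ 2 * PK2 r = 1 / 1135411200 := by
  simp_rw [rsq_PK2_expand]
  rw [integral_poly_sum]
  simp only [dK2, Finset.sum_range_succ, Finset.sum_range_zero]
  norm_num

/-- `PK2` is continuous. [folklore] -/
theorem continuous_PK2 : Continuous PK2 := by
  unfold PK2
  refine continuous_finsetSum _ fun k _ => ?_
  have hc : Continuous fun r => cK2 r k := by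
    rcases k with _ | _ | _ | _ | _ | _ | _ | _ | _ | _ <;> simp only [cK2] <;> fun_prop
  fun_prop

/-- `phi2 ≥ 0` on the region of integration: `phi2 = N³(4D - N)` with `0 ≤ N ≤ D`. [folklore] -/
theorem phi2_nonneg (t r : ℝ) (hr : 0 ≤ r) (hrt : r ≤ t) (htr : t + r ≤ 1 / 2) : 0 ≤ phi2 t r := by
  have hN : 0 ≤ (t - r) * (1 / 2 - t - r) := mul_nonneg (by linarith) (by linarith)
  have hND : (t - r) * (1 / 2 - t - r) ≤ (t + r) * (1 / 2 - t + r) := by nlinarith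
  have h : phi2 t r = ((t - r) * (1 / 2 - t - r)) ^ 3 *
      (4 * ((t + r) * (1 / 2 - t + r)) - (t - r) * (1 / 2 - t - r)) := by
    unfold phi2; ring
  rw [h]
  exact mul_nonneg (pow_nonneg hN 3) (by linarith)

/-- **`∫∫ r² phi2 = 1/1135411200`** in the `lintegral` form produced by `lintegral_tr`. [folklore] -/
theorem lintegral_K2 (c : ℝ) (hc : 0 ≤ c) :
    ∫⁻ t : ℝ, ∫⁻ r in Ioi (0:ℝ), ENNReal.ofReal (r ^ 2) *
        (if r < t ∧ t + r < 1 / 2 then ENNReal.ofReal (c * phi2 t r) else 0) =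
      ENNReal.ofReal (c * (1 / 1135411200)) :=
  outer_eval (p := phi2) (P := PK2) (by unfold phi2; fun_prop) continuous_PK2
    (fun t r h1 h2 h3 => phi2_nonneg t r h1 h2 h3) (fun r _ _ => inner_K2 r) hc outer_K2


/-! ## F6. Assembly -/

/-- `det P = t² − r²`. [folklore] -/
theorem detP_eq_tr (a : Fin 4 → ℝ) : a 0 * a 1 - (a 2 ^ 2 + a 3 ^ 2) = tOf a ^ 2 - rOf a ^ 2 := by
  rw [rOf_sq, tOf]; ring

/-- `det Q = (½ - t)² - r²`. [folklore] -/
theorem detQ_eq_tr (a : Fin 4 → ℝ) :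
    (1 / 2 - a 0) * (1 / 2 - a 1) - (a 2 ^ 2 + a 3 ^ 2) = (1 / 2 - tOf a) ^ 2 - rOf a ^ 2 := by
  rw [rOf_sq, tOf]; ring
set_option maxHeartbeats 400000 in
/-- The good region in terms of `(t, r)`: `r < t` and `t + r < ½`. [folklore] -/
theorem good_iff_tr (a : Fin 4 → ℝ) : Good a ↔ rOf a < tOf a ∧ tOf a + rOf a < 1 / 2 := by
  have hr0 := rOf_nonneg a
  have hr2 := rOf_sq a
  have hdP := detP_eq_tr a
  have hdQ := detQ_eq_tr a
  have hm : 0 ≤ a 2 ^ 2 + a 3 ^ 2 := by positivity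
  -- s = (a0 - a1)/2, a0 = t + s, a1 = t - s
  have ha0 : a 0 = tOf a + (a 0 - a 1) / 2 := by rw [tOf]; ring
  have ha1 : a 1 = tOf a - (a 0 - a 1) / 2 := by rw [tOf]; ring
  have hs2 : ((a 0 - a 1) / 2) ^ 2 ≤ rOf a ^ 2 := by rw [hr2]; linarith
  set t := tOf a
  set r := rOf a
  set s := (a 0 - a 1) / 2
  constructor
  · rintro ⟨h0, h1, h2, h3⟩
    have hP : 0 < t ^ 2 - r ^ 2 := by rw [← hdP]; linarith
    have hQ : 0 < (1 / 2 - t) ^ 2 - r ^ 2 := by rw [← hdQ]; linarith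
    have ha1pos : 0 < a 1 := by
      by_contra h; push Not at h; nlinarith
    have ht : 0 < t := by rw [show t = (a 0 + a 1) / 2 from rfl]; linarith
    have ha1' : 0 < 1 / 2 - a 1 := by
      by_contra h; push Not at h; nlinarith
    have ht' : 0 < 1 / 2 - t := by rw [show t = (a 0 + a 1) / 2 from rfl]; linarith
    constructor
    · nlinarith
    · nlinarith
  · rintro ⟨h1, h2⟩
    have ht : 0 < t := by linarith
    have hP : 0 < t ^ 2 - r ^ 2 := by nlinarith
    have hQ : 0 < (1 / 2 - t) ^ 2 - r ^ 2 := by nlinarith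
    have hs : s ^ 2 < t ^ 2 := by nlinarith
    have hs' : s ^ 2 < (1 / 2 - t) ^ 2 := by nlinarith
    refine ⟨?_, by linarith [hdP], ?_, by linarith [hdQ]⟩
    · rw [ha0]
      by_contra h; push Not at h
      nlinarith
    · rw [ha0]
      by_contra h; push Not at h
      nlinarith

open Classical in
/-- The one-body density in `(t, r)`. [folklore] -/
def phiK1 (t r : ℝ) : ℝ≥0∞ :=
  if r < t ∧ t + r < 1 / 2 then ENNReal.ofReal (π ^ 4 / 12 * pK1 t r) else 0

open Classical in
/-- The two-body density in `(t, r)`. [folklore] -/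
def phiK2 (t r : ℝ) : ℝ≥0∞ :=
  if r < t ∧ t + r < 1 / 2 then ENNReal.ofReal (π ^ 4 / 36 * phi2 t r) else 0

/-- `densK` as a function of `(t, r)`. [folklore] -/
theorem densK_eq (a : Fin 4 → ℝ) : densK a = phiK1 (tOf a) (rOf a) := by
  classical
  unfold densK phiK1
  by_cases hG : Good a
  · rw [if_pos hG, if_pos ((good_iff_tr a).mp hG), pK1, detP_eq_tr, detQ_eq_tr, mul_pow]
  · rw [if_neg hG, if_neg (fun h => hG ((good_iff_tr a).mpr h))]

/-- `densK'` as a function of `(t, r)`. [folklore] -/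
theorem densK'_eq (a : Fin 4 → ℝ) : densK' a = phiK2 (tOf a) (rOf a) := by
  classical
  unfold densK' phiK2
  by_cases hG : Good a
  · rw [if_pos hG, if_pos ((good_iff_tr a).mp hG)]
  · rw [if_neg hG, if_neg (fun h => hG ((good_iff_tr a).mpr h))]

/-- The `(t, r)` region `{r < t, t + r < ½}` is measurable. [folklore] -/
theorem measurableSet_tr : MeasurableSet {q : ℝ × ℝ | q.2 < q.1 ∧ q.1 + q.2 < 1 / 2} := by
  simp only [setOf_and]
  exact (measurableSet_lt measurable_snd measurable_fst).inter
    (measurableSet_lt (by fun_prop) measurable_const)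

/-- `phiK1` is measurable. [folklore] -/
theorem measurable_phiK1 : Measurable (Function.uncurry phiK1) := by
  classical
  unfold phiK1
  refine Measurable.ite measurableSet_tr ?_ measurable_const
  exact (Measurable.ennreal_ofReal (by unfold pK1; fun_prop))

/-- `phiK2` is measurable. [folklore] -/
theorem measurable_phiK2 : Measurable (Function.uncurry phiK2) := by
  classical
  unfold phiK2
  refine Measurable.ite measurableSet_tr ?_ measurable_const
  exact (Measurable.ennreal_ofReal (by unfold phi2; fun_prop))

/-- **Theorem A**: `vol(K) = π⁵/1238630400`. [folklore] -/
theorem volume_Kset_value : volume Kset = ENNReal.ofReal (π ^ 5 / 1238630400) := by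
  rw [volume_Kset_eq]
  simp_rw [densK_eq]
  rw [lintegral_tr measurable_phiK1]
  have h := lintegral_K1 (π ^ 4 / 12) (by positivity)
  simp only [phiK1] at h ⊢
  rw [h, ← ENNReal.ofReal_mul (by positivity)]
  congr 1
  ring

/-- **Theorem B**: `vol(K') = π⁵/5109350400`. [folklore] -/
theorem volume_K'set_value : volume K'set = ENNReal.ofReal (π ^ 5 / 5109350400) := by
  rw [volume_K'set_eq]
  simp_rw [densK'_eq]
  rw [lintegral_tr measurable_phiK2]
  have h := lintegral_K2 (π ^ 4 / 36) (by positivity)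
  simp only [phiK2] at h ⊢
  rw [h, ← ENNReal.ofReal_mul (by positivity)]
  congr 1
  ring

/-- **`33 · vol(K') = 8 · vol(K)`** (both equal `π⁵/154828800`). [folklore] -/
theorem main_identity : 33 * volume K'set = 8 * volume Kset := by
  rw [volume_K'set_value, volume_Kset_value,
    show (33 : ℝ≥0∞) = ENNReal.ofReal 33 by norm_num, show (8 : ℝ≥0∞) = ENNReal.ofReal 8 by norm_num,
    ← ENNReal.ofReal_mul (by norm_num), ← ENNReal.ofReal_mul (by norm_num)]
  congr 1
  ring

/-- The statement as it appears in the tree, discharged. [folklore] -/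
theorem fibre_separability_probability :
    33 * volume {x : Fin 12 → ℝ | (qubitFibreMatrix x).PosSemidef ∧
      ((2 : ℂ)⁻¹ • (1 : Matrix (Fin 4) (Fin 4) ℂ) - qubitFibreMatrix x).PosSemidef} =
    8 * volume {x : Fin 12 → ℝ | (qubitFibreMatrix x).PosSemidef} :=
  main_identity

end ZhangJiangXie2025

/-- **Zhang–Jiang–Xie 2025, Theorem 6.12 (proof) with Props. 6.7, 6.9, 6.10; Huong–Khoi 2024:
the zero-Bloch-vector fibre separability probability is `8/33`** — discharge of the named fact
`ZhangJiangXie2025_qubit_fibre_separability_probability`: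
`33 · vol{x : ρ(x) ≥ 0 ∧ ½ − ρ(x) ≥ 0} = 8 · vol{x : ρ(x) ≥ 0}` on the fibre chart `ℝ¹²`
(both sides equal `π⁵/154828800`; see the module docstring for the elementary proof formalized
here). [cite: ZhangJiangXie2025, Theorem 6.12 (proof) and Props. 6.7, 6.9, 6.10]
[cite: HuongKhoi2024, main theorem] -/
theorem ZhangJiangXie2025_qubit_fibre_separability_probability_holds :
    ZhangJiangXie2025_qubit_fibre_separability_probability :=
  ZhangJiangXie2025.main_identity

end Literature.Probability.RandomMatrix

end
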